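import Literature.AlgebraicGeometry.HodgeTheory.WeilClassesFieldTypeOneTwoEndLevel
import Mathlib.Data.Prod.Lex
import HarnessLib

/-!
# Moonen–Zarhin's Criterion (2), TYPE 4 WITH `d = 2`: a QUATERNION algebra `D = E⟨α, β⟩` over a CM centre `E = ℚ(ψ)`
# (Rosati involution of the second kind) — «`W_F` decomposable ⟺ `θ = 0`» on `A` and on `A^{n+1}`, on the carrier and
# from `End(A)`-level data (Moonen–Zarhin 1998 §1, Criterion (2), case «`Y` of Type 4 with `d ≥ 2` or `m ≥ 2`»)

Layer `Literature/AlgebraicGeometry/HodgeTheory`; THEOREMS ONLY — no definition, no named fact, no `sorry` (D-0026, net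
debt 0).  The seat's type-4 files `WeilClassesFieldExceptionalOfCentralTorus` (the torus `U_E ⊂ G_div(X)`: an eigenvalue
IMBALANCE of `ψ^*` versus `ψ'^* = (ψ†)^*` on some `V_ρ` ⟹ all non-zero Weil classes exceptional — valid for every `d`),
`WeilClassesFieldCMCentreMatricesDecomposable` (BALANCE + adjoint-closed matrix units `U_{ab}† = U_{ba}` commuting with
`ψ^*` ⟹ decomposable) and `WeilClassesFieldCMCentreDichotomy` / `WeilClassesFieldCMFieldEndLevel` (the case `d = 1`,
`D = E`) left the case `d ≥ 2` open because the matrix units were only available for `D = E` (`U = 1`, or the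
`(πₐ ≫ ι_b)^*` of a power).  This file supplies them for `d = 2`: for a quaternion algebra `D = E⟨α, β⟩` over the CM
field `E` the involution is of the SECOND kind, it exchanges the simple factors of `D ⊗_ℚ ℂ = ∏_σ M₂(ℂ)` at `σ` and
`σ̄`, and `2 × 2` matrix units with `U_{ab}† = U_{ba}` are obtained by taking ANY matrix units on one half of the places
and their adjoint-transposes on the other half (§2) — the algebraic content of the print's «in this case `G_div(X)` is
connected» (no orthogonal factor, in contrast with type 3).  The CM-centre mechanism then gives the decomposable half,
and with the torus half the print's dichotomy «decomposable ⟺ `θ = 0`» for `d = 2` and every `m` (§4 on `A`, §5 on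
`A^{n+1}`), also from `End(A)`-level data (§6).  With the seat's rows for types 1, 2 (`…TypeOneTwoEndLevel`), type 3
(`…DefiniteQuaternionMatricesEndLevel`, `…DefiniteQuaternionDichotomy`, `…DefiniteQuaternionCentral`) and type 4 with
`d = 1` (`…CMFieldEndLevel`), every row of Criterion (2) with `d ≤ 2` is now in the tree in `End(A)`-level form.

## The print

B. J. J. Moonen, Yu. G. Zarhin, *Weil classes on abelian varieties*, J. reine angew. Math. **496** (1998) 83–92 =
arXiv:alg-geom/9612017 [MoonenZarhin1998WeilClasses] (held text `paper:arxiv-alg-geom_9612017`), §1 Criterion (2)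
(chunk p0003 L59–L80), VERBATIM: «Suppose `X` is isogenous to a power `Y^m` of a simple abelian variety `Y` … Then
either all classes in `W_F` are decomposable, or all non-zero classes in `W_F` are exceptional; this last possibility
occurs precisely in the following cases: … `Y` is of Type 4 with `d ≥ 2` or `m ≥ 2` and the map
`θ : E₋ ↪ End_F(V_X) —Tr_F→ F` is non-zero.»  Proof (chunk p0003 L92–L106): «Next assume that `X` is of type 4 with
either `m ≥ 2` or `d ≥ 2`.  We have `F ⊆ B = End⁰(X)`.  Since in this case `G_div(X)` is connected (see (Gdivprops)),
it acts trivially on `W_F` if and only if the composition `U_E = Z(G_div) ⊂ G_div(X) ↪ Gl_F(V_Y) —det_F→ F^*` is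
trivial.  The torus `U_E` being connected, this is the case if and only if the induced map on Lie algebras `θ : E₋ ↪
End_F(V_X) —Tr_F→ F` is zero.»  The places (chunk p0002 L104–L118): «`Δ ⊗ ℂ = ∏_τ Δ_ℂ^{(τ)}` … Type 4: `Δ_ℂ^{(τ)} ≅
M_{dm}(ℂ) × M_{dm}(ℂ)` with the involution exchanging the factors», Tables 1–2.
H. Lange, Ch. Birkenhake [LangeBirkenhake1992], §5.5: type IV — `End⁰` a central simple algebra of degree `d²` over a
CM field `E` with a positive involution of the second kind.
J. S. Milne [Milne1999LefschetzClasses], §1 pp. 642–644 (`C(A)`, `S(A)`, the Lefschetz group), §2 (semisimple algebras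
with involution), Thm. 3.2, Cor. 4.5.

## The data

ON THE CARRIER `H¹(A(ℂ); ℂ)` with `Q_h` (`h ∈ B¹ ⊗ ℂ`) non-degenerate: `T` (`= ψ^*`) killed by `R ∈ ℤ[X]` monic
irreducible over `ℚ`; its `Q_h`-adjoint `T'` (`= ψ'^*`, `ψ' = ψ†`) with `T' ∈ ℂ[T]` and `ker(T - σ) ∩ ker(T' - σ) = 0`
for all `σ` (CM: no real place); `Sa, Sb` (`= α^*, β^*`) commuting with `T`, anticommuting, `Sa² = a(T)`, `Sb² = b(T)`
with `a, b ∈ ℂ[X]` non-vanishing at the roots of `R`, and `Q_h(Sa x, y) = εa Q_h(x, Sa y)`, `Q_h(Sb x, y) =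
εb Q_h(x, Sb y)`, `εa² = εb² = 1` — generators of `D` over `E` adapted to the involution (`α† = ±α`, `β† = ±β`; by
Albert's theorem `D = D₀ ⊗_{E₀} E` with `D₀` a `†`-stable quaternion algebra over the real subfield `E₀`, and such
generators exist in `D₀`).  «`θ = 0`» is read, as in the `d = 1` files, as the eigenvalue BALANCE
`dim(V_ρ ∩ ker(T - σ)) = dim(V_ρ ∩ ker(T' - σ))` for every root `ρ` of `P` and every `σ`.
AT THE `End(A)` LEVEL (§6): `ψ` central in `End(A)`, `R(ψ) = 0`; `ψ' ∈ End(A)` with `Q_h(ψ^* x, y) = Q_h(x, ψ'^* y)`,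
`N'ψ' ∈ ℤ[ψ]` for some `N' ≠ 0` and `ψ' ≠ ψ`; `α, β` as above; `hD : ∀ g, ∃ N ≠ 0, N g ∈ ℤ⟨ψ, α, β⟩`
(«`End⁰(A) = D`»); `F = ℚ(φ)` for ANY `φ ∈ End(A)` resp. `End(A^{n+1})` with `P(φ) = 0`, `P` monic irreducible of
degree `e`, `e · 2m = 2 dim` (`m ≠ 0`).

## What is proved

* §0–§1 (private) polynomial, spectral and adjoint calculus; a half `H` of the live spectrum (`σ ∈ H ↔ σ̄ ∉ H`, by the
  lexicographic order of `ℂ`); the `2 × 2` block of two anticommuting involutions (`morita_block'`).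
* §2 **`exists_matrixUnits_adjoint_of_quaternionOver_CM`**: adjoint-closed `2 × 2` matrix units `U_{ab}` on `H¹`
  (`U_{ab} U_{cd} = δ_{bc} U_{ad}`, `Σ U_{aa} = 1`, `U_{ab}† = U_{ba}`, `[T, U_{ab}] = 0`, `U_{ab} ∈ ℂ⟨T, T', Sa, Sb⟩`,
  `Sa, Sb ∈ ℂ⟨T, U_{ab}⟩`): `U_{ab} = x_a y_b P_H + x'_a y'_b P'_H` with `(x, y)` the block of the normalised pair
  `s = Sa · a(T)^{-1/2}`, `t = Sb · b(T)^{-1/2}`, `(x', y')` the block of the adjoint pair `(εa Sa · a(T')^{-1/2},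
  εb Sb · b(T')^{-1/2})`, `P_H = Σ_{σ ∈ H} P_σ ∈ ℂ[T]` and `P'_H` the same polynomial in `T'` (`P_H† = P'_H`,
  `P_H + P'_H = 1`, `P_H P'_H = 0`).
* §3 **`weilClassesField_le_divisorClassesSpan_of_quaternionOver_CM_matrixUnits_of_forall_finrank_eq`** (+ `…_le_algebraicClasses_…`):
  for the data above together with an auxiliary adjoint-closed system of matrix units `W_{ab}` of pull-backs commuting
  with `T, Sa, Sb` and `φ^* ∈ ℂ⟨T, Sa, Sb, W_{ab}⟩`: BALANCE ⟹ `W_F ⊗ ℂ ≤ 𝒟ᵐ ⊗ ℂ` (the products `W_{ab} U_{ij}` are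
  adjoint-closed matrix units indexed by `ι × Fin 2`; then the seat's
  `CentralTorus.weilClassesField_le_divisorClassesSpan_of_matrixUnits_of_forall_finrank_eq`).
* §4 ON `A` (`W = 1`): `weilClassesField_le_divisorClassesSpan_of_quaternionOver_CMField_of_forall_finrank_eq`,
  `…_le_algebraicClasses_…`, and for `ψ^* ∈ C(A) ⊗ ℂ`:
  **`weilClassesField_le_divisorClassesSpan_iff_forall_finrank_eq_of_central_quaternionOver_CMField`**,
  **`weilClassesField_inf_divisorClassesSpan_eq_bot_iff_exists_finrank_ne_of_central_quaternionOver_CMField`**,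
  `weilClassesField_le_or_inf_divisorClassesSpan_eq_bot_of_central_quaternionOver_CMField` (THE DICHOTOMY).
* §5 ON `A^{n+1}` with the product polarization (`W_{ab} = (πₐ ≫ ι_b)^*`, diagonal data, `εa, εb ∈ {1, -1}`):
  `weilClassesField_biproduct_le_divisorClassesSpan_of_quaternionOver_CMField_of_forall_finrank_eq`,
  `…_biproduct_le_algebraicClasses_…`, **`…_biproduct_le_divisorClassesSpan_iff_forall_finrank_eq_of_central_…`**,
  **`…_biproduct_inf_divisorClassesSpan_eq_bot_iff_exists_finrank_ne_of_central_…`**, `…_biproduct_le_or_inf_…` (`ψ`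
  central in `End(A)`).
* §6 FROM `End(A)`: `pullbackOne_mem_adjoin_singleton_of_exists_zsmul_mem_closure_singleton` (`N'ψ' ∈ ℤ[ψ]` ⟹
  `ψ'^* ∈ ℂ[ψ^*]`), **`eigenspace_inf_eigenspace_eq_bot_of_ne_of_exists_zsmul_mem_closure_singleton`** (no real place from
  `ψ' ≠ ψ`, the seat's lemma with its hypothesis weakened to the one membership it uses), and the three statements on `A`
  (**`weilClassesField_le_divisorClassesSpan_iff_forall_finrank_eq_of_quaternionOverCMField_End`**,
  **`weilClassesField_inf_divisorClassesSpan_eq_bot_iff_exists_finrank_ne_of_quaternionOverCMField_End`**,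
  `weilClassesField_le_or_inf_divisorClassesSpan_eq_bot_of_quaternionOverCMField_End`) and on `A^{n+1}`
  (`weilClassesField_biproduct_…_of_quaternionOverCMField_End`), for EVERY `φ` (`hF` discharged by the seat's
  `pullbackOne_mem_adjoin_triple_…` / `pullbackOne_mem_adjoin_diagonal_…`).

## Scope (honest column)

As in the seat's other End-level files: the type is the PRESENTATION (`hD` + the Rosati data of the generators), not
Albert's classification, and positivity of the involution is not used; the existence of generators `α, β` adapted to the
involution (Albert's normal form `D = D₀ ⊗_{E₀} E`) is ASSUMED in the presentation, not derived; «`θ = 0`» is the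
eigenvalue balance on `H¹`, whose identification with the print's trace map is the one explained in
`WeilClassesFieldExceptionalOfCentralTorus` («Relation to the print»); `d ≥ 3` (a central division algebra of degree `d`
over `E`) is NOT covered — it needs adjoint-closed matrix units of size `d`, for which the tree's abstract
`Literature/RingTheory/SimpleModule/InvolutionWedderburnBlocks` (Milne §2) would be the starting point.  Everything is
on `ℂ`-points of Milne's `S(A)(h)` through the seat's carrier theorems; no algebraic groups, no connectedness argument.

## References

* [MoonenZarhin1998WeilClasses] B. J. J. Moonen, Yu. G. Zarhin, Weil classes on abelian varieties, J. reine angew.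
  Math. 496 (1998) 83–92; arXiv:alg-geom/9612017: §1 Criterion (2) and its proof (chunk p0003 L46–L106), Tables 1–2 and
  «Δ ⊗ ℂ = ∏_τ Δ_ℂ^{(τ)}» (chunk p0002 L60–L118).
* [Milne1999LefschetzClasses] J. S. Milne, Lefschetz classes on abelian varieties, Duke Math. J. 96 (1999) 639–675,
  §1 pp. 642–644, §2, Thm. 3.2, Cor. 4.5.
* [LangeBirkenhake1992] H. Lange, Ch. Birkenhake, Complex Abelian Varieties, Grundlehren 302 (1992), §1.1, §5.3, §5.5.
* [McconnellRobson2001] J. C. McConnell, J. C. Robson, Noncommutative Noetherian Rings, GSM 30 (AMS 2001), 3.5.5–3.5.7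
  (matrix units).
* [HatcherAT2002] A. Hatcher, Algebraic Topology (CUP 2002), Thm. 3.11 (graded commutativity).
* [VoisinHodgeI2002] C. Voisin, Hodge Theory and Complex Algebraic Geometry I (CUP 2002), Thm. 11.30 (Lefschetz (1,1)).

## Provenance

Lane `lit-hodgefound` (Track 2, Layer A), prover seat `lit-hodgefound-p21` (generation 24), row g24-#5 (successor note
(c) of generation 23: «type 4 with `d ≥ 2`», the quaternion case).
-/

noncomputable section

open CategoryTheory CategoryTheory.Limits Polynomial Module
open Literature.AlgebraicTopology.SingularHomology
open Literature.AlgebraicGeometry.Motives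
open Literature.AlgebraicGeometry.VanGeemen1994 (hodgeClassSpan pullbackOne)
open Literature.AlgebraicGeometry.Milne1999
open Literature.AlgebraicGeometry.Pohlmann1968 (sum_map_π_map_ι map_biproductMap_map_π)
open Literature.Barriers.HodgeConjecture (divisorClassesSpan)
open Literature.Geometry.Kaehler (lefschetzPow)
open Literature.LinearAlgebra

namespace Literature.AlgebraicGeometry.HodgeTheory

/-! ### §0 (private) polynomial, spectral and adjoint calculus -/

section Aux

variable {M : Type*} [AddCommGroup M] [Module ℂ M]

/-- `L ∘ q(f) = q(g) ∘ L` when `L ∘ f = g ∘ L`. [folklore] -/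
private theorem map_aeval_apply_of_semiconj' {N : Type*} [AddCommGroup N] [Module ℂ N] (L : M →ₗ[ℂ] N)
    (f : Module.End ℂ M) (g : Module.End ℂ N) (hc : ∀ v, L (f v) = g (L v)) (q : ℂ[X]) (v : M) :
    L (aeval f q v) = aeval g q (L v) := by
  induction q using Polynomial.induction_on' generalizing v with
  | add p q hp hq => rw [map_add, map_add, LinearMap.add_apply, LinearMap.add_apply, map_add, hp, hq]
  | monomial k c =>
    rw [aeval_monomial, aeval_monomial, Module.End.mul_apply, Module.End.mul_apply,
      Module.algebraMap_end_apply, Module.algebraMap_end_apply, map_smul]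
    congr 1
    induction k generalizing v with
    | zero => rw [pow_zero, pow_zero, Module.End.one_apply, Module.End.one_apply]
    | succ k ih => rw [pow_succ, pow_succ, Module.End.mul_apply, Module.End.mul_apply, ih, hc]

/-- `q(T)` commutes with `U` when `T` does. [folklore] -/
private theorem aeval_comm_of_comm' (T U : Module.End ℂ M) (hc : T * U = U * T) (q : ℂ[X]) :
    aeval T q * U = U * aeval T q := by
  refine LinearMap.ext fun v ↦ ?_
  rw [Module.End.mul_apply, Module.End.mul_apply]
  exact (map_aeval_apply_of_semiconj' U T T (fun v ↦ by rw [← Module.End.mul_apply, ← hc, Module.End.mul_apply]) q v).symm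

/-- Functional calculus on an eigen-idempotent: `T P = z P ⟹ q(T) P = q(z) P`. [folklore] -/
private theorem aeval_mul_eq_eval_smul' {T P : Module.End ℂ M} {z : ℂ} (hTP : T * P = z • P) (q : ℂ[X]) :
    aeval T q * P = q.eval z • P := by
  induction q using Polynomial.induction_on' with
  | add p q hp hq => rw [map_add, add_mul, hp, hq, eval_add, add_smul]
  | monomial k c =>
    have hk : ∀ k : ℕ, T ^ k * P = z ^ k • P := by
      intro k
      induction k with
      | zero => rw [pow_zero, pow_zero, one_mul, one_smul]
      | succ k ih => rw [pow_succ, mul_assoc, hTP, mul_smul_comm, ih, smul_smul, pow_succ, mul_comm z]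
    rw [aeval_monomial, eval_monomial, mul_assoc, hk, Algebra.algebraMap_eq_smul_one, smul_mul_assoc, one_mul,
      smul_smul]

/-- If `Σ_z P_z = 1`, two operators agreeing on every `P_z` are equal. [folklore] -/
private theorem eq_of_forall_mul_proj_eq' {κ : Type*} {s : Finset κ} {P : κ → Module.End ℂ M}
    (hPsum : ∑ z ∈ s, P z = 1) {L L' : Module.End ℂ M} (hL : ∀ z ∈ s, L * P z = L' * P z) : L = L' := by
  rw [← mul_one L, ← hPsum, Finset.mul_sum, ← mul_one L', ← hPsum, Finset.mul_sum]
  exact Finset.sum_congr rfl hL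

/-- `(Σ_w c_w ℓ_w)(z) = c_z` for the Lagrange basis `ℓ_w` of a finite `s ∋ z`. [folklore] -/
private theorem eval_sum_C_mul_basis' {s : Finset ℂ} (c : ℂ → ℂ) {z : ℂ} (hz : z ∈ s) :
    (∑ w ∈ s, C (c w) * Lagrange.basis s id w).eval z = c z := by
  classical
  rw [Polynomial.eval_finsetSum, Finset.sum_eq_single_of_mem z hz fun w _ hwz ↦ ?_]
  · have h1 : (Lagrange.basis s id z).eval z = 1 := Lagrange.eval_basis_self (v := id) (Set.injOn_id _) hz
    rw [eval_mul, eval_C, h1, mul_one]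
  · have h0 : (Lagrange.basis s id w).eval z = 0 := Lagrange.eval_basis_of_ne (v := id) hwz hz
    rw [eval_mul, eval_C, h0, mul_zero]

/-- `(Σ_{w ∈ H} ℓ_w)(z) = [z ∈ H]` for `H ⊆ s ∋ z`. [folklore] -/
private theorem eval_sum_basis' {s H : Finset ℂ} {z : ℂ} (hz : z ∈ s) :
    (∑ w ∈ H, Lagrange.basis s id w).eval z = if z ∈ H then 1 else 0 := by
  classical
  rw [Polynomial.eval_finsetSum]
  by_cases hzH : z ∈ H
  · rw [if_pos hzH, Finset.sum_eq_single_of_mem z hzH fun w hw hwz ↦ ?_]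
    · exact Lagrange.eval_basis_self (v := id) (Set.injOn_id _) hz
    · exact Lagrange.eval_basis_of_ne (v := id) hwz hz
  · rw [if_neg hzH]
    exact Finset.sum_eq_zero fun w hw ↦ Lagrange.eval_basis_of_ne (v := id) (fun h ↦ hzH (h ▸ hw)) hz

/-- **The normalisation.** If `S² = q(T)`, `S` commutes with `T`, `T` is killed by the nodal polynomial of `s` and
`q(z) = c_z² ≠ 0` on `s`, then `R = Σ_z c_z⁻¹ P_z ∈ ℂ[T]` satisfies `(S R)² = 1` and `R · (Σ_z c_z P_z) = 1`. [folklore] -/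
private theorem sq_normaliser' {T S : Module.End ℂ M} {s : Finset ℂ} (hs : s.Nonempty)
    (hTs : aeval T (Lagrange.nodal s id) = 0) {q : ℂ[X]} (hS2 : S * S = aeval T q) (hTS : T * S = S * T)
    {c : ℂ → ℂ} (hc : ∀ z ∈ s, q.eval z = c z * c z) (hc0 : ∀ z ∈ s, c z ≠ 0) :
    S * aeval T (∑ w ∈ s, C ((c w)⁻¹) * Lagrange.basis s id w) *
        (S * aeval T (∑ w ∈ s, C ((c w)⁻¹) * Lagrange.basis s id w)) = 1 ∧
      aeval T (∑ w ∈ s, C ((c w)⁻¹) * Lagrange.basis s id w) * aeval T (∑ w ∈ s, C (c w) * Lagrange.basis s id w) = 1 := by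
  classical
  obtain ⟨hPsum, -, -, hTP⟩ := aeval_lagrange_basis_spectral T s hs hTs
  set R := aeval T (∑ w ∈ s, C ((c w)⁻¹) * Lagrange.basis s id w) with hRdef
  set R' := aeval T (∑ w ∈ s, C (c w) * Lagrange.basis s id w) with hR'def
  have hRP : ∀ z ∈ s, R * aeval T (Lagrange.basis s id z) = (c z)⁻¹ • aeval T (Lagrange.basis s id z) :=
    fun z hz ↦ by rw [hRdef, aeval_mul_eq_eval_smul' (hTP z hz), eval_sum_C_mul_basis' (fun w ↦ (c w)⁻¹) hz]
  have hR'P : ∀ z ∈ s, R' * aeval T (Lagrange.basis s id z) = c z • aeval T (Lagrange.basis s id z) :=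
    fun z hz ↦ by rw [hR'def, aeval_mul_eq_eval_smul' (hTP z hz), eval_sum_C_mul_basis' c hz]
  have hRS : R * S = S * R := aeval_comm_of_comm' T S hTS _
  refine ⟨?_, ?_⟩
  · have hSS : S * R * (S * R) = aeval T q * (R * R) := by
      rw [mul_assoc, ← mul_assoc R S, hRS, mul_assoc, ← mul_assoc S S, hS2]
    refine eq_of_forall_mul_proj_eq' hPsum fun z hz ↦ ?_
    rw [hSS, one_mul, mul_assoc, mul_assoc, hRP z hz, mul_smul_comm, hRP z hz, smul_smul, mul_smul_comm,
      aeval_mul_eq_eval_smul' (hTP z hz), smul_smul, hc z hz,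
      show (c z)⁻¹ * (c z)⁻¹ * (c z * c z) = 1 by field_simp [hc0 z hz], one_smul]
  · refine eq_of_forall_mul_proj_eq' hPsum fun z hz ↦ ?_
    rw [one_mul, mul_assoc, hR'P z hz, mul_smul_comm, hRP z hz, smul_smul, mul_inv_cancel₀ (hc0 z hz), one_smul]

/-- The complex roots of a monic integer polynomial irreducible over `ℚ` are simple and non-empty, with nodal
polynomial the polynomial itself, which is squarefree over `ℂ`. [folklore] -/
private theorem nodal_roots_toFinset' {Q : Polynomial ℤ} (hQm : Q.Monic)
    (hQirr : Irreducible (Q.map (Int.castRingHom ℚ))) :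
    Lagrange.nodal (Q.map (Int.castRingHom ℂ)).roots.toFinset id = Q.map (Int.castRingHom ℂ) ∧
      (Q.map (Int.castRingHom ℂ)).roots.toFinset.Nonempty ∧ Squarefree (Q.map (Int.castRingHom ℂ)) := by
  classical
  have hQc : Q.map (Int.castRingHom ℂ) = (Q.map (Int.castRingHom ℚ)).map (algebraMap ℚ ℂ) := by
    rw [Polynomial.map_map, RingHom.ext_int ((algebraMap ℚ ℂ).comp (Int.castRingHom ℚ)) (Int.castRingHom ℂ)]
  have hsep : (Q.map (Int.castRingHom ℂ)).Separable := by
    rw [hQc]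
    exact hQirr.separable.map
  have hmon : (Q.map (Int.castRingHom ℂ)).Monic := hQm.map _
  have hnodup : (Q.map (Int.castRingHom ℂ)).roots.Nodup := Polynomial.nodup_roots hsep
  refine ⟨?_, ?_, hsep.squarefree⟩
  · have hsplit := (IsAlgClosed.splits (Q.map (Int.castRingHom ℂ))).eq_prod_roots_of_monic hmon
    rw [Lagrange.nodal_eq, ← Multiset.toFinset_eq hnodup, Finset.prod_mk]
    exact hsplit.symm
  · have hdeg : (Q.map (Int.castRingHom ℂ)).degree ≠ 0 := by
      have h1 : 0 < (Q.map (Int.castRingHom ℚ)).natDegree :=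
        Polynomial.natDegree_pos_iff_degree_pos.2 (Polynomial.degree_pos_of_irreducible hQirr)
      rw [hQm.natDegree_map] at h1
      intro h0
      rw [Polynomial.degree_eq_natDegree hmon.ne_zero, hQm.natDegree_map] at h0
      exact h1.ne' (by exact_mod_cast h0)
    obtain ⟨z, hz⟩ := IsAlgClosed.exists_root _ hdeg
    exact ⟨z, Multiset.mem_toFinset.2 ((Polynomial.mem_roots hmon.ne_zero).2 hz)⟩

variable {W : Type*} [AddCommGroup W] [Module ℂ W]

/-- Adjoints multiply in reverse order: `(S R)† = R† S†`. [folklore] -/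
private theorem adj_mul' (B : M →ₗ[ℂ] M →ₗ[ℂ] W) {S S' R R' : Module.End ℂ M}
    (hS : ∀ v w, B (S v) w = B v (S' w)) (hR : ∀ v w, B (R v) w = B v (R' w)) (v w : M) :
    B ((S * R) v) w = B v ((R' * S') w) := by
  rw [Module.End.mul_apply, hS, hR, Module.End.mul_apply]

/-- `(c S)† = c S†`. [folklore] -/
private theorem adj_smul' (B : M →ₗ[ℂ] M →ₗ[ℂ] W) {S S' : Module.End ℂ M}
    (hS : ∀ v w, B (S v) w = B v (S' w)) (c : ℂ) (v w : M) :
    B ((c • S) v) w = B v ((c • S') w) := by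
  rw [LinearMap.smul_apply, map_smul, LinearMap.smul_apply, hS, LinearMap.smul_apply, map_smul]

/-- `(S + R)† = S† + R†`. [folklore] -/
private theorem adj_add' (B : M →ₗ[ℂ] M →ₗ[ℂ] W) {S S' R R' : Module.End ℂ M}
    (hS : ∀ v w, B (S v) w = B v (S' w)) (hR : ∀ v w, B (R v) w = B v (R' w)) (v w : M) :
    B ((S + R) v) w = B v ((S' + R') w) := by
  rw [LinearMap.add_apply, map_add, LinearMap.add_apply, hS, hR, LinearMap.add_apply, map_add]

/-- `(S - R)† = S† - R†`. [folklore] -/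
private theorem adj_sub' (B : M →ₗ[ℂ] M →ₗ[ℂ] W) {S S' R R' : Module.End ℂ M}
    (hS : ∀ v w, B (S v) w = B v (S' w)) (hR : ∀ v w, B (R v) w = B v (R' w)) (v w : M) :
    B ((S - R) v) w = B v ((S' - R') w) := by
  rw [LinearMap.sub_apply, map_sub, LinearMap.sub_apply, hS, hR, LinearMap.sub_apply, map_sub]

/-- `1† = 1`. [folklore] -/
private theorem adj_one' (B : M →ₗ[ℂ] M →ₗ[ℂ] W) (v w : M) :
    B ((1 : Module.End ℂ M) v) w = B v ((1 : Module.End ℂ M) w) := rfl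

/-- `q(T)† = q(T†)`: a polynomial in `T` has adjoint the same polynomial in the adjoint `T'`. [folklore] -/
private theorem adj_aeval' (B : M →ₗ[ℂ] M →ₗ[ℂ] W) {T T' : Module.End ℂ M}
    (hT : ∀ v w, B (T v) w = B v (T' w)) (q : ℂ[X]) (v w : M) :
    B (aeval T q v) w = B v (aeval T' q w) := by
  induction q using Polynomial.induction_on' generalizing v w with
  | add p q hp hq => simp only [map_add, LinearMap.add_apply, hp, hq]
  | monomial k c =>
    rw [aeval_monomial, aeval_monomial, Module.End.mul_apply, Module.End.mul_apply, Module.algebraMap_end_apply,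
      Module.algebraMap_end_apply, map_smul, LinearMap.smul_apply, map_smul]
    congr 1
    induction k generalizing v w with
    | zero => rw [pow_zero, pow_zero, Module.End.one_apply, Module.End.one_apply]
    | succ k ih =>
      conv_lhs => rw [pow_succ', Module.End.mul_apply]
      rw [hT, ih, ← Module.End.mul_apply, ← pow_succ]

/-- For an ANTISYMMETRIC `B`, adjointness is symmetric: `S†† = S`. [folklore] -/
private theorem adj_symm' (B : M →ₗ[ℂ] M →ₗ[ℂ] W) (hB : ∀ x y, B y x = -B x y) {S S' : Module.End ℂ M}
    (hS : ∀ v w, B (S v) w = B v (S' w)) (v w : M) : B (S' v) w = B v (S w) := by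
  rw [hB w (S' v), ← hS w v]
  exact (hB (S w) v).symm

end Aux

/-! ### §1 (private) A half of the spectrum and the `2 × 2` block of a pair of anticommuting involutions -/

section Half

/-- A set of representatives `H ⊆ s` for the orbits of a fixed-point-free involution `r` on the «live» part of a finite
`s ⊆ ℂ`: `z ∈ H ↔ r z ∉ H` for live `z` (take `H = {z ∈ s | z <_lex r z}` in the lexicographic order of `ℂ = ℝ²`).
[folklore] -/
private theorem exists_half' (s : Finset ℂ) (r : ℂ → ℂ) (live : ℂ → Prop)
    (hstab : ∀ z ∈ s, live z → r z ∈ s ∧ r (r z) = z ∧ r z ≠ z) :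
    ∃ H : Finset ℂ, H ⊆ s ∧ ∀ z ∈ s, live z → (z ∈ H ↔ r z ∉ H) := by
  classical
  let key : ℂ → Lex (ℝ × ℝ) := fun z ↦ toLex (z.re, z.im)
  have hkey : ∀ {a b : ℂ}, key a = key b → a = b := fun {a b} hab ↦ by
    have h' : (a.re, a.im) = (b.re, b.im) := toLex_inj.1 hab
    exact Complex.ext (Prod.ext_iff.1 h').1 (Prod.ext_iff.1 h').2
  refine ⟨s.filter fun z ↦ key z < key (r z), Finset.filter_subset _ _, fun z hz hl ↦ ?_⟩
  obtain ⟨hrz, hrr, hne⟩ := hstab z hz hl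
  have hne' : key (r z) ≠ key z := fun h' ↦ hne (hkey h')
  simp only [Finset.mem_filter, hz, hrz, true_and, hrr]
  exact ⟨fun h1 h2 ↦ lt_asymm h1 h2, fun h2 ↦ lt_of_le_of_ne (not_lt.1 h2) hne'.symm⟩

end Half

section Block

variable {R : Type*} [Ring R] [Algebra ℂ R] {s t : R}

/-- `p² = p` for `p = ½(1 + s)`, `s² = 1`. [folklore] -/
private theorem half_one_add_mul_self' (hs : s * s = 1) :
    ((2:ℂ)⁻¹ • (1 + s)) * ((2:ℂ)⁻¹ • (1 + s)) = (2:ℂ)⁻¹ • (1 + s) := by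
  rw [smul_mul_assoc, mul_smul_comm, smul_smul, mul_add, add_mul, add_mul, one_mul, mul_one, one_mul, hs]
  module

/-- `p t p = 0`. [folklore] -/
private theorem half_one_add_mul_mul_half_one_add' (hs : s * s = 1) (hst : s * t = -(t * s)) :
    ((2:ℂ)⁻¹ • (1 + s)) * t * ((2:ℂ)⁻¹ • (1 + s)) = 0 := by
  have hsts : s * t * s = -t := by rw [hst, neg_mul, mul_assoc, hs, mul_one]
  rw [smul_mul_assoc, smul_mul_assoc, mul_smul_comm, smul_smul, add_mul, add_mul, one_mul, mul_add,
    mul_add, mul_one, mul_one, hsts, hst]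
  module

/-- `t p t = ½(1 - s)`. [folklore] -/
private theorem mul_half_one_add_mul' (ht : t * t = 1) (hst : s * t = -(t * s)) :
    t * ((2:ℂ)⁻¹ • (1 + s)) * t = (2:ℂ)⁻¹ • (1 - s) := by
  have htst : t * s * t = -s := by rw [mul_assoc, hst, mul_neg, ← mul_assoc, ht, one_mul]
  rw [mul_smul_comm, smul_mul_assoc, mul_add, add_mul, mul_one, ht, htst]
  module

/-- `p + q = 1`. [folklore] -/
private theorem half_one_add_add_half_one_sub' : (2:ℂ)⁻¹ • (1 + s) + (2:ℂ)⁻¹ • (1 - s) = 1 := by module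

/-- `p - q = s`. [folklore] -/
private theorem half_one_add_sub_half_one_sub' : (2:ℂ)⁻¹ • (1 + s) - (2:ℂ)⁻¹ • (1 - s) = s := by module

/-- `p t = t q`. [folklore] -/
private theorem half_one_add_mul_eq' (hst : s * t = -(t * s)) :
    ((2:ℂ)⁻¹ • (1 + s)) * t = t * ((2:ℂ)⁻¹ • (1 - s)) := by
  rw [smul_mul_assoc, mul_smul_comm, add_mul, one_mul, hst, mul_sub, mul_one]
  module

/-- `t = t p + p t`. [folklore] -/
private theorem eq_mul_half_one_add_add' (hst : s * t = -(t * s)) :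
    t * ((2:ℂ)⁻¹ • (1 + s)) + ((2:ℂ)⁻¹ • (1 + s)) * t = t := by
  rw [half_one_add_mul_eq' hst, ← mul_add, half_one_add_add_half_one_sub', mul_one]

/-- **The `2 × 2` block of two anticommuting involutions** `s² = t² = 1`, `s t = -t s` in a `ℂ`-algebra: with
`p = ½(1 + s)`, `x = (p, t p)`, `y = (p, p t)` one has `yᵢ xⱼ = δᵢⱼ p`, `Σ xᵢ yᵢ = 1`, `s = x₀y₀ - x₁y₁`,
`t = x₁y₀ + x₀y₁` (the isomorphism `ℂ⟨s, t⟩ ≅ M₂(ℂ)`). [folklore] -/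
private theorem morita_block' (hs : s * s = 1) (ht : t * t = 1) (hst : s * t = -(t * s))
    {p : R} (hp : p = (2:ℂ)⁻¹ • (1 + s)) {x y : Fin 2 → R} (hx0 : x 0 = p) (hx1 : x 1 = t * p)
    (hy0 : y 0 = p) (hy1 : y 1 = p * t) :
    (∀ i j, y i * x j = if i = j then p else 0) ∧ (∑ i, x i * y i = 1) ∧
      s = x 0 * y 0 - x 1 * y 1 ∧ t = x 1 * y 0 + x 0 * y 1 := by
  have hpp : p * p = p := by rw [hp]; exact half_one_add_mul_self' hs
  have hptp : p * t * p = 0 := by rw [hp]; exact half_one_add_mul_mul_half_one_add' hs hst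
  have htpt : t * p * t = (2:ℂ)⁻¹ • (1 - s) := by rw [hp]; exact mul_half_one_add_mul' ht hst
  refine ⟨?_, ?_, ?_, ?_⟩
  · have h01 : p * (t * p) = 0 := by rw [← mul_assoc, hptp]
    have h11 : p * t * (t * p) = p := by rw [mul_assoc, ← mul_assoc t, ht, one_mul, hpp]
    intro i j
    fin_cases i <;> fin_cases j <;> simp [hx0, hx1, hy0, hy1, hpp, h01, hptp, h11]
  · rw [Fin.sum_univ_two, hx0, hy0, hx1, hy1, hpp, mul_assoc, ← mul_assoc p p, hpp, ← mul_assoc, htpt, hp]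
    exact half_one_add_add_half_one_sub'
  · rw [hx0, hy0, hx1, hy1, hpp, mul_assoc, ← mul_assoc p p, hpp, ← mul_assoc, htpt, hp,
      half_one_add_sub_half_one_sub']
  · rw [hx0, hy0, hx1, hy1, mul_assoc t p p, hpp, ← mul_assoc p p t, hpp, hp, eq_mul_half_one_add_add' hst]

end Block

/-! ### §2 ADJOINT-CLOSED MATRIX UNITS FROM A QUATERNION PAIR OVER A CM CENTRE -/

section Units

variable {A : AbelianVariety ℂ} {h : complexBetti A.X 2} {T T' Sa Sb : Module.End ℂ (complexBetti A.X 1)}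
  {R : Polynomial ℤ} {qa qb : ℂ[X]} {εa εb : ℂ}

/-- `Q_h(y, x) = -Q_h(x, y)` on `H¹` (graded commutativity of the cup product; the tree's `polarizationPairingOne_swap`,
restated to keep the import closure small). [cite: HatcherAT2002, Thm. 3.11] -/
private theorem polarizationPairingOne_swap'' (x y : complexBetti A.X 1) :
    polarizationPairingOne A.X h (A.dim - 1) y x = -polarizationPairingOne A.X h (A.dim - 1) x y := by
  rw [polarizationPairingOne_apply, polarizationPairingOne_apply,
    cupProduct_gradedComm_holds (R := ℂ) (X := ComplexPoints A.X) rfl rfl y x, map_smul, pow_one, neg_one_smul]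

/-- **ADJOINT-CLOSED `2 × 2` MATRIX UNITS FOR A QUATERNION ALGEBRA OVER A CM CENTRE** («`Δ ⊗ ℂ = ∏_τ M₂(ℂ)`, the
involution of the SECOND kind exchanging the factors at `τ` and `τ̄`»).  Data on `H¹(A(ℂ); ℂ)` with `Q_h`
non-degenerate: `T` killed by `R ∈ ℤ[X]` monic irreducible over `ℚ` (the CM centre `E = ℚ(ψ)`, `T = ψ^*`), its
`Q_h`-adjoint `T' ∈ ℂ[T]` (`ψ† ∈ E`) with `ker(T - σ) ∩ ker(T' - σ) = 0` for all `σ` (no real place: `σ̄ ≠ σ`);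
`Sa, Sb` (`= α^*, β^*`) commuting with `T`, ANTICOMMUTING, `Sa² = a(T)`, `Sb² = b(T)` with `a, b` non-vanishing at the
roots of `R`, and `Q_h(Sa x, y) = εa Q_h(x, Sa y)`, `Q_h(Sb x, y) = εb Q_h(x, Sb y)` with `εa² = εb² = 1` (generators
adapted to the involution: `α† = ±α`, `β† = ±β`).  THEN there are MATRIX UNITS `U_{ab}` (`a, b ∈ Fin 2`) on `H¹` with
`U_{ab} U_{cd} = δ_{bc} U_{ad}`, `Σ U_{aa} = 1`, `U_{ab}† = U_{ba}`, commuting with `T`, lying in `ℂ⟨T, T', Sa, Sb⟩`, and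
such that `Sa, Sb ∈ ℂ⟨T, U_{ab}⟩`.  Construction: normalise `s = Sa · a(T)^{-1/2}`, `t = Sb · b(T)^{-1/2}` (square roots
chosen as functions of the VALUES `a(σ)`, so that the same polynomial normalises on the conjugate places), take the
block `x = (p, tp)`, `y = (p, pt)`, `p = ½(1 + s)` and the block `x', y'` of the ADJOINT pair `s† = εa Sa a(T')^{-1/2}`,
`t†`; choose a half `H` of the live spectrum of `T` (`σ ∈ H ↔ σ̄ ∉ H`, `σ̄` the eigenvalue of `T` on which `T'` acts
by `σ`… i.e. `r(σ)` for `T' = r(T)`), and put `U_{ab} = x_a y_b P_H + x'_a y'_b P'_H` with `P_H = Σ_{σ ∈ H} P_σ ∈ ℂ[T]`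
and `P'_H` the same polynomial in `T'` (`= P_{r(H)}`, the adjoint of `P_H`; `P_H + P'_H = 1`, `P_H P'_H = 0`).
[cite: MoonenZarhin1998WeilClasses, §1 Tables 1–2 and «Δ ⊗ ℂ = ∏_τ Δ_ℂ^{(τ)}», Type 4 (chunk p0002 L60–L118); proof of Criterion (2), case «Type 4 with d ≥ 2 or m ≥ 2» (chunk p0003 L72–L80)]
[cite: Milne1999LefschetzClasses, §2 (semisimple algebras with involution of the second kind)] [cite: McconnellRobson2001, 3.5.5–3.5.7] -/
theorem exists_matrixUnits_adjoint_of_quaternionOver_CM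
    (hnd : ∀ x : complexBetti A.X 1, (∀ y, polarizationPairingOne A.X h (A.dim - 1) x y = 0) → x = 0)
    (hRm : R.Monic) (hRirr : Irreducible (R.map (Int.castRingHom ℚ)))
    (hTR : aeval T (R.map (Int.castRingHom ℂ)) = 0)
    (hT' : T' ∈ Algebra.adjoin ℂ ({T} : Set (Module.End ℂ (complexBetti A.X 1))))
    (hadj : ∀ x y : complexBetti A.X 1, polarizationPairingOne A.X h (A.dim - 1) (T x) y =
      polarizationPairingOne A.X h (A.dim - 1) x (T' y))
    (hCM : ∀ σ : ℂ, T.eigenspace σ ⊓ T'.eigenspace σ = ⊥)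
    (hTSa : T * Sa = Sa * T) (hTSb : T * Sb = Sb * T) (hanti : Sa * Sb = -(Sb * Sa))
    (hSa2 : Sa * Sa = aeval T qa) (hqa : ∀ z : ℂ, (R.map (Int.castRingHom ℂ)).IsRoot z → qa.eval z ≠ 0)
    (hSb2 : Sb * Sb = aeval T qb) (hqb : ∀ z : ℂ, (R.map (Int.castRingHom ℂ)).IsRoot z → qb.eval z ≠ 0)
    (hεa : εa * εa = 1) (hεb : εb * εb = 1)
    (hαadj : ∀ x y : complexBetti A.X 1, polarizationPairingOne A.X h (A.dim - 1) (Sa x) y =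
      εa • polarizationPairingOne A.X h (A.dim - 1) x (Sa y))
    (hβadj : ∀ x y : complexBetti A.X 1, polarizationPairingOne A.X h (A.dim - 1) (Sb x) y =
      εb • polarizationPairingOne A.X h (A.dim - 1) x (Sb y)) :
    ∃ U : Fin 2 → Fin 2 → Module.End ℂ (complexBetti A.X 1),
      (∀ a b c d, U a b * U c d = if b = c then U a d else 0) ∧ (∑ a, U a a = 1) ∧
      (∀ a b (x y : complexBetti A.X 1), polarizationPairingOne A.X h (A.dim - 1) (U a b x) y =
        polarizationPairingOne A.X h (A.dim - 1) x (U b a y)) ∧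
      (∀ a b, T * U a b = U a b * T) ∧
      (∀ a b, U a b ∈ Algebra.adjoin ℂ ({T, T', Sa, Sb} : Set (Module.End ℂ (complexBetti A.X 1)))) ∧
      Sa ∈ Algebra.adjoin ℂ (insert T (Set.range fun ab : Fin 2 × Fin 2 ↦ U ab.1 ab.2)) ∧
      Sb ∈ Algebra.adjoin ℂ (insert T (Set.range fun ab : Fin 2 × Fin 2 ↦ U ab.1 ab.2)) := by
  classical
  -- the form, its antisymmetry and right non-degeneracy
  set Q := polarizationPairingOne A.X h (A.dim - 1) with hQdef
  have hswap : ∀ x y : complexBetti A.X 1, Q y x = -Q x y := polarizationPairingOne_swap''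
  have hnd' : ∀ y : complexBetti A.X 1, (∀ x, Q x y = 0) → y = 0 := fun y hy ↦
    hnd y fun x ↦ by rw [hswap, hy, neg_zero]
  -- `T' = r(T)`
  rw [Algebra.adjoin_singleton_eq_range_aeval] at hT'
  obtain ⟨r, hr⟩ := hT'
  replace hr : aeval T r = T' := hr
  have hpoly' : ∀ f : ℂ[X], aeval T' f = aeval T (f.comp r) := fun f ↦ by rw [aeval_comp, hr]
  have hcT : ∀ X : Module.End ℂ (complexBetti A.X 1), T * X = X * T → ∀ f : ℂ[X], aeval T f * X = X * aeval T f :=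
    fun X hX f ↦ aeval_comm_of_comm' T X hX f
  have hcT' : ∀ X : Module.End ℂ (complexBetti A.X 1), T * X = X * T → ∀ f : ℂ[X], aeval T' f * X = X * aeval T' f :=
    fun X hX f ↦ by rw [hpoly']; exact hcT X hX _
  have hpp : ∀ f g : ℂ[X], aeval T f * aeval T g = aeval T g * aeval T f := fun f g ↦ by
    rw [← map_mul, mul_comm, map_mul]
  have hTT' : T * T' = T' * T := by rw [← hr]; exact (hcT T rfl r).symm
  have hT'Sa : T' * Sa = Sa * T' := by rw [← hr]; exact hcT Sa hTSa r
  have hT'Sb : T' * Sb = Sb * T' := by rw [← hr]; exact hcT Sb hTSb r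
  -- spectral data of `T` and of `T'`
  obtain ⟨hnodal, hsne, hRsq⟩ := nodal_roots_toFinset' hRm hRirr
  set s : Finset ℂ := (R.map (Int.castRingHom ℂ)).roots.toFinset with hsdef
  have hTs : aeval T (Lagrange.nodal s id) = 0 := by rw [hnodal]; exact hTR
  have hmem_s : ∀ z ∈ s, (R.map (Int.castRingHom ℂ)).IsRoot z := fun z hz ↦
    (Polynomial.mem_roots (hRm.map _).ne_zero).1 (Multiset.mem_toFinset.1 hz)
  have hmem_s' : ∀ {z : ℂ}, T.eigenspace z ≠ ⊥ → z ∈ s := by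
    intro z hz
    obtain ⟨v, hv, hv0⟩ := (Submodule.ne_bot_iff _).1 hz
    have hroot : (R.map (Int.castRingHom ℂ)).IsRoot z := by
      have e := LinearMap.congr_fun hTR v
      rw [LinearMap.zero_apply] at e
      have e2 : aeval T (R.map (Int.castRingHom ℂ)) v = (R.map (Int.castRingHom ℂ)).eval z • v := by
        exact Module.End.aeval_apply_of_hasEigenvector (f := T) (p := R.map (Int.castRingHom ℂ)) (μ := z) (x := v)
          ⟨hv, hv0⟩
      rw [e2] at e
      exact (smul_eq_zero.1 e).resolve_right hv0
    exact Multiset.mem_toFinset.2 ((Polynomial.mem_roots (hRm.map _).ne_zero).2 hroot)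
  obtain ⟨hPsum, hPorth, hPidem, hTP⟩ := aeval_lagrange_basis_spectral T s hsne hTs
  have hadjq : ∀ (f : ℂ[X]) (v w : complexBetti A.X 1), Q (aeval T f v) w = Q v (aeval T' f w) :=
    fun f ↦ adj_aeval' Q hadj f
  have hT'R : aeval T' (R.map (Int.castRingHom ℂ)) = 0 := by
    refine LinearMap.ext fun w ↦ hnd' _ fun v ↦ ?_
    rw [← hadjq, hTR, LinearMap.zero_apply, map_zero, LinearMap.zero_apply]
  have hT's : aeval T' (Lagrange.nodal s id) = 0 := by rw [hnodal]; exact hT'R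
  -- the conjugation `σ ↦ r(σ)` on the live spectrum
  have hlive : ∀ σ : ℂ, T.eigenspace σ ≠ ⊥ → T.eigenspace (r.eval σ) ≠ ⊥ ∧ r.eval (r.eval σ) = σ :=
    fun σ hσ ↦ CentralTorus.eigenspace_eval_ne_bot hnd hRsq hTR hadj hr.symm hσ
  have hfix : ∀ σ : ℂ, T.eigenspace σ ≠ ⊥ → r.eval σ ≠ σ := by
    intro σ hσ hEq
    have e1 := hCM σ
    rw [CentralTorus.eigenspace_adjoint_eq_eigenspace_eval hnd hRsq hTR hadj hr.symm hσ, hEq, inf_idem] at e1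
    exact hσ e1
  have hPlive : ∀ z ∈ s, aeval T (Lagrange.basis s id z) ≠ 0 → T.eigenspace z ≠ ⊥ := by
    intro z hz hP
    obtain ⟨v, hv⟩ : ∃ v, aeval T (Lagrange.basis s id z) v ≠ 0 := by
      by_contra hall
      push Not at hall
      exact hP (LinearMap.ext hall)
    refine (Submodule.ne_bot_iff _).2 ⟨_, ?_, hv⟩
    rw [Module.End.mem_eigenspace_iff, ← Module.End.mul_apply, hTP z hz, LinearMap.smul_apply]
  -- a half `H` of the live spectrum
  obtain ⟨H, hHs, hH⟩ := exists_half' s (fun z ↦ r.eval z) (fun z ↦ T.eigenspace z ≠ ⊥) fun z hz hl ↦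
    ⟨hmem_s' (hlive z hl).1, (hlive z hl).2, hfix z hl⟩
  set fH : ℂ[X] := ∑ w ∈ H, Lagrange.basis s id w with hfHdef
  set PH : Module.End ℂ (complexBetti A.X 1) := aeval T fH with hPHdef
  set PH' : Module.End ℂ (complexBetti A.X 1) := aeval T' fH with hPH'def
  have hcH : ∀ z ∈ s, fH.eval z = if z ∈ H then 1 else 0 := fun z hz ↦ eval_sum_basis' hz
  have hPHP : ∀ z ∈ s, PH * aeval T (Lagrange.basis s id z) =
      (if z ∈ H then (1:ℂ) else 0) • aeval T (Lagrange.basis s id z) := fun z hz ↦ by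
    rw [hPHdef, aeval_mul_eq_eval_smul' (hTP z hz), hcH z hz]
  have hT'P : ∀ z ∈ s, T' * aeval T (Lagrange.basis s id z) = r.eval z • aeval T (Lagrange.basis s id z) :=
    fun z hz ↦ by rw [← hr, aeval_mul_eq_eval_smul' (hTP z hz)]
  have hPH'P : ∀ z ∈ s, PH' * aeval T (Lagrange.basis s id z) =
      fH.eval (r.eval z) • aeval T (Lagrange.basis s id z) := fun z hz ↦ by
    rw [hPH'def, aeval_mul_eq_eval_smul' (hT'P z hz)]
  -- the projector identities `P_H² = P_H`, `P'_H² = P'_H`, `P_H P'_H = 0`, `P_H + P'_H = 1`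
  have hsplit : ∀ z ∈ s, aeval T (Lagrange.basis s id z) ≠ 0 →
      r.eval z ∈ s ∧ ((z ∈ H ∧ r.eval z ∉ H) ∨ (z ∉ H ∧ r.eval z ∈ H)) := by
    intro z hz hP
    have hl := hPlive z hz hP
    refine ⟨hmem_s' (hlive z hl).1, ?_⟩
    by_cases hzH : z ∈ H
    · exact Or.inl ⟨hzH, (hH z hz hl).1 hzH⟩
    · refine Or.inr ⟨hzH, ?_⟩
      by_contra hr'
      exact hzH ((hH z hz hl).2 hr')
  have hF3 : PH * PH = PH := by
    refine eq_of_forall_mul_proj_eq' hPsum fun z hz ↦ ?_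
    rw [mul_assoc, hPHP z hz, mul_smul_comm, hPHP z hz, smul_smul]
    congr 1
    split_ifs <;> simp
  have hF4 : PH' * PH' = PH' := by
    refine eq_of_forall_mul_proj_eq' hPsum fun z hz ↦ ?_
    by_cases hP : aeval T (Lagrange.basis s id z) = 0
    · rw [hP, mul_zero, mul_zero]
    obtain ⟨hrs, hcase⟩ := hsplit z hz hP
    rw [mul_assoc, hPH'P z hz, mul_smul_comm, hPH'P z hz, smul_smul, hcH _ hrs]
    congr 1
    split_ifs <;> simp
  have hF1 : PH * PH' = 0 := by
    refine eq_of_forall_mul_proj_eq' hPsum fun z hz ↦ ?_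
    by_cases hP : aeval T (Lagrange.basis s id z) = 0
    · rw [hP, mul_zero, mul_zero]
    obtain ⟨hrs, hcase⟩ := hsplit z hz hP
    rw [zero_mul, mul_assoc, hPH'P z hz, mul_smul_comm, hPHP z hz, smul_smul, hcH _ hrs]
    rcases hcase with ⟨h1, h2⟩ | ⟨h1, h2⟩
    · rw [if_neg h2, zero_mul, zero_smul]
    · rw [if_neg h1, mul_zero, zero_smul]
  have hF5 : PH' * PH = 0 := by
    rw [hPH'def, hcT' PH (hcT T rfl fH).symm fH, ← hPH'def, hF1]
  have hF2 : PH + PH' = 1 := by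
    refine eq_of_forall_mul_proj_eq' hPsum fun z hz ↦ ?_
    by_cases hP : aeval T (Lagrange.basis s id z) = 0
    · rw [hP, mul_zero, mul_zero]
    obtain ⟨hrs, hcase⟩ := hsplit z hz hP
    rw [one_mul, add_mul, hPHP z hz, hPH'P z hz, ← add_smul, hcH _ hrs]
    rcases hcase with ⟨h1, h2⟩ | ⟨h1, h2⟩
    · rw [if_pos h1, if_neg h2, add_zero, one_smul]
    · rw [if_neg h1, if_pos h2, zero_add, one_smul]
  have hadjPH : ∀ v w : complexBetti A.X 1, Q (PH v) w = Q v (PH' w) := hadjq fH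
  have hadjPH' : ∀ v w : complexBetti A.X 1, Q (PH' v) w = Q v (PH w) := adj_symm' Q hswap hadjPH
  -- `Sa² = a(T')`, `Sb² = b(T')` (the squares are `†`-symmetric)
  have hsq' : ∀ {S : Module.End ℂ (complexBetti A.X 1)} {q : ℂ[X]} {ε : ℂ}, ε * ε = 1 →
      (∀ x y : complexBetti A.X 1, Q (S x) y = ε • Q x (S y)) → S * S = aeval T q → S * S = aeval T' q := by
    intro S q ε hε hS hS2
    refine LinearMap.ext fun w ↦ ?_
    rw [← sub_eq_zero, ← LinearMap.sub_apply]
    refine hnd' _ fun v ↦ ?_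
    rw [LinearMap.sub_apply, map_sub, ← hadjq, ← hS2, Module.End.mul_apply, Module.End.mul_apply, hS, hS, smul_smul,
      hε, one_smul, sub_self]
  have hSa2' : Sa * Sa = aeval T' qa := hsq' hεa hαadj hSa2
  have hSb2' : Sb * Sb = aeval T' qb := hsq' hεb hβadj hSb2
  -- square roots of the values `a(σ)`, `b(σ)` and the four normalisations
  have hsqrt : ∀ z : ℂ, ∃ c : ℂ, z = c * c := fun z ↦ IsAlgClosed.exists_eq_mul_self z
  choose sq hsq using hsqrt
  have hca : ∀ z ∈ s, qa.eval z = sq (qa.eval z) * sq (qa.eval z) := fun z _ ↦ hsq _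
  have hcb : ∀ z ∈ s, qb.eval z = sq (qb.eval z) * sq (qb.eval z) := fun z _ ↦ hsq _
  have hca0 : ∀ z ∈ s, sq (qa.eval z) ≠ 0 := fun z hz h0 ↦ hqa z (hmem_s z hz) (by rw [hsq (qa.eval z), h0, mul_zero])
  have hcb0 : ∀ z ∈ s, sq (qb.eval z) ≠ 0 := fun z hz h0 ↦ hqb z (hmem_s z hz) (by rw [hsq (qb.eval z), h0, mul_zero])
  obtain ⟨hs₁, hRa⟩ := sq_normaliser' hsne hTs hSa2 hTSa hca hca0
  obtain ⟨ht₁, hRb⟩ := sq_normaliser' hsne hTs hSb2 hTSb hcb hcb0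
  obtain ⟨hs₂', hQa⟩ := sq_normaliser' hsne hT's hSa2' hT'Sa hca hca0
  obtain ⟨ht₂', hQb⟩ := sq_normaliser' hsne hT's hSb2' hT'Sb hcb hcb0
  set fa : ℂ[X] := ∑ w ∈ s, C ((sq (qa.eval w))⁻¹) * Lagrange.basis s id w with hfadef
  set fa' : ℂ[X] := ∑ w ∈ s, C (sq (qa.eval w)) * Lagrange.basis s id w with hfa'def
  set fb : ℂ[X] := ∑ w ∈ s, C ((sq (qb.eval w))⁻¹) * Lagrange.basis s id w with hfbdef
  set fb' : ℂ[X] := ∑ w ∈ s, C (sq (qb.eval w)) * Lagrange.basis s id w with hfb'def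
  -- the two pairs of anticommuting involutions `(s₁, t₁)` and its adjoint pair `(s₂, t₂)`
  set s₁ : Module.End ℂ (complexBetti A.X 1) := Sa * aeval T fa with hs₁def
  set t₁ : Module.End ℂ (complexBetti A.X 1) := Sb * aeval T fb with ht₁def
  set s₂ : Module.End ℂ (complexBetti A.X 1) := εa • (Sa * aeval T' fa) with hs₂def
  set t₂ : Module.End ℂ (complexBetti A.X 1) := εb • (Sb * aeval T' fb) with ht₂def
  have hcm : ∀ {L V K : Module.End ℂ (complexBetti A.X 1)}, L * V = V * L → L * K = K * L →
      L * (V * K) = V * K * L := fun h1 h2 ↦ by rw [← mul_assoc, h1, mul_assoc, h2, ← mul_assoc]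
  have hst₁ : s₁ * t₁ = -(t₁ * s₁) := by
    have e1 : s₁ * t₁ = Sa * Sb * (aeval T fa * aeval T fb) := by
      rw [hs₁def, ht₁def, mul_assoc, ← mul_assoc (aeval T fa) Sb, hcT Sb hTSb, mul_assoc, ← mul_assoc Sa Sb]
    have e2 : t₁ * s₁ = Sb * Sa * (aeval T fa * aeval T fb) := by
      rw [hs₁def, ht₁def, mul_assoc, ← mul_assoc (aeval T fb) Sa, hcT Sa hTSa, mul_assoc, ← mul_assoc Sb Sa, hpp]
    rw [e1, e2, hanti, neg_mul]
  have hs₂ : s₂ * s₂ = 1 := by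
    rw [hs₂def, smul_mul_assoc, mul_smul_comm, smul_smul, hεa, one_smul, hs₂']
  have ht₂ : t₂ * t₂ = 1 := by
    rw [ht₂def, smul_mul_assoc, mul_smul_comm, smul_smul, hεb, one_smul, ht₂']
  have hst₂ : s₂ * t₂ = -(t₂ * s₂) := by
    have e1 : Sa * aeval T' fa * (Sb * aeval T' fb) = Sa * Sb * (aeval T' fa * aeval T' fb) := by
      rw [mul_assoc, ← mul_assoc (aeval T' fa) Sb, hcT' Sb hTSb, mul_assoc, ← mul_assoc Sa Sb]
    have e2 : Sb * aeval T' fb * (Sa * aeval T' fa) = Sb * Sa * (aeval T' fa * aeval T' fb) := by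
      rw [mul_assoc, ← mul_assoc (aeval T' fb) Sa, hcT' Sa hTSa, mul_assoc, ← mul_assoc Sb Sa, hpoly', hpoly', hpp]
    rw [hs₂def, ht₂def, smul_mul_assoc, mul_smul_comm, smul_smul, smul_mul_assoc, mul_smul_comm, smul_smul, e1, e2,
      hanti, neg_mul, smul_neg, mul_comm εb εa]
  -- adjoints: `s₁† = s₂`, `t₁† = t₂`
  have hadj_s : ∀ v w : complexBetti A.X 1, Q (s₁ v) w = Q v (s₂ w) := by
    intro v w
    rw [hs₁def, hs₂def, Module.End.mul_apply, hαadj, hadjq, LinearMap.smul_apply, map_smul, Module.End.mul_apply,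
      ← Module.End.mul_apply (aeval T' fa) Sa, hcT' Sa hTSa, Module.End.mul_apply]
  have hadj_t : ∀ v w : complexBetti A.X 1, Q (t₁ v) w = Q v (t₂ w) := by
    intro v w
    rw [ht₁def, ht₂def, Module.End.mul_apply, hβadj, hadjq, LinearMap.smul_apply, map_smul, Module.End.mul_apply,
      ← Module.End.mul_apply (aeval T' fb) Sb, hcT' Sb hTSb, Module.End.mul_apply]
  -- the two blocks
  set p₁ : Module.End ℂ (complexBetti A.X 1) := (2:ℂ)⁻¹ • (1 + s₁) with hp₁def
  set p₂ : Module.End ℂ (complexBetti A.X 1) := (2:ℂ)⁻¹ • (1 + s₂) with hp₂def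
  set x₁ : Fin 2 → Module.End ℂ (complexBetti A.X 1) := ![p₁, t₁ * p₁] with hx₁def
  set y₁ : Fin 2 → Module.End ℂ (complexBetti A.X 1) := ![p₁, p₁ * t₁] with hy₁def
  set x₂ : Fin 2 → Module.End ℂ (complexBetti A.X 1) := ![p₂, t₂ * p₂] with hx₂def
  set y₂ : Fin 2 → Module.End ℂ (complexBetti A.X 1) := ![p₂, p₂ * t₂] with hy₂def
  obtain ⟨hyx₁, hsum₁, hs₁repr, ht₁repr⟩ := morita_block' hs₁ ht₁ hst₁ hp₁def (x := x₁) (y := y₁) rfl rfl rfl rfl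
  obtain ⟨hyx₂, hsum₂, hs₂repr, ht₂repr⟩ := morita_block' hs₂ ht₂ hst₂ hp₂def (x := x₂) (y := y₂) rfl rfl rfl rfl
  have hadj_p : ∀ v w : complexBetti A.X 1, Q (p₁ v) w = Q v (p₂ w) :=
    adj_smul' Q (adj_add' Q (adj_one' Q) hadj_s) _
  have hadj_xy : ∀ i (v w : complexBetti A.X 1), Q (x₁ i v) w = Q v (y₂ i w) := by
    intro i v w
    fin_cases i
    · exact hadj_p v w
    · exact adj_mul' Q hadj_t hadj_p v w
  have hadj_yx : ∀ i (v w : complexBetti A.X 1), Q (y₁ i v) w = Q v (x₂ i w) := by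
    intro i v w
    fin_cases i
    · exact hadj_p v w
    · exact adj_mul' Q hadj_p hadj_t v w
  have hadj_xy' : ∀ i (v w : complexBetti A.X 1), Q (x₂ i v) w = Q v (y₁ i w) :=
    fun i ↦ adj_symm' Q hswap (hadj_yx i)
  have hadj_yx' : ∀ i (v w : complexBetti A.X 1), Q (y₂ i v) w = Q v (x₁ i w) :=
    fun i ↦ adj_symm' Q hswap (hadj_xy i)
  -- the algebra `ℂ⟨T, T', Sa, Sb⟩` commutes with `T`, hence with `P_H`, `P'_H`
  set 𝔅 := Algebra.adjoin ℂ ({T, T', Sa, Sb} : Set (Module.End ℂ (complexBetti A.X 1))) with h𝔅def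
  have h𝔅T : ∀ g ∈ 𝔅, T * g = g * T := by
    intro g hg
    have hsub : ({T, T', Sa, Sb} : Set (Module.End ℂ (complexBetti A.X 1))) ⊆
        Subalgebra.centralizer ℂ ({T} : Set (Module.End ℂ (complexBetti A.X 1))) := by
      intro g hg
      rw [SetLike.mem_coe, Subalgebra.mem_centralizer_iff]
      intro k hk
      rw [Set.mem_singleton_iff.1 hk]
      rcases hg with rfl | rfl | rfl | rfl
      · rfl
      · exact hTT'
      · exact hTSa
      · exact hTSb
    have hg' := Algebra.adjoin_le hsub hg
    rw [Subalgebra.mem_centralizer_iff] at hg'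
    exact hg' T rfl
  have hT𝔅 : T ∈ 𝔅 := Algebra.subset_adjoin (Set.mem_insert _ _)
  have hT'𝔅 : T' ∈ 𝔅 := Algebra.subset_adjoin (Set.mem_insert_of_mem _ (Set.mem_insert _ _))
  have hSa𝔅 : Sa ∈ 𝔅 := Algebra.subset_adjoin (Set.mem_insert_of_mem _ (Set.mem_insert_of_mem _ (Set.mem_insert _ _)))
  have hSb𝔅 : Sb ∈ 𝔅 :=
    Algebra.subset_adjoin (Set.mem_insert_of_mem _ (Set.mem_insert_of_mem _ (Set.mem_insert_of_mem _ rfl)))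
  have hfT𝔅 : ∀ f : ℂ[X], aeval T f ∈ 𝔅 := fun f ↦
    Algebra.adjoin_mono (Set.singleton_subset_iff.2 (Set.mem_insert _ _)) (Polynomial.aeval_mem_adjoin_singleton ℂ T)
  have hfT'𝔅 : ∀ f : ℂ[X], aeval T' f ∈ 𝔅 := fun f ↦ by rw [hpoly']; exact hfT𝔅 _
  have hs₁𝔅 : s₁ ∈ 𝔅 := Subalgebra.mul_mem _ hSa𝔅 (hfT𝔅 _)
  have ht₁𝔅 : t₁ ∈ 𝔅 := Subalgebra.mul_mem _ hSb𝔅 (hfT𝔅 _)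
  have hs₂𝔅 : s₂ ∈ 𝔅 := Subalgebra.smul_mem _ (Subalgebra.mul_mem _ hSa𝔅 (hfT'𝔅 _)) _
  have ht₂𝔅 : t₂ ∈ 𝔅 := Subalgebra.smul_mem _ (Subalgebra.mul_mem _ hSb𝔅 (hfT'𝔅 _)) _
  have hp₁𝔅 : p₁ ∈ 𝔅 := Subalgebra.smul_mem _ (Subalgebra.add_mem _ (Subalgebra.one_mem _) hs₁𝔅) _
  have hp₂𝔅 : p₂ ∈ 𝔅 := Subalgebra.smul_mem _ (Subalgebra.add_mem _ (Subalgebra.one_mem _) hs₂𝔅) _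
  have hx₁𝔅 : ∀ i, x₁ i ∈ 𝔅 := by
    intro i; fin_cases i
    · exact hp₁𝔅
    · exact Subalgebra.mul_mem _ ht₁𝔅 hp₁𝔅
  have hy₁𝔅 : ∀ i, y₁ i ∈ 𝔅 := by
    intro i; fin_cases i
    · exact hp₁𝔅
    · exact Subalgebra.mul_mem _ hp₁𝔅 ht₁𝔅
  have hx₂𝔅 : ∀ i, x₂ i ∈ 𝔅 := by
    intro i; fin_cases i
    · exact hp₂𝔅
    · exact Subalgebra.mul_mem _ ht₂𝔅 hp₂𝔅
  have hy₂𝔅 : ∀ i, y₂ i ∈ 𝔅 := by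
    intro i; fin_cases i
    · exact hp₂𝔅
    · exact Subalgebra.mul_mem _ hp₂𝔅 ht₂𝔅
  have hPHc : ∀ g ∈ 𝔅, PH * g = g * PH := fun g hg ↦ by rw [hPHdef]; exact hcT g (h𝔅T g hg) fH
  have hPH'c : ∀ g ∈ 𝔅, PH' * g = g * PH' := fun g hg ↦ by rw [hPH'def]; exact hcT' g (h𝔅T g hg) fH
  -- THE UNITS `U_{ab} = x_a y_b P_H + x'_a y'_b P'_H`, and the algebra `ℂ⟨T, U⟩`
  set U : Fin 2 → Fin 2 → Module.End ℂ (complexBetti A.X 1) := fun a b ↦ x₁ a * y₁ b * PH + x₂ a * y₂ b * PH'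
    with hUdef
  set 𝔘 := Algebra.adjoin ℂ (insert T (Set.range fun ab : Fin 2 × Fin 2 ↦ U ab.1 ab.2)) with h𝔘def
  have hU𝔘 : ∀ a b, U a b ∈ 𝔘 := fun a b ↦ Algebra.subset_adjoin (Set.mem_insert_of_mem _ ⟨(a, b), rfl⟩)
  have hfT𝔘 : ∀ f : ℂ[X], aeval T f ∈ 𝔘 := fun f ↦
    Algebra.adjoin_mono (Set.singleton_subset_iff.2 (Set.mem_insert _ _)) (Polynomial.aeval_mem_adjoin_singleton ℂ T)
  have hfT'𝔘 : ∀ f : ℂ[X], aeval T' f ∈ 𝔘 := fun f ↦ by rw [hpoly']; exact hfT𝔘 _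
  have hX₁𝔘 : ∀ a b, x₁ a * y₁ b * PH ∈ 𝔘 := by
    intro a b
    have e : x₁ a * y₁ b * PH = U a b * PH := by
      change _ = (x₁ a * y₁ b * PH + x₂ a * y₂ b * PH') * PH
      rw [add_mul, mul_assoc _ PH PH, hF3, mul_assoc _ PH' PH, hF5, mul_zero, add_zero]
    rw [e]
    exact Subalgebra.mul_mem _ (hU𝔘 a b) (by rw [hPHdef]; exact hfT𝔘 _)
  have hX₂𝔘 : ∀ a b, x₂ a * y₂ b * PH' ∈ 𝔘 := by
    intro a b
    have e : x₂ a * y₂ b * PH' = U a b * PH' := by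
      change _ = (x₁ a * y₁ b * PH + x₂ a * y₂ b * PH') * PH'
      rw [add_mul, mul_assoc _ PH PH', hF1, mul_zero, zero_add, mul_assoc _ PH' PH', hF4]
    rw [e]
    exact Subalgebra.mul_mem _ (hU𝔘 a b) (by rw [hPH'def]; exact hfT'𝔘 _)
  have hc1 : ∀ f : ℂ[X], aeval T f * PH = PH * aeval T f := fun f ↦ by rw [hPHdef]; exact hpp _ _
  have hc2 : ∀ f : ℂ[X], aeval T' f * PH' = PH' * aeval T' f := fun f ↦ by
    rw [hPH'def, hpoly', hpoly']; exact hpp _ _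
  refine ⟨U, ?_, ?_, ?_, ?_, ?_, ?_, ?_⟩
  · -- multiplication table
    have hX₁ : ∀ a b c d, x₁ a * y₁ b * (x₁ c * y₁ d) = if b = c then x₁ a * y₁ d else 0 := by
      intro a b c d
      rw [mul_assoc, ← mul_assoc (y₁ b), hyx₁ b c]
      split_ifs
      · rw [idem_mul_of_moritaData hyx₁ hsum₁ d]
      · rw [zero_mul, mul_zero]
    have hX₂ : ∀ a b c d, x₂ a * y₂ b * (x₂ c * y₂ d) = if b = c then x₂ a * y₂ d else 0 := by
      intro a b c d
      rw [mul_assoc, ← mul_assoc (y₂ b), hyx₂ b c]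
      split_ifs
      · rw [idem_mul_of_moritaData hyx₂ hsum₂ d]
      · rw [zero_mul, mul_zero]
    intro a b c d
    have hY₁ : x₁ c * y₁ d ∈ 𝔅 := Subalgebra.mul_mem _ (hx₁𝔅 c) (hy₁𝔅 d)
    have hY₂ : x₂ c * y₂ d ∈ 𝔅 := Subalgebra.mul_mem _ (hx₂𝔅 c) (hy₂𝔅 d)
    have e1 : x₁ a * y₁ b * PH * (x₁ c * y₁ d * PH) = x₁ a * y₁ b * (x₁ c * y₁ d) * PH := by
      rw [mul_assoc, ← mul_assoc PH, hPHc _ hY₁, mul_assoc (x₁ c * y₁ d) PH PH, hF3, ← mul_assoc]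
    have e2 : x₁ a * y₁ b * PH * (x₂ c * y₂ d * PH') = 0 := by
      rw [mul_assoc, ← mul_assoc PH, hPHc _ hY₂, mul_assoc (x₂ c * y₂ d) PH PH', hF1, mul_zero, mul_zero]
    have e3 : x₂ a * y₂ b * PH' * (x₁ c * y₁ d * PH) = 0 := by
      rw [mul_assoc, ← mul_assoc PH', hPH'c _ hY₁, mul_assoc (x₁ c * y₁ d) PH' PH, hF5, mul_zero, mul_zero]
    have e4 : x₂ a * y₂ b * PH' * (x₂ c * y₂ d * PH') = x₂ a * y₂ b * (x₂ c * y₂ d) * PH' := by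
      rw [mul_assoc, ← mul_assoc PH', hPH'c _ hY₂, mul_assoc (x₂ c * y₂ d) PH' PH', hF4, ← mul_assoc]
    change (x₁ a * y₁ b * PH + x₂ a * y₂ b * PH') * (x₁ c * y₁ d * PH + x₂ c * y₂ d * PH') =
      if b = c then x₁ a * y₁ d * PH + x₂ a * y₂ d * PH' else 0
    rw [add_mul, mul_add, mul_add, e1, e2, e3, e4, add_zero, zero_add, hX₁, hX₂]
    by_cases hbc : b = c
    · rw [if_pos hbc, if_pos hbc, if_pos hbc]
    · rw [if_neg hbc, if_neg hbc, if_neg hbc, zero_mul, zero_mul, add_zero]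
  · -- `Σ U_{aa} = 1`
    change ∑ a, (x₁ a * y₁ a * PH + x₂ a * y₂ a * PH') = 1
    rw [Finset.sum_add_distrib, ← Finset.sum_mul, ← Finset.sum_mul, hsum₁, hsum₂, one_mul, one_mul, hF2]
  · -- `U_{ab}† = U_{ba}`
    intro a b v w
    change Q ((x₁ a * y₁ b * PH + x₂ a * y₂ b * PH') v) w = Q v ((x₁ b * y₁ a * PH + x₂ b * y₂ a * PH') w)
    have e1 : Q ((x₁ a * y₁ b * PH) v) w = Q v ((x₂ b * y₂ a * PH') w) := by
      rw [adj_mul' Q (adj_mul' Q (hadj_xy a) (hadj_yx b)) hadjPH,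
        hPH'c _ (Subalgebra.mul_mem _ (hx₂𝔅 b) (hy₂𝔅 a))]
    have e2 : Q ((x₂ a * y₂ b * PH') v) w = Q v ((x₁ b * y₁ a * PH) w) := by
      rw [adj_mul' Q (adj_mul' Q (hadj_xy' a) (hadj_yx' b)) hadjPH',
        hPHc _ (Subalgebra.mul_mem _ (hx₁𝔅 b) (hy₁𝔅 a))]
    rw [LinearMap.add_apply, map_add, LinearMap.add_apply, e1, e2, LinearMap.add_apply, map_add]
    exact add_comm _ _
  · -- commuting with `T`
    intro a b
    exact h𝔅T _ (Subalgebra.add_mem _ (Subalgebra.mul_mem _ (Subalgebra.mul_mem _ (hx₁𝔅 a) (hy₁𝔅 b)) (hfT𝔅 _))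
      (Subalgebra.mul_mem _ (Subalgebra.mul_mem _ (hx₂𝔅 a) (hy₂𝔅 b)) (hfT'𝔅 _)))
  · -- membership in `ℂ⟨T, T', Sa, Sb⟩`
    intro a b
    exact Subalgebra.add_mem _ (Subalgebra.mul_mem _ (Subalgebra.mul_mem _ (hx₁𝔅 a) (hy₁𝔅 b)) (hfT𝔅 _))
      (Subalgebra.mul_mem _ (Subalgebra.mul_mem _ (hx₂𝔅 a) (hy₂𝔅 b)) (hfT'𝔅 _))
  · -- `Sa ∈ ℂ⟨T, U⟩`: `Sa = s₁ a^{1/2}(T) = (U₀₀ - U₁₁) P_H a^{1/2}(T) + εa (U₀₀ - U₁₁) P'_H a^{1/2}(T')`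
    have hSaR : Sa = s₁ * aeval T fa' := by rw [hs₁def, mul_assoc, hRa, mul_one]
    have hSaQ : Sa = εa • (s₂ * aeval T' fa') := by
      rw [hs₂def, smul_mul_assoc, smul_smul, hεa, one_smul, mul_assoc, hQa, mul_one]
    have e1 : Sa * PH = (x₁ 0 * y₁ 0 * PH - x₁ 1 * y₁ 1 * PH) * aeval T fa' := by
      rw [← sub_mul, ← hs₁repr, mul_assoc, ← hc1, ← mul_assoc, ← hSaR]
    have e2 : Sa * PH' = εa • ((x₂ 0 * y₂ 0 * PH' - x₂ 1 * y₂ 1 * PH') * aeval T' fa') := by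
      rw [← sub_mul, ← hs₂repr, mul_assoc, ← hc2, ← mul_assoc, ← smul_mul_assoc, ← hSaQ]
    rw [← mul_one Sa, ← hF2, mul_add, e1, e2]
    exact Subalgebra.add_mem _ (Subalgebra.mul_mem _ (Subalgebra.sub_mem _ (hX₁𝔘 0 0) (hX₁𝔘 1 1)) (hfT𝔘 _))
      (Subalgebra.smul_mem _ (Subalgebra.mul_mem _ (Subalgebra.sub_mem _ (hX₂𝔘 0 0) (hX₂𝔘 1 1)) (hfT'𝔘 _)) _)
  · -- `Sb ∈ ℂ⟨T, U⟩`: `Sb = t₁ b^{1/2}(T)`, `t₁ = x₁y₀ + x₀y₁`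
    have hSbR : Sb = t₁ * aeval T fb' := by rw [ht₁def, mul_assoc, hRb, mul_one]
    have hSbQ : Sb = εb • (t₂ * aeval T' fb') := by
      rw [ht₂def, smul_mul_assoc, smul_smul, hεb, one_smul, mul_assoc, hQb, mul_one]
    have e1 : Sb * PH = (x₁ 1 * y₁ 0 * PH + x₁ 0 * y₁ 1 * PH) * aeval T fb' := by
      rw [← add_mul, ← ht₁repr, mul_assoc, ← hc1, ← mul_assoc, ← hSbR]
    have e2 : Sb * PH' = εb • ((x₂ 1 * y₂ 0 * PH' + x₂ 0 * y₂ 1 * PH') * aeval T' fb') := by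
      rw [← add_mul, ← ht₂repr, mul_assoc, ← hc2, ← mul_assoc, ← smul_mul_assoc, ← hSbQ]
    rw [← mul_one Sb, ← hF2, mul_add, e1, e2]
    exact Subalgebra.add_mem _ (Subalgebra.mul_mem _ (Subalgebra.add_mem _ (hX₁𝔘 1 0) (hX₁𝔘 0 1)) (hfT𝔘 _))
      (Subalgebra.smul_mem _ (Subalgebra.mul_mem _ (Subalgebra.add_mem _ (hX₂𝔘 1 0) (hX₂𝔘 0 1)) (hfT'𝔘 _)) _)

end Units

/-! ### §3 THE DECOMPOSABLE HALF ON THE CARRIER: «`θ = 0` ⟹ `W_F` decomposable» for `F ⊆ M_ι(D)` -/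

section Carrier

variable {A : AbelianVariety ℂ} {h : complexBetti A.X 2} {φ : A ⟶ A} {P R : Polynomial ℤ} {e m : ℕ}
  {T T' Sa Sb : Module.End ℂ (complexBetti A.X 1)} {qa qb : ℂ[X]} {εa εb : ℂ}
  {ι : Type*} [Fintype ι] [DecidableEq ι] {W : ι → ι → Module.End ℂ (complexBetti A.X 1)}

/-- **MOONEN–ZARHIN's «`θ = 0` ⟹ `G_div(X)` acts trivially on `W_F`», TYPE 4 WITH `d = 2`, ON THE CARRIER.**  Data on
a complex abelian variety `A` with `h ∈ B¹ ⊗ ℂ`, `Q_h` non-degenerate: operators `T, T', Sa, Sb` in the `ℂ`-algebra of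
pull-backs as in `exists_matrixUnits_adjoint_of_quaternionOver_CM` (the CM centre `E = ℚ(ψ)`, `T = ψ^*`, its adjoint
`T' = ψ'^* ∈ ℂ[T]` with no real place; the quaternion generators `Sa = α^*`, `Sb = β^*` over `E`, adapted to the
involution); an auxiliary system of MATRIX UNITS `W_{ab}` (`a, b ∈ ι`) of pull-backs, `W_{ab} W_{cd} = δ_{bc} W_{ad}`,
`Σ W_{aa} = 1`, `W_{ab}† = W_{ba}`, commuting with `T, Sa, Sb` (for `X = Y^{n+1}`: the `(πₐ ≫ ι_b)^*`; for `X = Y`: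
`ι = Unit`, `W = 1`); `F = ℚ(φ)` with `φ^* ∈ ℂ⟨T, Sa, Sb, W_{ab}⟩` («`F ⊆ End⁰(X) = M_ι(D)`»), `P(φ) = 0`, `P` monic
irreducible of degree `e`, `e · 2m = 2 dim A`.  IF the multiplicities are BALANCED —
`dim(V_ρ ∩ ker(T - σ)) = dim(V_ρ ∩ ker(T' - σ))` for every root `ρ` of `P` and every `σ` («`θ = 0`») — THEN
`W_F ⊗ ℂ ≤ 𝒟ᵐ ⊗ ℂ`.  Proof: the products `W_{ab} U_{ij}` of the `W`'s with the adjoint-closed `2 × 2` units `U_{ij}` of §2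
are matrix units indexed by `ι × Fin 2`, adjoint-closed, commuting with `T`, and `ℂ⟨T, W_{ab} U_{ij}⟩ ∋ Sa, Sb, W_{ab}`;
then the seat's CM-centre mechanism `weilClassesField_le_divisorClassesSpan_of_matrixUnits_of_forall_finrank_eq`
(torus normalisation on the corners `P_σ U_{i₀i₀} V`).
[cite: MoonenZarhin1998WeilClasses, §1 Criterion (2), case «Type 4 with d ≥ 2 or m ≥ 2» and its proof (chunk p0003 L46–L80); Table 1 («B = End⁰(X)» for type 4)]
[cite: Milne1999LefschetzClasses, §1 pp. 642–644, Thm. 3.2, Cor. 4.5] [cite: McconnellRobson2001, 3.5.5–3.5.7] -/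
theorem weilClassesField_le_divisorClassesSpan_of_quaternionOver_CM_matrixUnits_of_forall_finrank_eq
    (hPm : P.Monic) (hPe : P.natDegree = e) (hPirr : Irreducible (P.map (Int.castRingHom ℚ)))
    (hφ : Polynomial.eval₂ (Int.castRingHom (CategoryTheory.End A)) (φ : CategoryTheory.End A) P = 0)
    (her : e * (2 * m) = 2 * A.dim) (hh : h ∈ hodgeClassSpan A.dim A.X 1)
    (hnd : ∀ x : complexBetti A.X 1, (∀ y, polarizationPairingOne A.X h (A.dim - 1) x y = 0) → x = 0)
    (hTe : T ∈ Algebra.adjoin ℂ (Set.range fun χ : A ⟶ A ↦ pullbackOne A χ))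
    (hT'e : T' ∈ Algebra.adjoin ℂ (Set.range fun χ : A ⟶ A ↦ pullbackOne A χ))
    (hSae : Sa ∈ Algebra.adjoin ℂ (Set.range fun χ : A ⟶ A ↦ pullbackOne A χ))
    (hSbe : Sb ∈ Algebra.adjoin ℂ (Set.range fun χ : A ⟶ A ↦ pullbackOne A χ))
    (hRm : R.Monic) (hRirr : Irreducible (R.map (Int.castRingHom ℚ)))
    (hTR : aeval T (R.map (Int.castRingHom ℂ)) = 0)
    (hT' : T' ∈ Algebra.adjoin ℂ ({T} : Set (Module.End ℂ (complexBetti A.X 1))))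
    (hadj : ∀ x y : complexBetti A.X 1, polarizationPairingOne A.X h (A.dim - 1) (T x) y =
      polarizationPairingOne A.X h (A.dim - 1) x (T' y))
    (hCM : ∀ σ : ℂ, T.eigenspace σ ⊓ T'.eigenspace σ = ⊥)
    (hTSa : T * Sa = Sa * T) (hTSb : T * Sb = Sb * T) (hanti : Sa * Sb = -(Sb * Sa))
    (hSa2 : Sa * Sa = aeval T qa) (hqa : ∀ z : ℂ, (R.map (Int.castRingHom ℂ)).IsRoot z → qa.eval z ≠ 0)
    (hSb2 : Sb * Sb = aeval T qb) (hqb : ∀ z : ℂ, (R.map (Int.castRingHom ℂ)).IsRoot z → qb.eval z ≠ 0)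
    (hεa : εa * εa = 1) (hεb : εb * εb = 1)
    (hαadj : ∀ x y : complexBetti A.X 1, polarizationPairingOne A.X h (A.dim - 1) (Sa x) y =
      εa • polarizationPairingOne A.X h (A.dim - 1) x (Sa y))
    (hβadj : ∀ x y : complexBetti A.X 1, polarizationPairingOne A.X h (A.dim - 1) (Sb x) y =
      εb • polarizationPairingOne A.X h (A.dim - 1) x (Sb y))
    (i₀ : ι) (hWe : ∀ a b, W a b ∈ Algebra.adjoin ℂ (Set.range fun χ : A ⟶ A ↦ pullbackOne A χ))
    (hWmul : ∀ a b c d, W a b * W c d = if b = c then W a d else 0) (hWsum : ∑ a, W a a = 1)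
    (hWadj : ∀ a b (x y : complexBetti A.X 1), polarizationPairingOne A.X h (A.dim - 1) (W a b x) y =
      polarizationPairingOne A.X h (A.dim - 1) x (W b a y))
    (hWT : ∀ a b, T * W a b = W a b * T) (hWSa : ∀ a b, Sa * W a b = W a b * Sa)
    (hWSb : ∀ a b, Sb * W a b = W a b * Sb)
    (hF : pullbackOne A φ ∈ Algebra.adjoin ℂ
      (insert T (insert Sa (insert Sb (Set.range fun ab : ι × ι ↦ W ab.1 ab.2)))))
    (hbal : ∀ ρ : ℂ, Polynomial.eval₂ (Int.castRingHom ℂ) ρ P = 0 → ∀ σ : ℂ,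
      Module.finrank ℂ ↥((pullbackOne A φ).eigenspace ρ ⊓ T.eigenspace σ) =
        Module.finrank ℂ ↥((pullbackOne A φ).eigenspace ρ ⊓ T'.eigenspace σ)) :
    weilClassesField A φ P (2 * m) ≤ divisorClassesSpan A.X A.dim m := by
  classical
  set Q := polarizationPairingOne A.X h (A.dim - 1) with hQdef
  obtain ⟨V, hVmul, hVsum, hVadj, hVT, hVmem, hSaV, hSbV⟩ :=
    exists_matrixUnits_adjoint_of_quaternionOver_CM hnd hRm hRirr hTR hT' hadj hCM hTSa hTSb hanti hSa2 hqa hSb2 hqb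
      hεa hεb hαadj hβadj
  -- `T' ∈ ℂ[T]` commutes with the `W_{ab}`; the `V_{ij} ∈ ℂ⟨T, T', Sa, Sb⟩` commute with the `W_{ab}`
  have hWT' : ∀ a b, T' * W a b = W a b * T' := by
    intro a b
    have hT'' := hT'
    rw [Algebra.adjoin_singleton_eq_range_aeval] at hT''
    obtain ⟨r, hr⟩ := hT''
    replace hr : aeval T r = T' := hr
    rw [← hr]
    exact aeval_comm_of_comm' T (W a b) (hWT a b) r
  have hWV : ∀ a b i j, W a b * V i j = V i j * W a b := by
    intro a b i j
    have hsub : ({T, T', Sa, Sb} : Set (Module.End ℂ (complexBetti A.X 1))) ⊆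
        Subalgebra.centralizer ℂ ({W a b} : Set (Module.End ℂ (complexBetti A.X 1))) := by
      intro g hg
      rw [SetLike.mem_coe, Subalgebra.mem_centralizer_iff]
      intro k hk
      rw [Set.mem_singleton_iff.1 hk]
      rcases hg with rfl | rfl | rfl | rfl
      · exact (hWT a b).symm
      · exact (hWT' a b).symm
      · exact (hWSa a b).symm
      · exact (hWSb a b).symm
    have hg' := Algebra.adjoin_le hsub (hVmem i j)
    rw [Subalgebra.mem_centralizer_iff] at hg'
    exact hg' _ rfl
  have gens : Algebra.adjoin ℂ ({T, T', Sa, Sb} : Set (Module.End ℂ (complexBetti A.X 1))) ≤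
      Algebra.adjoin ℂ (Set.range fun χ : A ⟶ A ↦ pullbackOne A χ) :=
    Algebra.adjoin_le (by
      rintro g (rfl | rfl | rfl | rfl)
      exacts [hTe, hT'e, hSae, hSbe])
  -- the product system `U_{(a,i),(b,j)} = W_{ab} V_{ij}`
  set U : ι × Fin 2 → ι × Fin 2 → Module.End ℂ (complexBetti A.X 1) := fun p q ↦ W p.1 q.1 * V p.2 q.2 with hUdef
  refine CentralTorus.weilClassesField_le_divisorClassesSpan_of_matrixUnits_of_forall_finrank_eq (ι := ι × Fin 2) (U := U) hPm hPe
    hPirr hφ her hh hnd hTe hRm hRirr hTR hT' hadj hCM (i₀, 0)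
    (fun p q ↦ Subalgebra.mul_mem _ (hWe _ _) (gens (hVmem _ _))) (fun p q p' q' ↦ ?_) ?_ (fun p q x y ↦ ?_)
    (fun p q ↦ ?_) (Algebra.adjoin_le ?_ hF) hbal
  · -- multiplication table
    change W p.1 q.1 * V p.2 q.2 * (W p'.1 q'.1 * V p'.2 q'.2) = if q = p' then W p.1 q'.1 * V p.2 q'.2 else 0
    rw [mul_assoc, ← mul_assoc (V p.2 q.2), ← hWV, mul_assoc (W p'.1 q'.1), ← mul_assoc (W p.1 q.1), hWmul, hVmul]
    by_cases h1 : q.1 = p'.1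
    · by_cases h2 : q.2 = p'.2
      · rw [if_pos h1, if_pos h2, if_pos (Prod.ext h1 h2)]
      · rw [if_pos h1, if_neg h2, mul_zero, if_neg fun h' ↦ h2 (congrArg Prod.snd h')]
    · rw [if_neg h1, zero_mul, if_neg fun h' ↦ h1 (congrArg Prod.fst h')]
  · -- `Σ U_{(a,i),(a,i)} = 1`
    change ∑ p : ι × Fin 2, W p.1 p.1 * V p.2 p.2 = 1
    rw [Fintype.sum_prod_type]
    dsimp only
    simp_rw [← Finset.mul_sum, hVsum, mul_one]
    exact hWsum
  · -- adjoint-closed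
    change Q ((W p.1 q.1 * V p.2 q.2) x) y = Q x ((W q.1 p.1 * V q.2 p.2) y)
    rw [adj_mul' Q (hWadj p.1 q.1) (hVadj p.2 q.2) x y, ← hWV]
  · -- commuting with `T`
    change T * (W p.1 q.1 * V p.2 q.2) = W p.1 q.1 * V p.2 q.2 * T
    rw [← mul_assoc, hWT, mul_assoc, hVT, ← mul_assoc]
  · -- the generators `T, Sa, Sb, W_{ab}` lie in `ℂ⟨T, U⟩`
    set 𝔘 := Algebra.adjoin ℂ (insert T (Set.range fun pq : (ι × Fin 2) × (ι × Fin 2) ↦ U pq.1 pq.2)) with h𝔘def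
    have hU𝔘 : ∀ a b i j, W a b * V i j ∈ 𝔘 := fun a b i j ↦
      Algebra.subset_adjoin (Set.mem_insert_of_mem _ ⟨((a, i), (b, j)), rfl⟩)
    have hT𝔘 : T ∈ 𝔘 := Algebra.subset_adjoin (Set.mem_insert _ _)
    have hV𝔘 : ∀ i j, V i j ∈ 𝔘 := fun i j ↦ by
      have e : V i j = ∑ a, W a a * V i j := by rw [← Finset.sum_mul, hWsum, one_mul]
      rw [e]
      exact Subalgebra.sum_mem _ fun a _ ↦ hU𝔘 a a i j
    have hW𝔘 : ∀ a b, W a b ∈ 𝔘 := fun a b ↦ by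
      have e : W a b = ∑ i, W a b * V i i := by rw [← Finset.mul_sum, hVsum, mul_one]
      rw [e]
      exact Subalgebra.sum_mem _ fun i _ ↦ hU𝔘 a b i i
    have hVT𝔘 : Algebra.adjoin ℂ (insert T (Set.range fun ab : Fin 2 × Fin 2 ↦ V ab.1 ab.2)) ≤ 𝔘 :=
      Algebra.adjoin_le (Set.insert_subset_iff.2 ⟨hT𝔘, by rintro _ ⟨ab, rfl⟩; exact hV𝔘 _ _⟩)
    exact Set.insert_subset_iff.2 ⟨hT𝔘, Set.insert_subset_iff.2 ⟨hVT𝔘 hSaV, Set.insert_subset_iff.2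
      ⟨hVT𝔘 hSbV, by rintro _ ⟨ab, rfl⟩; exact hW𝔘 _ _⟩⟩⟩

/-- **… hence ALGEBRAIC** (`W_F ⊗ ℂ ≤ algebraicClasses A.X m`, Lefschetz (1,1) and products).
[cite: MoonenZarhin1998WeilClasses, Introduction (chunk p0001 L10–L18) and §1 Criterion (2) (chunk p0003 L46–L80)] [cite: VoisinHodgeI2002, Thm. 11.30] -/
theorem weilClassesField_le_algebraicClasses_of_quaternionOver_CM_matrixUnits_of_forall_finrank_eq
    (hPm : P.Monic) (hPe : P.natDegree = e) (hPirr : Irreducible (P.map (Int.castRingHom ℚ)))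
    (hφ : Polynomial.eval₂ (Int.castRingHom (CategoryTheory.End A)) (φ : CategoryTheory.End A) P = 0)
    (her : e * (2 * m) = 2 * A.dim) (hh : h ∈ hodgeClassSpan A.dim A.X 1)
    (hnd : ∀ x : complexBetti A.X 1, (∀ y, polarizationPairingOne A.X h (A.dim - 1) x y = 0) → x = 0)
    (hTe : T ∈ Algebra.adjoin ℂ (Set.range fun χ : A ⟶ A ↦ pullbackOne A χ))
    (hT'e : T' ∈ Algebra.adjoin ℂ (Set.range fun χ : A ⟶ A ↦ pullbackOne A χ))
    (hSae : Sa ∈ Algebra.adjoin ℂ (Set.range fun χ : A ⟶ A ↦ pullbackOne A χ))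
    (hSbe : Sb ∈ Algebra.adjoin ℂ (Set.range fun χ : A ⟶ A ↦ pullbackOne A χ))
    (hRm : R.Monic) (hRirr : Irreducible (R.map (Int.castRingHom ℚ)))
    (hTR : aeval T (R.map (Int.castRingHom ℂ)) = 0)
    (hT' : T' ∈ Algebra.adjoin ℂ ({T} : Set (Module.End ℂ (complexBetti A.X 1))))
    (hadj : ∀ x y : complexBetti A.X 1, polarizationPairingOne A.X h (A.dim - 1) (T x) y =
      polarizationPairingOne A.X h (A.dim - 1) x (T' y))
    (hCM : ∀ σ : ℂ, T.eigenspace σ ⊓ T'.eigenspace σ = ⊥)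
    (hTSa : T * Sa = Sa * T) (hTSb : T * Sb = Sb * T) (hanti : Sa * Sb = -(Sb * Sa))
    (hSa2 : Sa * Sa = aeval T qa) (hqa : ∀ z : ℂ, (R.map (Int.castRingHom ℂ)).IsRoot z → qa.eval z ≠ 0)
    (hSb2 : Sb * Sb = aeval T qb) (hqb : ∀ z : ℂ, (R.map (Int.castRingHom ℂ)).IsRoot z → qb.eval z ≠ 0)
    (hεa : εa * εa = 1) (hεb : εb * εb = 1)
    (hαadj : ∀ x y : complexBetti A.X 1, polarizationPairingOne A.X h (A.dim - 1) (Sa x) y =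
      εa • polarizationPairingOne A.X h (A.dim - 1) x (Sa y))
    (hβadj : ∀ x y : complexBetti A.X 1, polarizationPairingOne A.X h (A.dim - 1) (Sb x) y =
      εb • polarizationPairingOne A.X h (A.dim - 1) x (Sb y))
    (i₀ : ι) (hWe : ∀ a b, W a b ∈ Algebra.adjoin ℂ (Set.range fun χ : A ⟶ A ↦ pullbackOne A χ))
    (hWmul : ∀ a b c d, W a b * W c d = if b = c then W a d else 0) (hWsum : ∑ a, W a a = 1)
    (hWadj : ∀ a b (x y : complexBetti A.X 1), polarizationPairingOne A.X h (A.dim - 1) (W a b x) y =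
      polarizationPairingOne A.X h (A.dim - 1) x (W b a y))
    (hWT : ∀ a b, T * W a b = W a b * T) (hWSa : ∀ a b, Sa * W a b = W a b * Sa)
    (hWSb : ∀ a b, Sb * W a b = W a b * Sb)
    (hF : pullbackOne A φ ∈ Algebra.adjoin ℂ
      (insert T (insert Sa (insert Sb (Set.range fun ab : ι × ι ↦ W ab.1 ab.2)))))
    (hbal : ∀ ρ : ℂ, Polynomial.eval₂ (Int.castRingHom ℂ) ρ P = 0 → ∀ σ : ℂ,
      Module.finrank ℂ ↥((pullbackOne A φ).eigenspace ρ ⊓ T.eigenspace σ) =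
        Module.finrank ℂ ↥((pullbackOne A φ).eigenspace ρ ⊓ T'.eigenspace σ)) :
    weilClassesField A φ P (2 * m) ≤ algebraicClasses A.X m :=
  (weilClassesField_le_divisorClassesSpan_of_quaternionOver_CM_matrixUnits_of_forall_finrank_eq hPm hPe hPirr hφ her hh hnd
    hTe hT'e hSae hSbe hRm hRirr hTR hT' hadj hCM hTSa hTSb hanti hSa2 hqa hSb2 hqb hεa hεb hαadj hβadj i₀ hWe hWmul hWsum
    hWadj hWT hWSa hWSb hF hbal).trans
    (AbelianVariety.divisorClassesSpan_le_algebraicClasses A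
      (fun b hb hb' ↦ lefschetzOneOne_rational_holds (AbelianVariety.isSmoothProjective_holds (A := A)) b hb hb') m)

end Carrier

/-! ### §4 ON `A` ITSELF (`m = 1`, `F ⊆ D`): decomposable iff balanced, exceptional iff unbalanced, the dichotomy -/

section Simple

variable {A : AbelianVariety ℂ} {h : complexBetti A.X 2} {φ ψ ψ' α β : A ⟶ A} {P R : Polynomial ℤ} {e m : ℕ}
  {qa qb : ℂ[X]} {εa εb : ℂ}

/-- **TYPE 4 WITH `d = 2`, `m = 1`, THE DECOMPOSABLE HALF ON THE CARRIER.**  `A` a complex abelian variety, `h ∈ B¹ ⊗ ℂ`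
with `Q_h` non-degenerate; `ψ ∈ End(A)` with `R(ψ) = 0` (`R` monic irreducible over `ℚ`; `E = ℚ(ψ)`), Rosati image
`ψ' ∈ End(A)` (`Q_h(ψ^* x, y) = Q_h(x, ψ'^* y)`) with `ψ'^* ∈ ℂ[ψ^*]` and no real place `ker(ψ^* - σ) ∩ ker(ψ'^* - σ) = 0`
(`E` is CM); `α, β ∈ End(A)` with `α^*, β^*` commuting with `ψ^*`, anticommuting, `α^{*2} = a(ψ^*)`, `β^{*2} = b(ψ^*)`
(`a, b` non-vanishing at the roots of `R`: `α², β² ∈ E^×`), `Q_h(α^* x, y) = εa Q_h(x, α^* y)`, `Q_h(β^* x, y) =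
εb Q_h(x, β^* y)`, `εa² = εb² = 1` («`D = E⟨α, β⟩` a quaternion algebra over `E` with involution of the second kind,
generators adapted to it»); `F = ℚ(φ)` with `φ^* ∈ ℂ⟨ψ^*, α^*, β^*⟩` («`F ⊆ D`»), `P(φ) = 0`, `P` monic irreducible of
degree `e`, `e · 2m = 2 dim A`.  IF `dim(V_ρ ∩ ker(ψ^* - σ)) = dim(V_ρ ∩ ker(ψ'^* - σ))` for all roots `ρ` of `P` and all
`σ` («`θ = 0`») THEN `W_F ⊗ ℂ ≤ 𝒟ᵐ ⊗ ℂ` (§3 with `W = 1`).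
[cite: MoonenZarhin1998WeilClasses, §1 Criterion (2), case «Type 4 with d ≥ 2 or m ≥ 2» and its proof (chunk p0003 L46–L80)]
[cite: Milne1999LefschetzClasses, §1 pp. 642–644, Thm. 3.2, Cor. 4.5] -/
theorem weilClassesField_le_divisorClassesSpan_of_quaternionOver_CMField_of_forall_finrank_eq (hPm : P.Monic)
    (hPe : P.natDegree = e) (hPirr : Irreducible (P.map (Int.castRingHom ℚ)))
    (hφ : Polynomial.eval₂ (Int.castRingHom (CategoryTheory.End A)) (φ : CategoryTheory.End A) P = 0)
    (her : e * (2 * m) = 2 * A.dim) (hh : h ∈ hodgeClassSpan A.dim A.X 1)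
    (hnd : ∀ x : complexBetti A.X 1, (∀ y, polarizationPairingOne A.X h (A.dim - 1) x y = 0) → x = 0)
    (hRm : R.Monic) (hRirr : Irreducible (R.map (Int.castRingHom ℚ)))
    (hψR : Polynomial.eval₂ (Int.castRingHom (CategoryTheory.End A)) (ψ : CategoryTheory.End A) R = 0)
    (hψ' : pullbackOne A ψ' ∈ Algebra.adjoin ℂ ({pullbackOne A ψ} : Set (Module.End ℂ (complexBetti A.X 1))))
    (hadj : ∀ x y : complexBetti A.X 1, polarizationPairingOne A.X h (A.dim - 1) (pullbackOne A ψ x) y =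
      polarizationPairingOne A.X h (A.dim - 1) x (pullbackOne A ψ' y))
    (hCM : ∀ σ : ℂ, (pullbackOne A ψ).eigenspace σ ⊓ (pullbackOne A ψ').eigenspace σ = ⊥)
    (hψα : pullbackOne A ψ * pullbackOne A α = pullbackOne A α * pullbackOne A ψ)
    (hψβ : pullbackOne A ψ * pullbackOne A β = pullbackOne A β * pullbackOne A ψ)
    (hanti : pullbackOne A α * pullbackOne A β = -(pullbackOne A β * pullbackOne A α))
    (hα2 : pullbackOne A α * pullbackOne A α = aeval (pullbackOne A ψ) qa)
    (hqa : ∀ z : ℂ, (R.map (Int.castRingHom ℂ)).IsRoot z → qa.eval z ≠ 0)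
    (hβ2 : pullbackOne A β * pullbackOne A β = aeval (pullbackOne A ψ) qb)
    (hqb : ∀ z : ℂ, (R.map (Int.castRingHom ℂ)).IsRoot z → qb.eval z ≠ 0) (hεa : εa * εa = 1) (hεb : εb * εb = 1)
    (hαadj : ∀ x y : complexBetti A.X 1, polarizationPairingOne A.X h (A.dim - 1) (pullbackOne A α x) y =
      εa • polarizationPairingOne A.X h (A.dim - 1) x (pullbackOne A α y))
    (hβadj : ∀ x y : complexBetti A.X 1, polarizationPairingOne A.X h (A.dim - 1) (pullbackOne A β x) y =
      εb • polarizationPairingOne A.X h (A.dim - 1) x (pullbackOne A β y))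
    (hF : pullbackOne A φ ∈ Algebra.adjoin ℂ
      ({pullbackOne A ψ, pullbackOne A α, pullbackOne A β} : Set (Module.End ℂ (complexBetti A.X 1))))
    (hbal : ∀ ρ : ℂ, Polynomial.eval₂ (Int.castRingHom ℂ) ρ P = 0 → ∀ σ : ℂ,
      Module.finrank ℂ ↥((pullbackOne A φ).eigenspace ρ ⊓ (pullbackOne A ψ).eigenspace σ) =
        Module.finrank ℂ ↥((pullbackOne A φ).eigenspace ρ ⊓ (pullbackOne A ψ').eigenspace σ)) :
    weilClassesField A φ P (2 * m) ≤ divisorClassesSpan A.X A.dim m :=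
  weilClassesField_le_divisorClassesSpan_of_quaternionOver_CM_matrixUnits_of_forall_finrank_eq (ι := Unit)
    (W := fun _ _ ↦ (1 : Module.End ℂ (complexBetti A.X 1))) hPm hPe hPirr hφ her hh hnd (Algebra.subset_adjoin ⟨ψ, rfl⟩)
    (Algebra.subset_adjoin ⟨ψ', rfl⟩) (Algebra.subset_adjoin ⟨α, rfl⟩) (Algebra.subset_adjoin ⟨β, rfl⟩) hRm hRirr
    (aeval_hom_complexBetti_map_one_eq_zero hψR) hψ' hadj hCM hψα hψβ hanti hα2 hqa hβ2 hqb hεa hεb hαadj hβadj ()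
    (fun _ _ ↦ Subalgebra.one_mem _) (fun _ _ _ _ ↦ by rw [mul_one, if_pos rfl]) (Fintype.sum_unique _)
    (fun _ _ _ _ ↦ rfl) (fun _ _ ↦ by rw [mul_one, one_mul]) (fun _ _ ↦ by rw [mul_one, one_mul])
    (fun _ _ ↦ by rw [mul_one, one_mul])
    (Algebra.adjoin_mono (Set.insert_subset_insert (Set.insert_subset_insert
      (Set.singleton_subset_iff.2 (Set.mem_insert _ _)))) hF) hbal

/-- **… hence ALGEBRAIC.** [cite: MoonenZarhin1998WeilClasses, Introduction (chunk p0001 L10–L18) and §1 Criterion (2) (chunk p0003 L46–L80)]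
[cite: VoisinHodgeI2002, Thm. 11.30] -/
theorem weilClassesField_le_algebraicClasses_of_quaternionOver_CMField_of_forall_finrank_eq (hPm : P.Monic)
    (hPe : P.natDegree = e) (hPirr : Irreducible (P.map (Int.castRingHom ℚ)))
    (hφ : Polynomial.eval₂ (Int.castRingHom (CategoryTheory.End A)) (φ : CategoryTheory.End A) P = 0)
    (her : e * (2 * m) = 2 * A.dim) (hh : h ∈ hodgeClassSpan A.dim A.X 1)
    (hnd : ∀ x : complexBetti A.X 1, (∀ y, polarizationPairingOne A.X h (A.dim - 1) x y = 0) → x = 0)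
    (hRm : R.Monic) (hRirr : Irreducible (R.map (Int.castRingHom ℚ)))
    (hψR : Polynomial.eval₂ (Int.castRingHom (CategoryTheory.End A)) (ψ : CategoryTheory.End A) R = 0)
    (hψ' : pullbackOne A ψ' ∈ Algebra.adjoin ℂ ({pullbackOne A ψ} : Set (Module.End ℂ (complexBetti A.X 1))))
    (hadj : ∀ x y : complexBetti A.X 1, polarizationPairingOne A.X h (A.dim - 1) (pullbackOne A ψ x) y =
      polarizationPairingOne A.X h (A.dim - 1) x (pullbackOne A ψ' y))
    (hCM : ∀ σ : ℂ, (pullbackOne A ψ).eigenspace σ ⊓ (pullbackOne A ψ').eigenspace σ = ⊥)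
    (hψα : pullbackOne A ψ * pullbackOne A α = pullbackOne A α * pullbackOne A ψ)
    (hψβ : pullbackOne A ψ * pullbackOne A β = pullbackOne A β * pullbackOne A ψ)
    (hanti : pullbackOne A α * pullbackOne A β = -(pullbackOne A β * pullbackOne A α))
    (hα2 : pullbackOne A α * pullbackOne A α = aeval (pullbackOne A ψ) qa)
    (hqa : ∀ z : ℂ, (R.map (Int.castRingHom ℂ)).IsRoot z → qa.eval z ≠ 0)
    (hβ2 : pullbackOne A β * pullbackOne A β = aeval (pullbackOne A ψ) qb)
    (hqb : ∀ z : ℂ, (R.map (Int.castRingHom ℂ)).IsRoot z → qb.eval z ≠ 0) (hεa : εa * εa = 1) (hεb : εb * εb = 1)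
    (hαadj : ∀ x y : complexBetti A.X 1, polarizationPairingOne A.X h (A.dim - 1) (pullbackOne A α x) y =
      εa • polarizationPairingOne A.X h (A.dim - 1) x (pullbackOne A α y))
    (hβadj : ∀ x y : complexBetti A.X 1, polarizationPairingOne A.X h (A.dim - 1) (pullbackOne A β x) y =
      εb • polarizationPairingOne A.X h (A.dim - 1) x (pullbackOne A β y))
    (hF : pullbackOne A φ ∈ Algebra.adjoin ℂ
      ({pullbackOne A ψ, pullbackOne A α, pullbackOne A β} : Set (Module.End ℂ (complexBetti A.X 1))))
    (hbal : ∀ ρ : ℂ, Polynomial.eval₂ (Int.castRingHom ℂ) ρ P = 0 → ∀ σ : ℂ,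
      Module.finrank ℂ ↥((pullbackOne A φ).eigenspace ρ ⊓ (pullbackOne A ψ).eigenspace σ) =
        Module.finrank ℂ ↥((pullbackOne A φ).eigenspace ρ ⊓ (pullbackOne A ψ').eigenspace σ)) :
    weilClassesField A φ P (2 * m) ≤ algebraicClasses A.X m :=
  (weilClassesField_le_divisorClassesSpan_of_quaternionOver_CMField_of_forall_finrank_eq hPm hPe hPirr hφ her hh hnd hRm hRirr
    hψR hψ' hadj hCM hψα hψβ hanti hα2 hqa hβ2 hqb hεa hεb hαadj hβadj hF hbal).trans
    (AbelianVariety.divisorClassesSpan_le_algebraicClasses A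
      (fun b hb hb' ↦ lefschetzOneOne_rational_holds (AbelianVariety.isSmoothProjective_holds (A := A)) b hb hb') m)

/-- **«`W_F` DECOMPOSABLE ⟺ `θ = 0`», TYPE 4 WITH `d = 2`, `m = 1`, ON THE CARRIER** (for `ψ^*` central in the algebra
of pull-backs, `m ≠ 0`): `W_F ⊗ ℂ ≤ 𝒟ᵐ ⊗ ℂ` iff the multiplicities of `ψ^*` and `ψ'^*` agree on every `V_ρ`; the
«only if» half is the seat's torus argument `weilClassesField_inf_divisorClassesSpan_eq_bot_of_central_of_finrank_ne` with
`dim W_F ⊗ ℂ = e ≠ 0`. [cite: MoonenZarhin1998WeilClasses, §1 Criterion (2), case «Type 4 with d ≥ 2 or m ≥ 2» and its proof (chunk p0003 L46–L80)]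
[cite: Milne1999LefschetzClasses, §1 pp. 642–644, Thm. 3.2, Cor. 4.5] -/
theorem weilClassesField_le_divisorClassesSpan_iff_forall_finrank_eq_of_central_quaternionOver_CMField (hPm : P.Monic)
    (hPe : P.natDegree = e) (hPirr : Irreducible (P.map (Int.castRingHom ℚ)))
    (hφ : Polynomial.eval₂ (Int.castRingHom (CategoryTheory.End A)) (φ : CategoryTheory.End A) P = 0)
    (her : e * (2 * m) = 2 * A.dim) (hm : m ≠ 0) (hh : h ∈ hodgeClassSpan A.dim A.X 1)
    (hnd : ∀ x : complexBetti A.X 1, (∀ y, polarizationPairingOne A.X h (A.dim - 1) x y = 0) → x = 0)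
    (hψC : pullbackOne A ψ ∈ centralizerAlgebra A)
    (hRm : R.Monic) (hRirr : Irreducible (R.map (Int.castRingHom ℚ)))
    (hψR : Polynomial.eval₂ (Int.castRingHom (CategoryTheory.End A)) (ψ : CategoryTheory.End A) R = 0)
    (hψ' : pullbackOne A ψ' ∈ Algebra.adjoin ℂ ({pullbackOne A ψ} : Set (Module.End ℂ (complexBetti A.X 1))))
    (hadj : ∀ x y : complexBetti A.X 1, polarizationPairingOne A.X h (A.dim - 1) (pullbackOne A ψ x) y =
      polarizationPairingOne A.X h (A.dim - 1) x (pullbackOne A ψ' y))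
    (hCM : ∀ σ : ℂ, (pullbackOne A ψ).eigenspace σ ⊓ (pullbackOne A ψ').eigenspace σ = ⊥)
    (hψα : pullbackOne A ψ * pullbackOne A α = pullbackOne A α * pullbackOne A ψ)
    (hψβ : pullbackOne A ψ * pullbackOne A β = pullbackOne A β * pullbackOne A ψ)
    (hanti : pullbackOne A α * pullbackOne A β = -(pullbackOne A β * pullbackOne A α))
    (hα2 : pullbackOne A α * pullbackOne A α = aeval (pullbackOne A ψ) qa)
    (hqa : ∀ z : ℂ, (R.map (Int.castRingHom ℂ)).IsRoot z → qa.eval z ≠ 0)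
    (hβ2 : pullbackOne A β * pullbackOne A β = aeval (pullbackOne A ψ) qb)
    (hqb : ∀ z : ℂ, (R.map (Int.castRingHom ℂ)).IsRoot z → qb.eval z ≠ 0) (hεa : εa * εa = 1) (hεb : εb * εb = 1)
    (hαadj : ∀ x y : complexBetti A.X 1, polarizationPairingOne A.X h (A.dim - 1) (pullbackOne A α x) y =
      εa • polarizationPairingOne A.X h (A.dim - 1) x (pullbackOne A α y))
    (hβadj : ∀ x y : complexBetti A.X 1, polarizationPairingOne A.X h (A.dim - 1) (pullbackOne A β x) y =
      εb • polarizationPairingOne A.X h (A.dim - 1) x (pullbackOne A β y))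
    (hF : pullbackOne A φ ∈ Algebra.adjoin ℂ
      ({pullbackOne A ψ, pullbackOne A α, pullbackOne A β} : Set (Module.End ℂ (complexBetti A.X 1)))) :
    weilClassesField A φ P (2 * m) ≤ divisorClassesSpan A.X A.dim m ↔
      ∀ ρ : ℂ, Polynomial.eval₂ (Int.castRingHom ℂ) ρ P = 0 → ∀ σ : ℂ,
        Module.finrank ℂ ↥((pullbackOne A φ).eigenspace ρ ⊓ (pullbackOne A ψ).eigenspace σ) =
          Module.finrank ℂ ↥((pullbackOne A φ).eigenspace ρ ⊓ (pullbackOne A ψ').eigenspace σ) := by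
  refine ⟨fun hle ρ hρ σ ↦ ?_, fun hbal ↦
    weilClassesField_le_divisorClassesSpan_of_quaternionOver_CMField_of_forall_finrank_eq hPm hPe hPirr hφ her hh hnd hRm hRirr
      hψR hψ' hadj hCM hψα hψβ hanti hα2 hqa hβ2 hqb hεa hεb hαadj hβadj hF hbal⟩
  by_contra hne
  have hbot := weilClassesField_inf_divisorClassesSpan_eq_bot_of_central_of_finrank_ne hPm hPe hPirr hφ her hm hh hnd hψC hRirr
    hψR hψ' hadj hρ hne
  rw [inf_eq_left.2 hle] at hbot
  exact weilClassesField_ne_bot hPe hPirr hφ her (Nat.mul_ne_zero two_ne_zero hm) hbot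

/-- **«ALL NON-ZERO CLASSES EXCEPTIONAL ⟺ `θ ≠ 0`», TYPE 4 WITH `d = 2`, `m = 1`, ON THE CARRIER.**
[cite: MoonenZarhin1998WeilClasses, §1 Criterion (2), case «Type 4 with d ≥ 2 or m ≥ 2» and its proof (chunk p0003 L46–L80)]
[cite: Milne1999LefschetzClasses, §1 pp. 642–644, Thm. 3.2, Cor. 4.5] -/
theorem weilClassesField_inf_divisorClassesSpan_eq_bot_iff_exists_finrank_ne_of_central_quaternionOver_CMField
    (hPm : P.Monic) (hPe : P.natDegree = e) (hPirr : Irreducible (P.map (Int.castRingHom ℚ)))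
    (hφ : Polynomial.eval₂ (Int.castRingHom (CategoryTheory.End A)) (φ : CategoryTheory.End A) P = 0)
    (her : e * (2 * m) = 2 * A.dim) (hm : m ≠ 0) (hh : h ∈ hodgeClassSpan A.dim A.X 1)
    (hnd : ∀ x : complexBetti A.X 1, (∀ y, polarizationPairingOne A.X h (A.dim - 1) x y = 0) → x = 0)
    (hψC : pullbackOne A ψ ∈ centralizerAlgebra A)
    (hRm : R.Monic) (hRirr : Irreducible (R.map (Int.castRingHom ℚ)))
    (hψR : Polynomial.eval₂ (Int.castRingHom (CategoryTheory.End A)) (ψ : CategoryTheory.End A) R = 0)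
    (hψ' : pullbackOne A ψ' ∈ Algebra.adjoin ℂ ({pullbackOne A ψ} : Set (Module.End ℂ (complexBetti A.X 1))))
    (hadj : ∀ x y : complexBetti A.X 1, polarizationPairingOne A.X h (A.dim - 1) (pullbackOne A ψ x) y =
      polarizationPairingOne A.X h (A.dim - 1) x (pullbackOne A ψ' y))
    (hCM : ∀ σ : ℂ, (pullbackOne A ψ).eigenspace σ ⊓ (pullbackOne A ψ').eigenspace σ = ⊥)
    (hψα : pullbackOne A ψ * pullbackOne A α = pullbackOne A α * pullbackOne A ψ)
    (hψβ : pullbackOne A ψ * pullbackOne A β = pullbackOne A β * pullbackOne A ψ)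
    (hanti : pullbackOne A α * pullbackOne A β = -(pullbackOne A β * pullbackOne A α))
    (hα2 : pullbackOne A α * pullbackOne A α = aeval (pullbackOne A ψ) qa)
    (hqa : ∀ z : ℂ, (R.map (Int.castRingHom ℂ)).IsRoot z → qa.eval z ≠ 0)
    (hβ2 : pullbackOne A β * pullbackOne A β = aeval (pullbackOne A ψ) qb)
    (hqb : ∀ z : ℂ, (R.map (Int.castRingHom ℂ)).IsRoot z → qb.eval z ≠ 0) (hεa : εa * εa = 1) (hεb : εb * εb = 1)
    (hαadj : ∀ x y : complexBetti A.X 1, polarizationPairingOne A.X h (A.dim - 1) (pullbackOne A α x) y =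
      εa • polarizationPairingOne A.X h (A.dim - 1) x (pullbackOne A α y))
    (hβadj : ∀ x y : complexBetti A.X 1, polarizationPairingOne A.X h (A.dim - 1) (pullbackOne A β x) y =
      εb • polarizationPairingOne A.X h (A.dim - 1) x (pullbackOne A β y))
    (hF : pullbackOne A φ ∈ Algebra.adjoin ℂ
      ({pullbackOne A ψ, pullbackOne A α, pullbackOne A β} : Set (Module.End ℂ (complexBetti A.X 1)))) :
    weilClassesField A φ P (2 * m) ⊓ divisorClassesSpan A.X A.dim m = ⊥ ↔
      ∃ ρ σ : ℂ, Polynomial.eval₂ (Int.castRingHom ℂ) ρ P = 0 ∧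
        Module.finrank ℂ ↥((pullbackOne A φ).eigenspace ρ ⊓ (pullbackOne A ψ).eigenspace σ) ≠
          Module.finrank ℂ ↥((pullbackOne A φ).eigenspace ρ ⊓ (pullbackOne A ψ').eigenspace σ) := by
  refine ⟨fun hbot ↦ ?_, fun ⟨ρ, σ, hρ, hne⟩ ↦
    weilClassesField_inf_divisorClassesSpan_eq_bot_of_central_of_finrank_ne hPm hPe hPirr hφ her hm hh hnd hψC hRirr hψR hψ'
      hadj hρ hne⟩
  by_contra hall
  push Not at hall
  have hle := weilClassesField_le_divisorClassesSpan_of_quaternionOver_CMField_of_forall_finrank_eq hPm hPe hPirr hφ her hh hnd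
    hRm hRirr hψR hψ' hadj hCM hψα hψβ hanti hα2 hqa hβ2 hqb hεa hεb hαadj hβadj hF fun ρ hρ σ ↦ hall ρ σ hρ
  rw [inf_eq_left.2 hle] at hbot
  exact weilClassesField_ne_bot hPe hPirr hφ her (Nat.mul_ne_zero two_ne_zero hm) hbot

/-- **THE DICHOTOMY, TYPE 4 WITH `d = 2`, `m = 1`**: «either all classes in `W_F` are decomposable or all non-zero classes
in `W_F` are exceptional». [cite: MoonenZarhin1998WeilClasses, §1 Criterion (2) (chunk p0003 L46–L60)] -/
theorem weilClassesField_le_or_inf_divisorClassesSpan_eq_bot_of_central_quaternionOver_CMField (hPm : P.Monic)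
    (hPe : P.natDegree = e) (hPirr : Irreducible (P.map (Int.castRingHom ℚ)))
    (hφ : Polynomial.eval₂ (Int.castRingHom (CategoryTheory.End A)) (φ : CategoryTheory.End A) P = 0)
    (her : e * (2 * m) = 2 * A.dim) (hm : m ≠ 0) (hh : h ∈ hodgeClassSpan A.dim A.X 1)
    (hnd : ∀ x : complexBetti A.X 1, (∀ y, polarizationPairingOne A.X h (A.dim - 1) x y = 0) → x = 0)
    (hψC : pullbackOne A ψ ∈ centralizerAlgebra A)
    (hRm : R.Monic) (hRirr : Irreducible (R.map (Int.castRingHom ℚ)))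
    (hψR : Polynomial.eval₂ (Int.castRingHom (CategoryTheory.End A)) (ψ : CategoryTheory.End A) R = 0)
    (hψ' : pullbackOne A ψ' ∈ Algebra.adjoin ℂ ({pullbackOne A ψ} : Set (Module.End ℂ (complexBetti A.X 1))))
    (hadj : ∀ x y : complexBetti A.X 1, polarizationPairingOne A.X h (A.dim - 1) (pullbackOne A ψ x) y =
      polarizationPairingOne A.X h (A.dim - 1) x (pullbackOne A ψ' y))
    (hCM : ∀ σ : ℂ, (pullbackOne A ψ).eigenspace σ ⊓ (pullbackOne A ψ').eigenspace σ = ⊥)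
    (hψα : pullbackOne A ψ * pullbackOne A α = pullbackOne A α * pullbackOne A ψ)
    (hψβ : pullbackOne A ψ * pullbackOne A β = pullbackOne A β * pullbackOne A ψ)
    (hanti : pullbackOne A α * pullbackOne A β = -(pullbackOne A β * pullbackOne A α))
    (hα2 : pullbackOne A α * pullbackOne A α = aeval (pullbackOne A ψ) qa)
    (hqa : ∀ z : ℂ, (R.map (Int.castRingHom ℂ)).IsRoot z → qa.eval z ≠ 0)
    (hβ2 : pullbackOne A β * pullbackOne A β = aeval (pullbackOne A ψ) qb)
    (hqb : ∀ z : ℂ, (R.map (Int.castRingHom ℂ)).IsRoot z → qb.eval z ≠ 0) (hεa : εa * εa = 1) (hεb : εb * εb = 1)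
    (hαadj : ∀ x y : complexBetti A.X 1, polarizationPairingOne A.X h (A.dim - 1) (pullbackOne A α x) y =
      εa • polarizationPairingOne A.X h (A.dim - 1) x (pullbackOne A α y))
    (hβadj : ∀ x y : complexBetti A.X 1, polarizationPairingOne A.X h (A.dim - 1) (pullbackOne A β x) y =
      εb • polarizationPairingOne A.X h (A.dim - 1) x (pullbackOne A β y))
    (hF : pullbackOne A φ ∈ Algebra.adjoin ℂ
      ({pullbackOne A ψ, pullbackOne A α, pullbackOne A β} : Set (Module.End ℂ (complexBetti A.X 1)))) :
    weilClassesField A φ P (2 * m) ≤ divisorClassesSpan A.X A.dim m ∨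
      weilClassesField A φ P (2 * m) ⊓ divisorClassesSpan A.X A.dim m = ⊥ := by
  by_cases hbal : ∀ ρ : ℂ, Polynomial.eval₂ (Int.castRingHom ℂ) ρ P = 0 → ∀ σ : ℂ,
      Module.finrank ℂ ↥((pullbackOne A φ).eigenspace ρ ⊓ (pullbackOne A ψ).eigenspace σ) =
        Module.finrank ℂ ↥((pullbackOne A φ).eigenspace ρ ⊓ (pullbackOne A ψ').eigenspace σ)
  · exact Or.inl (weilClassesField_le_divisorClassesSpan_of_quaternionOver_CMField_of_forall_finrank_eq hPm hPe hPirr hφ her hh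
      hnd hRm hRirr hψR hψ' hadj hCM hψα hψβ hanti hα2 hqa hβ2 hqb hεa hεb hαadj hβadj hF hbal)
  · push Not at hbal
    obtain ⟨ρ, hρ, σ, hne⟩ := hbal
    exact Or.inr (weilClassesField_inf_divisorClassesSpan_eq_bot_of_central_of_finrank_ne hPm hPe hPirr hφ her hm hh hnd hψC
      hRirr hψR hψ' hadj hρ hne)

end Simple

/-! ### §5 POWERS `X = A^{n+1}` WITH THE PRODUCT POLARIZATION: `F ⊆ End⁰(X) = M_{n+1}(D)` -/

section Powers

variable {A : AbelianVariety ℂ} {h : complexBetti A.X 2} {n : ℕ} {ψ ψ' α β : A ⟶ A}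
  {φ : ⨁ (fun _ : Fin (n + 1) => A) ⟶ ⨁ (fun _ : Fin (n + 1) => A)} {P R : Polynomial ℤ} {e m : ℕ}
  {qa qb : ℂ[X]} {εa εb : ℂ}

/-- **A ROSATI-EIGEN `g` (`g† = ±g`) HAS ROSATI-EIGEN DIAGONAL `⊕g` WITH THE SAME SIGN** for the product polarization
`D = Σ πᵢ^* h` on `A^{n+1}` (`0 < dim A`) — the tree's `polarizationPairingOne_biproductMap_of_adjoint` (sign `+1`) and
`polarizationPairingOne_biproductMap_const_of_skew` (sign `-1`). [cite: Milne1999LefschetzClasses, §1 p. 643] [cite: LangeBirkenhake1992, §5.3] -/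
private theorem polarizationPairingOne_biproductMap_const_of_sign (hA : 0 < A.dim) (g : A ⟶ A) {ε : ℂ}
    (hε : ε = 1 ∨ ε = -1)
    (hg : ∀ a b : complexBetti A.X 1, polarizationPairingOne A.X h (A.dim - 1) (pullbackOne A g a) b =
      ε • polarizationPairingOne A.X h (A.dim - 1) a (pullbackOne A g b))
    (v w : complexBetti (⨁ (fun _ : Fin (n + 1) => A)).X 1) :
    polarizationPairingOne (⨁ (fun _ : Fin (n + 1) => A)).X (sumPolarizationClass (fun _ : Fin (n + 1) => A) fun _ => h)
        ((⨁ (fun _ : Fin (n + 1) => A)).dim - 1)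
        (pullbackOne (⨁ (fun _ : Fin (n + 1) => A)) (biproduct.map fun _ : Fin (n + 1) => g) v) w =
      ε • polarizationPairingOne (⨁ (fun _ : Fin (n + 1) => A)).X
        (sumPolarizationClass (fun _ : Fin (n + 1) => A) fun _ => h) ((⨁ (fun _ : Fin (n + 1) => A)).dim - 1) v
        (pullbackOne (⨁ (fun _ : Fin (n + 1) => A)) (biproduct.map fun _ : Fin (n + 1) => g) w) := by
  rcases hε with rfl | rfl
  · have key := polarizationPairingOne_biproductMap_of_adjoint (fun _ : Fin (n + 1) => A) (fun _ => h) (fun _ => hA)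
      (fun _ => g) (fun _ => g) (fun i a b ↦ by
        change polarizationPairingOne A.X h (A.dim - 1) (pullbackOne A g a) b =
          polarizationPairingOne A.X h (A.dim - 1) a (pullbackOne A g b)
        rw [hg, one_smul]) v w
    rw [one_smul]
    exact key
  · rw [neg_one_smul]
    exact polarizationPairingOne_biproductMap_const_of_skew hA g (fun a b ↦ by rw [hg, neg_one_smul]) v w

/-- **TYPE 4 WITH `d = 2` ON POWERS — THE DECOMPOSABLE HALF ON THE CARRIER: «`θ = 0` ⟹ `W_F(A^{n+1})` decomposable» for
`F ⊆ M_{n+1}(D)`.**  `A` of positive dimension with `h ∈ B¹ ⊗ ℂ`, `h^{dim A} ≠ 0`, `Q_h` non-degenerate; `ψ, ψ', α, β`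
as in `weilClassesField_le_divisorClassesSpan_of_quaternionOver_CMField_of_forall_finrank_eq` with the signs
`εa, εb ∈ {1, -1}`; `X = A^{n+1}` with the product polarization `Σ πᵢ^* h`; `φ ∈ End(X)` with
`φ^* ∈ ℂ⟨(⊕ψ)^*, (⊕α)^*, (⊕β)^*, (πₐ ≫ ι_b)^*⟩` («`F = ℚ(φ) ⊆ End⁰(X) = M_{n+1}(D)`»), `P(φ) = 0`, `P` monic irreducible
of degree `e`, `e · 2m = 2(n+1) dim A`.  IF the multiplicities of `σ` for `(⊕ψ)^*` and `(⊕ψ')^*` agree on every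
`V_ρ ⊆ H¹(X)` THEN `W_F(X) ⊗ ℂ ≤ 𝒟ᵐ(X) ⊗ ℂ` (§3 with the units `(πₐ ≫ ι_b)^*` and the diagonal data).
[cite: MoonenZarhin1998WeilClasses, §1 Criterion (2), case «Type 4 with d ≥ 2 or m ≥ 2» and its proof (chunk p0003 L46–L80); Table 1 («B = End⁰(X) = M_m(D)»)]
[cite: Milne1999LefschetzClasses, §1 p. 643, Thm. 3.2, Cor. 4.5] [cite: McconnellRobson2001, 3.5.5–3.5.7] -/
theorem weilClassesField_biproduct_le_divisorClassesSpan_of_quaternionOver_CMField_of_forall_finrank_eq (hA : 0 < A.dim)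
    (hh : h ∈ hodgeClassSpan A.dim A.X 1) (htop : lefschetzPow h (A.dim - 1) 2 h ≠ 0)
    (hnd : ∀ x : complexBetti A.X 1, (∀ y, polarizationPairingOne A.X h (A.dim - 1) x y = 0) → x = 0)
    (hRm : R.Monic) (hRirr : Irreducible (R.map (Int.castRingHom ℚ)))
    (hψR : Polynomial.eval₂ (Int.castRingHom (CategoryTheory.End A)) (ψ : CategoryTheory.End A) R = 0)
    (hψ' : pullbackOne A ψ' ∈ Algebra.adjoin ℂ ({pullbackOne A ψ} : Set (Module.End ℂ (complexBetti A.X 1))))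
    (hadj : ∀ x y : complexBetti A.X 1, polarizationPairingOne A.X h (A.dim - 1) (pullbackOne A ψ x) y =
      polarizationPairingOne A.X h (A.dim - 1) x (pullbackOne A ψ' y))
    (hCM : ∀ σ : ℂ, (pullbackOne A ψ).eigenspace σ ⊓ (pullbackOne A ψ').eigenspace σ = ⊥)
    (hψα : pullbackOne A ψ * pullbackOne A α = pullbackOne A α * pullbackOne A ψ)
    (hψβ : pullbackOne A ψ * pullbackOne A β = pullbackOne A β * pullbackOne A ψ)
    (hanti : pullbackOne A α * pullbackOne A β = -(pullbackOne A β * pullbackOne A α))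
    (hα2 : pullbackOne A α * pullbackOne A α = aeval (pullbackOne A ψ) qa)
    (hqa : ∀ z : ℂ, (R.map (Int.castRingHom ℂ)).IsRoot z → qa.eval z ≠ 0)
    (hβ2 : pullbackOne A β * pullbackOne A β = aeval (pullbackOne A ψ) qb)
    (hqb : ∀ z : ℂ, (R.map (Int.castRingHom ℂ)).IsRoot z → qb.eval z ≠ 0) (hεa : εa = 1 ∨ εa = -1)
    (hεb : εb = 1 ∨ εb = -1)
    (hαadj : ∀ x y : complexBetti A.X 1, polarizationPairingOne A.X h (A.dim - 1) (pullbackOne A α x) y =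
      εa • polarizationPairingOne A.X h (A.dim - 1) x (pullbackOne A α y))
    (hβadj : ∀ x y : complexBetti A.X 1, polarizationPairingOne A.X h (A.dim - 1) (pullbackOne A β x) y =
      εb • polarizationPairingOne A.X h (A.dim - 1) x (pullbackOne A β y))
    (hPm : P.Monic) (hPe : P.natDegree = e) (hPirr : Irreducible (P.map (Int.castRingHom ℚ)))
    (hφ : Polynomial.eval₂ (Int.castRingHom (CategoryTheory.End (⨁ (fun _ : Fin (n + 1) => A))))
      (φ : CategoryTheory.End (⨁ (fun _ : Fin (n + 1) => A))) P = 0)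
    (her : e * (2 * m) = 2 * ((n + 1) * A.dim))
    (hF : pullbackOne (⨁ (fun _ : Fin (n + 1) => A)) φ ∈ Algebra.adjoin ℂ
      (insert (pullbackOne (⨁ (fun _ : Fin (n + 1) => A)) (biproduct.map fun _ : Fin (n + 1) => ψ))
        (insert (pullbackOne (⨁ (fun _ : Fin (n + 1) => A)) (biproduct.map fun _ : Fin (n + 1) => α))
          (insert (pullbackOne (⨁ (fun _ : Fin (n + 1) => A)) (biproduct.map fun _ : Fin (n + 1) => β))
            (Set.range fun ab : Fin (n + 1) × Fin (n + 1) ↦ pullbackOne (⨁ (fun _ : Fin (n + 1) => A))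
              (biproduct.π (fun _ : Fin (n + 1) => A) ab.1 ≫ biproduct.ι (fun _ : Fin (n + 1) => A) ab.2))))))
    (hbal : ∀ ρ : ℂ, Polynomial.eval₂ (Int.castRingHom ℂ) ρ P = 0 → ∀ σ : ℂ,
      Module.finrank ℂ ↥((pullbackOne (⨁ (fun _ : Fin (n + 1) => A)) φ).eigenspace ρ ⊓
          (pullbackOne (⨁ (fun _ : Fin (n + 1) => A)) (biproduct.map fun _ : Fin (n + 1) => ψ)).eigenspace σ) =
      Module.finrank ℂ ↥((pullbackOne (⨁ (fun _ : Fin (n + 1) => A)) φ).eigenspace ρ ⊓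
          (pullbackOne (⨁ (fun _ : Fin (n + 1) => A)) (biproduct.map fun _ : Fin (n + 1) => ψ')).eigenspace σ)) :
    weilClassesField (⨁ (fun _ : Fin (n + 1) => A)) φ P (2 * m) ≤
      divisorClassesSpan (⨁ (fun _ : Fin (n + 1) => A)).X (⨁ (fun _ : Fin (n + 1) => A)).dim m := by
  classical
  obtain ⟨hhX, -, hndX⟩ := sumPolarizationClass_hypotheses (fun _ : Fin (n + 1) => A) (fun _ => h)
      (fun _ => hA) (fun _ => hh) (fun _ => htop) (fun _ => hnd)
  have herX : e * (2 * m) = 2 * (⨁ (fun _ : Fin (n + 1) => A)).dim := by rw [dim_biproduct_const_succ A n, her]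
  set X := ⨁ (fun _ : Fin (n + 1) => A) with hXdef
  set T : Module.End ℂ (complexBetti X.X 1) := pullbackOne X (biproduct.map fun _ : Fin (n + 1) => ψ) with hTdef
  -- the square relations `(⊕γ)^{*2} = q((⊕ψ)^*)` transfer slotwise
  have hsq : ∀ {γ : A ⟶ A} {q : ℂ[X]}, pullbackOne A γ * pullbackOne A γ = aeval (pullbackOne A ψ) q →
      pullbackOne X (biproduct.map fun _ : Fin (n + 1) => γ) * pullbackOne X (biproduct.map fun _ : Fin (n + 1) => γ) =
        aeval T q := by
    intro γ q hγ
    refine LinearMap.ext fun v ↦ ?_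
    rw [pullbackOne_biproductMap_const_mul_apply, hγ]
    conv_rhs => rw [← sum_map_π_map_ι (fun _ : Fin (n + 1) => A) v, map_sum]
    refine Finset.sum_congr rfl fun c _ ↦ ?_
    exact (map_aeval_apply_of_semiconj' (complexBetti.map (biproduct.π (fun _ : Fin (n + 1) => A) c).hom.hom.hom 1).hom
      (pullbackOne A ψ) T (fun w ↦ (map_biproductMap_map_π (fun _ : Fin (n + 1) => A) (fun _ => ψ) c 1 w).symm) q _)
  have hεa2 : εa * εa = 1 := by rcases hεa with rfl | rfl <;> norm_num
  have hεb2 : εb * εb = 1 := by rcases hεb with rfl | rfl <;> norm_num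
  exact weilClassesField_le_divisorClassesSpan_of_quaternionOver_CM_matrixUnits_of_forall_finrank_eq
    (W := fun a b ↦ pullbackOne X (biproduct.π (fun _ : Fin (n + 1) => A) a ≫ biproduct.ι (fun _ : Fin (n + 1) => A) b))
    hPm hPe hPirr hφ herX hhX hndX (Algebra.subset_adjoin ⟨_, rfl⟩) (Algebra.subset_adjoin ⟨_, rfl⟩)
    (Algebra.subset_adjoin ⟨_, rfl⟩) (Algebra.subset_adjoin ⟨_, rfl⟩) hRm hRirr
    (aeval_pullbackOne_biproductMap_const_eq_zero hψR) (pullbackOne_biproductMap_const_mem_adjoin_of_mem_adjoin hψ')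
    (fun x y ↦ polarizationPairingOne_biproductMap_of_adjoint (fun _ : Fin (n + 1) => A) (fun _ => h) (fun _ => hA)
      (fun _ => ψ) (fun _ => ψ') (fun _ => hadj) x y)
    (eigenspace_biproductMap_inf_eq_bot hCM) (pullbackOne_biproductMap_const_comm hψα)
    (pullbackOne_biproductMap_const_comm hψβ) (pullbackOne_biproductMap_const_mul_eq_neg hanti) (hsq hα2) hqa (hsq hβ2)
    hqb hεa2 hεb2 (fun x y ↦ polarizationPairingOne_biproductMap_const_of_sign hA α hεa hαadj x y)
    (fun x y ↦ polarizationPairingOne_biproductMap_const_of_sign hA β hεb hβadj x y) (0 : Fin (n + 1))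
    (fun a b ↦ Algebra.subset_adjoin ⟨_, rfl⟩) (fun a b c d ↦ pullbackOne_π_comp_ι_mul a b c d) sum_pullbackOne_π_comp_ι
    (fun a b v w ↦ polarizationPairingOne_pullbackOne_π_comp_ι hA hh htop hnd a b v w)
    (fun a b ↦ pullbackOne_biproductMap_const_mul_π_comp_ι ψ a b)
    (fun a b ↦ pullbackOne_biproductMap_const_mul_π_comp_ι α a b)
    (fun a b ↦ pullbackOne_biproductMap_const_mul_π_comp_ι β a b) hF hbal

/-- **… hence ALGEBRAIC**: `W_F(A^{n+1}) ⊗ ℂ ≤ algebraicClasses`. [cite: MoonenZarhin1998WeilClasses, Introduction (chunk p0001 L10–L18) and §1 Criterion (2) (chunk p0003 L46–L80)]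
[cite: VoisinHodgeI2002, Thm. 11.30] -/
theorem weilClassesField_biproduct_le_algebraicClasses_of_quaternionOver_CMField_of_forall_finrank_eq (hA : 0 < A.dim)
    (hh : h ∈ hodgeClassSpan A.dim A.X 1) (htop : lefschetzPow h (A.dim - 1) 2 h ≠ 0)
    (hnd : ∀ x : complexBetti A.X 1, (∀ y, polarizationPairingOne A.X h (A.dim - 1) x y = 0) → x = 0)
    (hRm : R.Monic) (hRirr : Irreducible (R.map (Int.castRingHom ℚ)))
    (hψR : Polynomial.eval₂ (Int.castRingHom (CategoryTheory.End A)) (ψ : CategoryTheory.End A) R = 0)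
    (hψ' : pullbackOne A ψ' ∈ Algebra.adjoin ℂ ({pullbackOne A ψ} : Set (Module.End ℂ (complexBetti A.X 1))))
    (hadj : ∀ x y : complexBetti A.X 1, polarizationPairingOne A.X h (A.dim - 1) (pullbackOne A ψ x) y =
      polarizationPairingOne A.X h (A.dim - 1) x (pullbackOne A ψ' y))
    (hCM : ∀ σ : ℂ, (pullbackOne A ψ).eigenspace σ ⊓ (pullbackOne A ψ').eigenspace σ = ⊥)
    (hψα : pullbackOne A ψ * pullbackOne A α = pullbackOne A α * pullbackOne A ψ)
    (hψβ : pullbackOne A ψ * pullbackOne A β = pullbackOne A β * pullbackOne A ψ)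
    (hanti : pullbackOne A α * pullbackOne A β = -(pullbackOne A β * pullbackOne A α))
    (hα2 : pullbackOne A α * pullbackOne A α = aeval (pullbackOne A ψ) qa)
    (hqa : ∀ z : ℂ, (R.map (Int.castRingHom ℂ)).IsRoot z → qa.eval z ≠ 0)
    (hβ2 : pullbackOne A β * pullbackOne A β = aeval (pullbackOne A ψ) qb)
    (hqb : ∀ z : ℂ, (R.map (Int.castRingHom ℂ)).IsRoot z → qb.eval z ≠ 0) (hεa : εa = 1 ∨ εa = -1)
    (hεb : εb = 1 ∨ εb = -1)
    (hαadj : ∀ x y : complexBetti A.X 1, polarizationPairingOne A.X h (A.dim - 1) (pullbackOne A α x) y =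
      εa • polarizationPairingOne A.X h (A.dim - 1) x (pullbackOne A α y))
    (hβadj : ∀ x y : complexBetti A.X 1, polarizationPairingOne A.X h (A.dim - 1) (pullbackOne A β x) y =
      εb • polarizationPairingOne A.X h (A.dim - 1) x (pullbackOne A β y))
    (hPm : P.Monic) (hPe : P.natDegree = e) (hPirr : Irreducible (P.map (Int.castRingHom ℚ)))
    (hφ : Polynomial.eval₂ (Int.castRingHom (CategoryTheory.End (⨁ (fun _ : Fin (n + 1) => A))))
      (φ : CategoryTheory.End (⨁ (fun _ : Fin (n + 1) => A))) P = 0)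
    (her : e * (2 * m) = 2 * ((n + 1) * A.dim))
    (hF : pullbackOne (⨁ (fun _ : Fin (n + 1) => A)) φ ∈ Algebra.adjoin ℂ
      (insert (pullbackOne (⨁ (fun _ : Fin (n + 1) => A)) (biproduct.map fun _ : Fin (n + 1) => ψ))
        (insert (pullbackOne (⨁ (fun _ : Fin (n + 1) => A)) (biproduct.map fun _ : Fin (n + 1) => α))
          (insert (pullbackOne (⨁ (fun _ : Fin (n + 1) => A)) (biproduct.map fun _ : Fin (n + 1) => β))
            (Set.range fun ab : Fin (n + 1) × Fin (n + 1) ↦ pullbackOne (⨁ (fun _ : Fin (n + 1) => A))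
              (biproduct.π (fun _ : Fin (n + 1) => A) ab.1 ≫ biproduct.ι (fun _ : Fin (n + 1) => A) ab.2))))))
    (hbal : ∀ ρ : ℂ, Polynomial.eval₂ (Int.castRingHom ℂ) ρ P = 0 → ∀ σ : ℂ,
      Module.finrank ℂ ↥((pullbackOne (⨁ (fun _ : Fin (n + 1) => A)) φ).eigenspace ρ ⊓
          (pullbackOne (⨁ (fun _ : Fin (n + 1) => A)) (biproduct.map fun _ : Fin (n + 1) => ψ)).eigenspace σ) =
      Module.finrank ℂ ↥((pullbackOne (⨁ (fun _ : Fin (n + 1) => A)) φ).eigenspace ρ ⊓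
          (pullbackOne (⨁ (fun _ : Fin (n + 1) => A)) (biproduct.map fun _ : Fin (n + 1) => ψ')).eigenspace σ)) :
    weilClassesField (⨁ (fun _ : Fin (n + 1) => A)) φ P (2 * m) ≤ algebraicClasses (⨁ (fun _ : Fin (n + 1) => A)).X m :=
  (weilClassesField_biproduct_le_divisorClassesSpan_of_quaternionOver_CMField_of_forall_finrank_eq hA hh htop hnd hRm hRirr
    hψR hψ' hadj hCM hψα hψβ hanti hα2 hqa hβ2 hqb hεa hεb hαadj hβadj hPm hPe hPirr hφ her hF hbal).trans
    (AbelianVariety.divisorClassesSpan_le_algebraicClasses _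
      (fun b hb hb' ↦ lefschetzOneOne_rational_holds (AbelianVariety.isSmoothProjective_holds
        (A := ⨁ (fun _ : Fin (n + 1) => A))) b hb hb') m)

/-- **«`W_F(A^{n+1})` DECOMPOSABLE ⟺ `θ = 0`», TYPE 4 WITH `d = 2`, `m = n + 1`, ON THE CARRIER** (`ψ` central in
`End(A)`, so that `⊕ψ` is central in `M_{n+1}(End A)`; `m ≠ 0`).
[cite: MoonenZarhin1998WeilClasses, §1 Criterion (2), case «Type 4 with d ≥ 2 or m ≥ 2» and its proof (chunk p0003 L46–L80)]
[cite: Milne1999LefschetzClasses, §1 p. 643, Thm. 3.2, Cor. 4.5] -/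
theorem weilClassesField_biproduct_le_divisorClassesSpan_iff_forall_finrank_eq_of_central_quaternionOver_CMField
    (hA : 0 < A.dim) (hh : h ∈ hodgeClassSpan A.dim A.X 1) (htop : lefschetzPow h (A.dim - 1) 2 h ≠ 0)
    (hnd : ∀ x : complexBetti A.X 1, (∀ y, polarizationPairingOne A.X h (A.dim - 1) x y = 0) → x = 0)
    (hψ : ∀ χ : A ⟶ A, ψ ≫ χ = χ ≫ ψ) (hRm : R.Monic) (hRirr : Irreducible (R.map (Int.castRingHom ℚ)))
    (hψR : Polynomial.eval₂ (Int.castRingHom (CategoryTheory.End A)) (ψ : CategoryTheory.End A) R = 0)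
    (hψ' : pullbackOne A ψ' ∈ Algebra.adjoin ℂ ({pullbackOne A ψ} : Set (Module.End ℂ (complexBetti A.X 1))))
    (hadj : ∀ x y : complexBetti A.X 1, polarizationPairingOne A.X h (A.dim - 1) (pullbackOne A ψ x) y =
      polarizationPairingOne A.X h (A.dim - 1) x (pullbackOne A ψ' y))
    (hCM : ∀ σ : ℂ, (pullbackOne A ψ).eigenspace σ ⊓ (pullbackOne A ψ').eigenspace σ = ⊥)
    (hψα : pullbackOne A ψ * pullbackOne A α = pullbackOne A α * pullbackOne A ψ)
    (hψβ : pullbackOne A ψ * pullbackOne A β = pullbackOne A β * pullbackOne A ψ)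
    (hanti : pullbackOne A α * pullbackOne A β = -(pullbackOne A β * pullbackOne A α))
    (hα2 : pullbackOne A α * pullbackOne A α = aeval (pullbackOne A ψ) qa)
    (hqa : ∀ z : ℂ, (R.map (Int.castRingHom ℂ)).IsRoot z → qa.eval z ≠ 0)
    (hβ2 : pullbackOne A β * pullbackOne A β = aeval (pullbackOne A ψ) qb)
    (hqb : ∀ z : ℂ, (R.map (Int.castRingHom ℂ)).IsRoot z → qb.eval z ≠ 0) (hεa : εa = 1 ∨ εa = -1)
    (hεb : εb = 1 ∨ εb = -1)
    (hαadj : ∀ x y : complexBetti A.X 1, polarizationPairingOne A.X h (A.dim - 1) (pullbackOne A α x) y =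
      εa • polarizationPairingOne A.X h (A.dim - 1) x (pullbackOne A α y))
    (hβadj : ∀ x y : complexBetti A.X 1, polarizationPairingOne A.X h (A.dim - 1) (pullbackOne A β x) y =
      εb • polarizationPairingOne A.X h (A.dim - 1) x (pullbackOne A β y))
    (hPm : P.Monic) (hPe : P.natDegree = e) (hPirr : Irreducible (P.map (Int.castRingHom ℚ)))
    (hφ : Polynomial.eval₂ (Int.castRingHom (CategoryTheory.End (⨁ (fun _ : Fin (n + 1) => A))))
      (φ : CategoryTheory.End (⨁ (fun _ : Fin (n + 1) => A))) P = 0)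
    (her : e * (2 * m) = 2 * ((n + 1) * A.dim)) (hm : m ≠ 0)
    (hF : pullbackOne (⨁ (fun _ : Fin (n + 1) => A)) φ ∈ Algebra.adjoin ℂ
      (insert (pullbackOne (⨁ (fun _ : Fin (n + 1) => A)) (biproduct.map fun _ : Fin (n + 1) => ψ))
        (insert (pullbackOne (⨁ (fun _ : Fin (n + 1) => A)) (biproduct.map fun _ : Fin (n + 1) => α))
          (insert (pullbackOne (⨁ (fun _ : Fin (n + 1) => A)) (biproduct.map fun _ : Fin (n + 1) => β))
            (Set.range fun ab : Fin (n + 1) × Fin (n + 1) ↦ pullbackOne (⨁ (fun _ : Fin (n + 1) => A))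
              (biproduct.π (fun _ : Fin (n + 1) => A) ab.1 ≫ biproduct.ι (fun _ : Fin (n + 1) => A) ab.2)))))) :
    weilClassesField (⨁ (fun _ : Fin (n + 1) => A)) φ P (2 * m) ≤
        divisorClassesSpan (⨁ (fun _ : Fin (n + 1) => A)).X (⨁ (fun _ : Fin (n + 1) => A)).dim m ↔
      ∀ ρ : ℂ, Polynomial.eval₂ (Int.castRingHom ℂ) ρ P = 0 → ∀ σ : ℂ,
        Module.finrank ℂ ↥((pullbackOne (⨁ (fun _ : Fin (n + 1) => A)) φ).eigenspace ρ ⊓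
          (pullbackOne (⨁ (fun _ : Fin (n + 1) => A)) (biproduct.map fun _ : Fin (n + 1) => ψ)).eigenspace σ) =
        Module.finrank ℂ ↥((pullbackOne (⨁ (fun _ : Fin (n + 1) => A)) φ).eigenspace ρ ⊓
          (pullbackOne (⨁ (fun _ : Fin (n + 1) => A)) (biproduct.map fun _ : Fin (n + 1) => ψ')).eigenspace σ) := by
  have herX : e * (2 * m) = 2 * (⨁ (fun _ : Fin (n + 1) => A)).dim := by rw [dim_biproduct_const_succ A n, her]
  refine ⟨fun hle ρ hρ σ ↦ ?_, fun hbal ↦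
    weilClassesField_biproduct_le_divisorClassesSpan_of_quaternionOver_CMField_of_forall_finrank_eq hA hh htop hnd hRm hRirr hψR
      hψ' hadj hCM hψα hψβ hanti hα2 hqa hβ2 hqb hεa hεb hαadj hβadj hPm hPe hPirr hφ her hF hbal⟩
  by_contra hne
  have hbot := weilClassesField_biproduct_inf_divisorClassesSpan_eq_bot_of_central_of_finrank_ne hA hh htop hnd hψ hRirr
    hψR hψ' hadj hPm hPe hPirr hφ her hm hρ hne
  rw [inf_eq_left.2 hle] at hbot
  exact weilClassesField_ne_bot hPe hPirr hφ herX (Nat.mul_ne_zero two_ne_zero hm) hbot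

/-- **«ALL NON-ZERO CLASSES OF `W_F(A^{n+1})` EXCEPTIONAL ⟺ `θ ≠ 0`», TYPE 4 WITH `d = 2`, ON THE CARRIER.**
[cite: MoonenZarhin1998WeilClasses, §1 Criterion (2), case «Type 4 with d ≥ 2 or m ≥ 2» and its proof (chunk p0003 L46–L80)]
[cite: Milne1999LefschetzClasses, §1 p. 643, Thm. 3.2, Cor. 4.5] -/
theorem weilClassesField_biproduct_inf_divisorClassesSpan_eq_bot_iff_exists_finrank_ne_of_central_quaternionOver_CMField
    (hA : 0 < A.dim) (hh : h ∈ hodgeClassSpan A.dim A.X 1) (htop : lefschetzPow h (A.dim - 1) 2 h ≠ 0)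
    (hnd : ∀ x : complexBetti A.X 1, (∀ y, polarizationPairingOne A.X h (A.dim - 1) x y = 0) → x = 0)
    (hψ : ∀ χ : A ⟶ A, ψ ≫ χ = χ ≫ ψ) (hRm : R.Monic) (hRirr : Irreducible (R.map (Int.castRingHom ℚ)))
    (hψR : Polynomial.eval₂ (Int.castRingHom (CategoryTheory.End A)) (ψ : CategoryTheory.End A) R = 0)
    (hψ' : pullbackOne A ψ' ∈ Algebra.adjoin ℂ ({pullbackOne A ψ} : Set (Module.End ℂ (complexBetti A.X 1))))
    (hadj : ∀ x y : complexBetti A.X 1, polarizationPairingOne A.X h (A.dim - 1) (pullbackOne A ψ x) y =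
      polarizationPairingOne A.X h (A.dim - 1) x (pullbackOne A ψ' y))
    (hCM : ∀ σ : ℂ, (pullbackOne A ψ).eigenspace σ ⊓ (pullbackOne A ψ').eigenspace σ = ⊥)
    (hψα : pullbackOne A ψ * pullbackOne A α = pullbackOne A α * pullbackOne A ψ)
    (hψβ : pullbackOne A ψ * pullbackOne A β = pullbackOne A β * pullbackOne A ψ)
    (hanti : pullbackOne A α * pullbackOne A β = -(pullbackOne A β * pullbackOne A α))
    (hα2 : pullbackOne A α * pullbackOne A α = aeval (pullbackOne A ψ) qa)
    (hqa : ∀ z : ℂ, (R.map (Int.castRingHom ℂ)).IsRoot z → qa.eval z ≠ 0)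
    (hβ2 : pullbackOne A β * pullbackOne A β = aeval (pullbackOne A ψ) qb)
    (hqb : ∀ z : ℂ, (R.map (Int.castRingHom ℂ)).IsRoot z → qb.eval z ≠ 0) (hεa : εa = 1 ∨ εa = -1)
    (hεb : εb = 1 ∨ εb = -1)
    (hαadj : ∀ x y : complexBetti A.X 1, polarizationPairingOne A.X h (A.dim - 1) (pullbackOne A α x) y =
      εa • polarizationPairingOne A.X h (A.dim - 1) x (pullbackOne A α y))
    (hβadj : ∀ x y : complexBetti A.X 1, polarizationPairingOne A.X h (A.dim - 1) (pullbackOne A β x) y =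
      εb • polarizationPairingOne A.X h (A.dim - 1) x (pullbackOne A β y))
    (hPm : P.Monic) (hPe : P.natDegree = e) (hPirr : Irreducible (P.map (Int.castRingHom ℚ)))
    (hφ : Polynomial.eval₂ (Int.castRingHom (CategoryTheory.End (⨁ (fun _ : Fin (n + 1) => A))))
      (φ : CategoryTheory.End (⨁ (fun _ : Fin (n + 1) => A))) P = 0)
    (her : e * (2 * m) = 2 * ((n + 1) * A.dim)) (hm : m ≠ 0)
    (hF : pullbackOne (⨁ (fun _ : Fin (n + 1) => A)) φ ∈ Algebra.adjoin ℂ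
      (insert (pullbackOne (⨁ (fun _ : Fin (n + 1) => A)) (biproduct.map fun _ : Fin (n + 1) => ψ))
        (insert (pullbackOne (⨁ (fun _ : Fin (n + 1) => A)) (biproduct.map fun _ : Fin (n + 1) => α))
          (insert (pullbackOne (⨁ (fun _ : Fin (n + 1) => A)) (biproduct.map fun _ : Fin (n + 1) => β))
            (Set.range fun ab : Fin (n + 1) × Fin (n + 1) ↦ pullbackOne (⨁ (fun _ : Fin (n + 1) => A))
              (biproduct.π (fun _ : Fin (n + 1) => A) ab.1 ≫ biproduct.ι (fun _ : Fin (n + 1) => A) ab.2)))))) :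
    weilClassesField (⨁ (fun _ : Fin (n + 1) => A)) φ P (2 * m) ⊓
        divisorClassesSpan (⨁ (fun _ : Fin (n + 1) => A)).X (⨁ (fun _ : Fin (n + 1) => A)).dim m = ⊥ ↔
      ∃ ρ σ : ℂ, Polynomial.eval₂ (Int.castRingHom ℂ) ρ P = 0 ∧
        Module.finrank ℂ ↥((pullbackOne (⨁ (fun _ : Fin (n + 1) => A)) φ).eigenspace ρ ⊓
          (pullbackOne (⨁ (fun _ : Fin (n + 1) => A)) (biproduct.map fun _ : Fin (n + 1) => ψ)).eigenspace σ) ≠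
        Module.finrank ℂ ↥((pullbackOne (⨁ (fun _ : Fin (n + 1) => A)) φ).eigenspace ρ ⊓
          (pullbackOne (⨁ (fun _ : Fin (n + 1) => A)) (biproduct.map fun _ : Fin (n + 1) => ψ')).eigenspace σ) := by
  have herX : e * (2 * m) = 2 * (⨁ (fun _ : Fin (n + 1) => A)).dim := by rw [dim_biproduct_const_succ A n, her]
  refine ⟨fun hbot ↦ ?_, fun ⟨ρ, σ, hρ, hne⟩ ↦
    weilClassesField_biproduct_inf_divisorClassesSpan_eq_bot_of_central_of_finrank_ne hA hh htop hnd hψ hRirr hψR hψ' hadj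
      hPm hPe hPirr hφ her hm hρ hne⟩
  by_contra hall
  push Not at hall
  have hle := weilClassesField_biproduct_le_divisorClassesSpan_of_quaternionOver_CMField_of_forall_finrank_eq hA hh htop hnd hRm
    hRirr hψR hψ' hadj hCM hψα hψβ hanti hα2 hqa hβ2 hqb hεa hεb hαadj hβadj hPm hPe hPirr hφ her hF
    fun ρ hρ σ ↦ hall ρ σ hρ
  rw [inf_eq_left.2 hle] at hbot
  exact weilClassesField_ne_bot hPe hPirr hφ herX (Nat.mul_ne_zero two_ne_zero hm) hbot

/-- **THE DICHOTOMY FOR `W_F(A^{n+1})`, TYPE 4 WITH `d = 2`**: «either all classes in `W_F` are decomposable or all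
non-zero classes in `W_F` are exceptional». [cite: MoonenZarhin1998WeilClasses, §1 Criterion (2) (chunk p0003 L46–L60)] -/
theorem weilClassesField_biproduct_le_or_inf_divisorClassesSpan_eq_bot_of_central_quaternionOver_CMField
    (hA : 0 < A.dim) (hh : h ∈ hodgeClassSpan A.dim A.X 1) (htop : lefschetzPow h (A.dim - 1) 2 h ≠ 0)
    (hnd : ∀ x : complexBetti A.X 1, (∀ y, polarizationPairingOne A.X h (A.dim - 1) x y = 0) → x = 0)
    (hψ : ∀ χ : A ⟶ A, ψ ≫ χ = χ ≫ ψ) (hRm : R.Monic) (hRirr : Irreducible (R.map (Int.castRingHom ℚ)))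
    (hψR : Polynomial.eval₂ (Int.castRingHom (CategoryTheory.End A)) (ψ : CategoryTheory.End A) R = 0)
    (hψ' : pullbackOne A ψ' ∈ Algebra.adjoin ℂ ({pullbackOne A ψ} : Set (Module.End ℂ (complexBetti A.X 1))))
    (hadj : ∀ x y : complexBetti A.X 1, polarizationPairingOne A.X h (A.dim - 1) (pullbackOne A ψ x) y =
      polarizationPairingOne A.X h (A.dim - 1) x (pullbackOne A ψ' y))
    (hCM : ∀ σ : ℂ, (pullbackOne A ψ).eigenspace σ ⊓ (pullbackOne A ψ').eigenspace σ = ⊥)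
    (hψα : pullbackOne A ψ * pullbackOne A α = pullbackOne A α * pullbackOne A ψ)
    (hψβ : pullbackOne A ψ * pullbackOne A β = pullbackOne A β * pullbackOne A ψ)
    (hanti : pullbackOne A α * pullbackOne A β = -(pullbackOne A β * pullbackOne A α))
    (hα2 : pullbackOne A α * pullbackOne A α = aeval (pullbackOne A ψ) qa)
    (hqa : ∀ z : ℂ, (R.map (Int.castRingHom ℂ)).IsRoot z → qa.eval z ≠ 0)
    (hβ2 : pullbackOne A β * pullbackOne A β = aeval (pullbackOne A ψ) qb)
    (hqb : ∀ z : ℂ, (R.map (Int.castRingHom ℂ)).IsRoot z → qb.eval z ≠ 0) (hεa : εa = 1 ∨ εa = -1)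
    (hεb : εb = 1 ∨ εb = -1)
    (hαadj : ∀ x y : complexBetti A.X 1, polarizationPairingOne A.X h (A.dim - 1) (pullbackOne A α x) y =
      εa • polarizationPairingOne A.X h (A.dim - 1) x (pullbackOne A α y))
    (hβadj : ∀ x y : complexBetti A.X 1, polarizationPairingOne A.X h (A.dim - 1) (pullbackOne A β x) y =
      εb • polarizationPairingOne A.X h (A.dim - 1) x (pullbackOne A β y))
    (hPm : P.Monic) (hPe : P.natDegree = e) (hPirr : Irreducible (P.map (Int.castRingHom ℚ)))
    (hφ : Polynomial.eval₂ (Int.castRingHom (CategoryTheory.End (⨁ (fun _ : Fin (n + 1) => A))))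
      (φ : CategoryTheory.End (⨁ (fun _ : Fin (n + 1) => A))) P = 0)
    (her : e * (2 * m) = 2 * ((n + 1) * A.dim)) (hm : m ≠ 0)
    (hF : pullbackOne (⨁ (fun _ : Fin (n + 1) => A)) φ ∈ Algebra.adjoin ℂ
      (insert (pullbackOne (⨁ (fun _ : Fin (n + 1) => A)) (biproduct.map fun _ : Fin (n + 1) => ψ))
        (insert (pullbackOne (⨁ (fun _ : Fin (n + 1) => A)) (biproduct.map fun _ : Fin (n + 1) => α))
          (insert (pullbackOne (⨁ (fun _ : Fin (n + 1) => A)) (biproduct.map fun _ : Fin (n + 1) => β))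
            (Set.range fun ab : Fin (n + 1) × Fin (n + 1) ↦ pullbackOne (⨁ (fun _ : Fin (n + 1) => A))
              (biproduct.π (fun _ : Fin (n + 1) => A) ab.1 ≫ biproduct.ι (fun _ : Fin (n + 1) => A) ab.2)))))) :
    weilClassesField (⨁ (fun _ : Fin (n + 1) => A)) φ P (2 * m) ≤
        divisorClassesSpan (⨁ (fun _ : Fin (n + 1) => A)).X (⨁ (fun _ : Fin (n + 1) => A)).dim m ∨
      weilClassesField (⨁ (fun _ : Fin (n + 1) => A)) φ P (2 * m) ⊓
        divisorClassesSpan (⨁ (fun _ : Fin (n + 1) => A)).X (⨁ (fun _ : Fin (n + 1) => A)).dim m = ⊥ := by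
  by_cases hbal : ∀ ρ : ℂ, Polynomial.eval₂ (Int.castRingHom ℂ) ρ P = 0 → ∀ σ : ℂ,
      Module.finrank ℂ ↥((pullbackOne (⨁ (fun _ : Fin (n + 1) => A)) φ).eigenspace ρ ⊓
        (pullbackOne (⨁ (fun _ : Fin (n + 1) => A)) (biproduct.map fun _ : Fin (n + 1) => ψ)).eigenspace σ) =
      Module.finrank ℂ ↥((pullbackOne (⨁ (fun _ : Fin (n + 1) => A)) φ).eigenspace ρ ⊓
        (pullbackOne (⨁ (fun _ : Fin (n + 1) => A)) (biproduct.map fun _ : Fin (n + 1) => ψ')).eigenspace σ)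
  · exact Or.inl (weilClassesField_biproduct_le_divisorClassesSpan_of_quaternionOver_CMField_of_forall_finrank_eq hA hh htop hnd
      hRm hRirr hψR hψ' hadj hCM hψα hψβ hanti hα2 hqa hβ2 hqb hεa hεb hαadj hβadj hPm hPe hPirr hφ her hF hbal)
  · push Not at hbal
    obtain ⟨ρ, hρ, σ, hne⟩ := hbal
    exact Or.inr (weilClassesField_biproduct_inf_divisorClassesSpan_eq_bot_of_central_of_finrank_ne hA hh htop hnd hψ hRirr
      hψR hψ' hadj hPm hPe hPirr hφ her hm hρ hne)

end Powers

/-! ### §6 FROM `End(A)`-LEVEL DATA: «`End⁰(A) = D = E⟨α, β⟩`, `E = ℚ(ψ)` CM, `ψ† = ψ' ≠ ψ`» -/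

section EndLevel

variable {A : AbelianVariety ℂ} {h : complexBetti A.X 2} {φ ψ ψ' α β : A ⟶ A} {P R : Polynomial ℤ} {e m : ℕ}
  {qa qb : ℂ[X]} {εa εb : ℂ}

/-- **`N ψ' ∈ ℤ[ψ]` (`N ≠ 0`) ⟹ `ψ'^* ∈ ℂ[ψ^*]`** («`ψ† ∈ E = ℚ(ψ)`»: clear the denominator over `ℂ`).
[cite: MoonenZarhin1998WeilClasses, §1 («E the center of D … E₀ the maximal totally real subfield of E»; chunk p0002 L46–L51)]
[cite: LangeBirkenhake1992, §1.1, §5.5] -/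
theorem pullbackOne_mem_adjoin_singleton_of_exists_zsmul_mem_closure_singleton
    (hψ'E : ∃ N : ℤ, N ≠ 0 ∧ End.of (N • ψ') ∈ Subring.closure {End.of ψ}) :
    pullbackOne A ψ' ∈ Algebra.adjoin ℂ ({pullbackOne A ψ} : Set (Module.End ℂ (complexBetti A.X 1))) := by
  obtain ⟨N, hN0, hN⟩ := hψ'E
  have h1 : pullbackOne A (N • ψ') ∈ Algebra.adjoin ℂ ({pullbackOne A ψ} : Set (Module.End ℂ (complexBetti A.X 1))) :=
    pullbackOne_mem_adjoin_singleton_of_mem_closure hN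
  rw [pullbackOne_zsmul] at h1
  have e : pullbackOne A ψ' = ((N : ℂ)⁻¹) • ((N : ℂ) • pullbackOne A ψ') := by
    rw [smul_smul, inv_mul_cancel₀ (Int.cast_ne_zero.2 hN0), one_smul]
  rw [e]
  exact Subalgebra.smul_mem _ h1 _

/-- **«NO REAL PLACE» FROM `ψ' ≠ ψ` AND `N'ψ' ∈ ℤ[ψ]`.**  `ψ ∈ End(A)` with `R(ψ) = 0` (`R` monic irreducible over
`ℚ`), `ψ' ∈ End(A)` with `N'ψ' = c(ψ)` for some `N' ≠ 0`, `c ∈ ℤ[X]`, and `ψ' ≠ ψ`.  Then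
`ker(ψ^* - σ) ∩ ker(ψ'^* - σ) = 0` for every `σ`: a non-zero common eigenvector gives `c(σ) = N'σ` at a complex root `σ`
of `R`, the minimal polynomial `R` of `σ` divides `c - N'X`, so `N'ψ'^* = N'ψ^*` and `ψ' = ψ` by faithfulness — the
seat's `eigenspace_inf_eigenspace_eq_bot_of_ne_of_forall_exists_zsmul_mem_closure_singleton` with its hypothesis
«`End⁰(A) = ℚ(ψ)`» weakened to the one membership it uses (here `End⁰(A) = D ⊋ E`).  For `ψ' = ψ†`: «`E = ℚ(ψ)` is a
CM field, `†` its complex conjugation, `σ̄ ≠ σ`». [cite: MoonenZarhin1998WeilClasses, §1 («E₀ the maximal totally real subfield of E», the torus U_E; chunk p0002 L46–L51, chunk p0003 L1–L3, L72–L80)]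
[cite: LangeBirkenhake1992, §1.1, §5.5] -/
theorem eigenspace_inf_eigenspace_eq_bot_of_ne_of_exists_zsmul_mem_closure_singleton (hRm : R.Monic)
    (hRirr : Irreducible (R.map (Int.castRingHom ℚ)))
    (hψR : Polynomial.eval₂ (Int.castRingHom (CategoryTheory.End A)) (ψ : CategoryTheory.End A) R = 0)
    (hψ'E : ∃ N : ℤ, N ≠ 0 ∧ End.of (N • ψ') ∈ Subring.closure {End.of ψ}) (hne : ψ' ≠ ψ) (σ : ℂ) :
    (pullbackOne A ψ).eigenspace σ ⊓ (pullbackOne A ψ').eigenspace σ = ⊥ := by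
  by_contra hbot
  obtain ⟨x, ⟨hxψ, hxψ'⟩, hx0⟩ := (Submodule.ne_bot_iff _).1 hbot
  -- `N' ψ' = c(ψ)` with `c ∈ ℤ[X]`
  obtain ⟨N', hN'0, hN'⟩ := hψ'E
  have hcomm : ∀ k : ℤ, Commute (Int.castRingHom (CategoryTheory.End A) k) (End.of ψ) := fun k ↦
    Int.cast_commute k _
  have hrange : Subring.closure {End.of ψ} ≤
      (Polynomial.eval₂RingHom' (Int.castRingHom (CategoryTheory.End A)) (End.of ψ) hcomm).range :=
    Subring.closure_le.2 (Set.singleton_subset_iff.2 ⟨X, by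
      change Polynomial.eval₂ (Int.castRingHom (CategoryTheory.End A)) (End.of ψ) X = End.of ψ
      exact eval₂_X _ _⟩)
  obtain ⟨c, hc⟩ := hrange hN'
  have hc' : (N' • ψ' : A ⟶ A) =
      (Polynomial.eval₂ (Int.castRingHom (CategoryTheory.End A)) (ψ : CategoryTheory.End A) c :) :=
    hc.symm
  have h2 : (N' : ℂ) • pullbackOne A ψ' = aeval (pullbackOne A ψ) (c.map (Int.castRingHom ℂ)) := by
    rw [← pullbackOne_zsmul, hc']
    exact pullbackOne_eval₂ ψ c
  -- at the common eigenvector: `c(σ) = N' σ`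
  have hσR : Polynomial.eval₂ (Int.castRingHom ℂ) σ R = 0 :=
    eval₂_eq_zero_of_eigenspace_pullbackOne_ne_bot hψR ((Submodule.ne_bot_iff _).2 ⟨x, hxψ, hx0⟩)
  have hcσ : (c.map (Int.castRingHom ℂ)).eval σ = (N' : ℂ) * σ := by
    have e1 : aeval (pullbackOne A ψ) (c.map (Int.castRingHom ℂ)) x = (c.map (Int.castRingHom ℂ)).eval σ • x :=
      Module.End.aeval_apply_of_hasEigenvector (Module.End.hasEigenvector_iff.2 ⟨hxψ, hx0⟩)
    have e2 : aeval (pullbackOne A ψ) (c.map (Int.castRingHom ℂ)) x = ((N' : ℂ) * σ) • x := by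
      rw [← h2, LinearMap.smul_apply, Module.End.mem_eigenspace_iff.1 hxψ', smul_smul]
    rw [e1] at e2
    exact smul_left_injective ℂ hx0 e2
  -- the minimal polynomial of `σ` over `ℚ` is `R`; it divides `c - N' X`
  set q : Polynomial ℤ := c - C N' * X with hqdef
  have hqσ : Polynomial.aeval σ (q.map (Int.castRingHom ℚ)) = 0 := by
    rw [aeval_def, eval₂_map, RingHom.ext_int ((algebraMap ℚ ℂ).comp (Int.castRingHom ℚ)) (Int.castRingHom ℂ), hqdef,
      eval₂_sub, eval₂_mul, eval₂_C, eval₂_X, ← Polynomial.eval_map, hcσ, eq_intCast, sub_self]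
  have hRσ : Polynomial.aeval σ (R.map (Int.castRingHom ℚ)) = 0 := by
    rw [aeval_def, eval₂_map, RingHom.ext_int ((algebraMap ℚ ℂ).comp (Int.castRingHom ℚ)) (Int.castRingHom ℂ)]
    exact hσR
  have hmin : R.map (Int.castRingHom ℚ) = minpoly ℚ σ :=
    minpoly.eq_of_irreducible_of_monic hRirr hRσ (hRm.map _)
  have hdvd : R.map (Int.castRingHom ℚ) ∣ q.map (Int.castRingHom ℚ) := by
    rw [hmin]
    exact minpoly.dvd ℚ σ hqσ
  have hdvdC : R.map (Int.castRingHom ℂ) ∣ q.map (Int.castRingHom ℂ) := by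
    have hd := Polynomial.map_dvd (algebraMap ℚ ℂ) hdvd
    rwa [Polynomial.map_map, Polynomial.map_map,
      RingHom.ext_int ((algebraMap ℚ ℂ).comp (Int.castRingHom ℚ)) (Int.castRingHom ℂ)] at hd
  -- hence `q(ψ^*) = 0`, i.e. `N' ψ'^* = N' ψ^*`
  have hR0 : aeval (pullbackOne A ψ) (R.map (Int.castRingHom ℂ)) = 0 := aeval_hom_complexBetti_map_one_eq_zero hψR
  have hq0 : aeval (pullbackOne A ψ) (q.map (Int.castRingHom ℂ)) = 0 := by
    obtain ⟨s, hs⟩ := hdvdC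
    rw [hs, map_mul, hR0, zero_mul]
  have h3 : (N' : ℂ) • pullbackOne A ψ' = (N' : ℂ) • pullbackOne A ψ := by
    rw [hqdef, Polynomial.map_sub, Polynomial.map_mul, Polynomial.map_C, Polynomial.map_X, map_sub, map_mul, aeval_C,
      aeval_X, ← h2, eq_intCast, sub_eq_zero, Algebra.algebraMap_eq_smul_one, smul_mul_assoc, one_mul] at hq0
    exact hq0
  have h4 : pullbackOne A ψ' = pullbackOne A ψ := smul_right_injective _ (Int.cast_ne_zero.2 hN'0) h3
  -- faithfulness
  have e0 : (complexBetti.map (ψ' - ψ).hom.hom.hom 1).hom = 0 := by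
    rw [complexBetti_map_sub_one, ModuleCat.hom_sub]
    exact sub_eq_zero.2 h4
  exact hne (sub_eq_zero.1 (ComplexMultiplication.hom_eq_zero_of_complexBetti_map_one_eq_zero _ e0))

/-- A central `ψ ∈ End(A)` has `ψ^* ∈ C(A) ⊗ ℂ` and commutes with every pull-back on `H¹`. [cite: Milne1999LefschetzClasses, §1 p. 642 (C(A))] -/
private theorem pullbackOne_mul_comm_of_central (hψ : ∀ χ : A ⟶ A, ψ ≫ χ = χ ≫ ψ) (χ : A ⟶ A) :
    pullbackOne A ψ * pullbackOne A χ = pullbackOne A χ * pullbackOne A ψ := by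
  rw [← pullbackOne_comp_eq_mul, ← pullbackOne_comp_eq_mul, hψ χ]

/-- A central `ψ ∈ End(A)` has `ψ^* ∈ C(A) ⊗ ℂ`. [cite: Milne1999LefschetzClasses, §1 p. 642 (C(A))] -/
private theorem pullbackOne_mem_centralizerAlgebra_of_central (hψ : ∀ χ : A ⟶ A, ψ ≫ χ = χ ≫ ψ) :
    pullbackOne A ψ ∈ centralizerAlgebra A :=
  mem_centralizerAlgebra_iff.2 fun χ ↦ (pullbackOne_mul_comm_of_central hψ χ).symm

/-- **MZ98 CRITERION (2), TYPE 4 WITH `d = 2`, `m = 1`, FROM `End(A)` — «`W_F` DECOMPOSABLE ⟺ `θ = 0`».**  Let `A` be a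
complex abelian variety, `h ∈ B¹(A) ⊗ ℂ` with `Q_h` non-degenerate, and let `End(A)` carry the presentation «`End⁰(A) =
D = E⟨α, β⟩`, a quaternion algebra over the CM field `E = ℚ(ψ)` with Rosati involution of the second kind»: `ψ ∈ End(A)`
CENTRAL with `R(ψ) = 0` (`R` monic irreducible over `ℚ`); its Rosati image `ψ' ∈ End(A)` (`Q_h(ψ^* x, y) =
Q_h(x, ψ'^* y)`) with `N'ψ' ∈ ℤ[ψ]` for some `N' ≠ 0` (`ψ† ∈ E`) and `ψ' ≠ ψ` (`E` is not totally real); `α, β ∈ End(A)`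
with `α^* β^* = -β^* α^*`, `α^{*2} = a(ψ^*)`, `β^{*2} = b(ψ^*)` (`a, b` non-vanishing at the roots of `R`) and
`Q_h(α^* x, y) = εa Q_h(x, α^* y)`, `Q_h(β^* x, y) = εb Q_h(x, β^* y)`, `εa, εb ∈ {1, -1}` (generators adapted to the
involution); and every `g ∈ End(A)` has a non-zero multiple in `ℤ⟨ψ, α, β⟩` (`hD`).  Then for EVERY `φ ∈ End(A)` with
`P(φ) = 0` (`P` monic irreducible of degree `e`, `e · 2m = 2 dim A`, `m ≠ 0`): `W_F ⊗ ℂ ≤ 𝒟ᵐ ⊗ ℂ` IFF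
`dim(V_ρ ∩ ker(ψ^* - σ)) = dim(V_ρ ∩ ker(ψ'^* - σ))` for every complex root `ρ` of `P` and every `σ` (the print's
«`θ : E₋ ↪ End_F(V_X) —Tr_F→ F` is zero», read as an eigenvalue count as in the seat's `d = 1` rows).
[cite: MoonenZarhin1998WeilClasses, §1 Criterion (2), case «Y is of Type 4 with d ≥ 2 or m ≥ 2 and the map θ … is non-zero» and its proof (chunk p0003 L46–L80)]
[cite: Milne1999LefschetzClasses, §1 pp. 642–644, Thm. 3.2, Cor. 4.5] [cite: LangeBirkenhake1992, §5.5 (type IV)] -/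
theorem weilClassesField_le_divisorClassesSpan_iff_forall_finrank_eq_of_quaternionOverCMField_End (hPm : P.Monic)
    (hPe : P.natDegree = e) (hPirr : Irreducible (P.map (Int.castRingHom ℚ)))
    (hφ : Polynomial.eval₂ (Int.castRingHom (CategoryTheory.End A)) (φ : CategoryTheory.End A) P = 0)
    (her : e * (2 * m) = 2 * A.dim) (hm : m ≠ 0) (hh : h ∈ hodgeClassSpan A.dim A.X 1)
    (hnd : ∀ x : complexBetti A.X 1, (∀ y, polarizationPairingOne A.X h (A.dim - 1) x y = 0) → x = 0)
    (hψ : ∀ χ : A ⟶ A, ψ ≫ χ = χ ≫ ψ) (hRm : R.Monic) (hRirr : Irreducible (R.map (Int.castRingHom ℚ)))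
    (hψR : Polynomial.eval₂ (Int.castRingHom (CategoryTheory.End A)) (ψ : CategoryTheory.End A) R = 0)
    (hadj : ∀ x y : complexBetti A.X 1, polarizationPairingOne A.X h (A.dim - 1) (pullbackOne A ψ x) y =
      polarizationPairingOne A.X h (A.dim - 1) x (pullbackOne A ψ' y))
    (hψ'E : ∃ N : ℤ, N ≠ 0 ∧ End.of (N • ψ') ∈ Subring.closure {End.of ψ}) (hne : ψ' ≠ ψ)
    (hanti : pullbackOne A α * pullbackOne A β = -(pullbackOne A β * pullbackOne A α))
    (hα2 : pullbackOne A α * pullbackOne A α = aeval (pullbackOne A ψ) qa)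
    (hqa : ∀ z : ℂ, (R.map (Int.castRingHom ℂ)).IsRoot z → qa.eval z ≠ 0)
    (hβ2 : pullbackOne A β * pullbackOne A β = aeval (pullbackOne A ψ) qb)
    (hqb : ∀ z : ℂ, (R.map (Int.castRingHom ℂ)).IsRoot z → qb.eval z ≠ 0) (hεa : εa = 1 ∨ εa = -1)
    (hεb : εb = 1 ∨ εb = -1)
    (hαadj : ∀ x y : complexBetti A.X 1, polarizationPairingOne A.X h (A.dim - 1) (pullbackOne A α x) y =
      εa • polarizationPairingOne A.X h (A.dim - 1) x (pullbackOne A α y))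
    (hβadj : ∀ x y : complexBetti A.X 1, polarizationPairingOne A.X h (A.dim - 1) (pullbackOne A β x) y =
      εb • polarizationPairingOne A.X h (A.dim - 1) x (pullbackOne A β y))
    (hD : ∀ g : A ⟶ A, ∃ N : ℤ, N ≠ 0 ∧ End.of (N • g) ∈ Subring.closure {End.of ψ, End.of α, End.of β}) :
    weilClassesField A φ P (2 * m) ≤ divisorClassesSpan A.X A.dim m ↔
      ∀ ρ : ℂ, Polynomial.eval₂ (Int.castRingHom ℂ) ρ P = 0 → ∀ σ : ℂ,
        Module.finrank ℂ ↥((pullbackOne A φ).eigenspace ρ ⊓ (pullbackOne A ψ).eigenspace σ) =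
          Module.finrank ℂ ↥((pullbackOne A φ).eigenspace ρ ⊓ (pullbackOne A ψ').eigenspace σ) := by
  have hεa2 : εa * εa = 1 := by rcases hεa with rfl | rfl <;> norm_num
  have hεb2 : εb * εb = 1 := by rcases hεb with rfl | rfl <;> norm_num
  exact weilClassesField_le_divisorClassesSpan_iff_forall_finrank_eq_of_central_quaternionOver_CMField hPm hPe hPirr hφ her hm
    hh hnd (pullbackOne_mem_centralizerAlgebra_of_central hψ) hRm hRirr hψR
    (pullbackOne_mem_adjoin_singleton_of_exists_zsmul_mem_closure_singleton hψ'E) hadj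
    (eigenspace_inf_eigenspace_eq_bot_of_ne_of_exists_zsmul_mem_closure_singleton hRm hRirr hψR hψ'E hne)
    (pullbackOne_mul_comm_of_central hψ α) (pullbackOne_mul_comm_of_central hψ β) hanti hα2 hqa hβ2 hqb hεa2 hεb2 hαadj
    hβadj (pullbackOne_mem_adjoin_triple_of_forall_exists_zsmul_mem_closure_triple hD φ)

/-- **… «ALL NON-ZERO CLASSES EXCEPTIONAL ⟺ `θ ≠ 0`», TYPE 4 WITH `d = 2`, `m = 1`, FROM `End(A)`.**
[cite: MoonenZarhin1998WeilClasses, §1 Criterion (2), case «Y is of Type 4 with d ≥ 2 or m ≥ 2 and the map θ … is non-zero» and its proof (chunk p0003 L46–L80)]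
[cite: Milne1999LefschetzClasses, §1 pp. 642–644, Thm. 3.2, Cor. 4.5] -/
theorem weilClassesField_inf_divisorClassesSpan_eq_bot_iff_exists_finrank_ne_of_quaternionOverCMField_End (hPm : P.Monic)
    (hPe : P.natDegree = e) (hPirr : Irreducible (P.map (Int.castRingHom ℚ)))
    (hφ : Polynomial.eval₂ (Int.castRingHom (CategoryTheory.End A)) (φ : CategoryTheory.End A) P = 0)
    (her : e * (2 * m) = 2 * A.dim) (hm : m ≠ 0) (hh : h ∈ hodgeClassSpan A.dim A.X 1)
    (hnd : ∀ x : complexBetti A.X 1, (∀ y, polarizationPairingOne A.X h (A.dim - 1) x y = 0) → x = 0)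
    (hψ : ∀ χ : A ⟶ A, ψ ≫ χ = χ ≫ ψ) (hRm : R.Monic) (hRirr : Irreducible (R.map (Int.castRingHom ℚ)))
    (hψR : Polynomial.eval₂ (Int.castRingHom (CategoryTheory.End A)) (ψ : CategoryTheory.End A) R = 0)
    (hadj : ∀ x y : complexBetti A.X 1, polarizationPairingOne A.X h (A.dim - 1) (pullbackOne A ψ x) y =
      polarizationPairingOne A.X h (A.dim - 1) x (pullbackOne A ψ' y))
    (hψ'E : ∃ N : ℤ, N ≠ 0 ∧ End.of (N • ψ') ∈ Subring.closure {End.of ψ}) (hne : ψ' ≠ ψ)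
    (hanti : pullbackOne A α * pullbackOne A β = -(pullbackOne A β * pullbackOne A α))
    (hα2 : pullbackOne A α * pullbackOne A α = aeval (pullbackOne A ψ) qa)
    (hqa : ∀ z : ℂ, (R.map (Int.castRingHom ℂ)).IsRoot z → qa.eval z ≠ 0)
    (hβ2 : pullbackOne A β * pullbackOne A β = aeval (pullbackOne A ψ) qb)
    (hqb : ∀ z : ℂ, (R.map (Int.castRingHom ℂ)).IsRoot z → qb.eval z ≠ 0) (hεa : εa = 1 ∨ εa = -1)
    (hεb : εb = 1 ∨ εb = -1)
    (hαadj : ∀ x y : complexBetti A.X 1, polarizationPairingOne A.X h (A.dim - 1) (pullbackOne A α x) y =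
      εa • polarizationPairingOne A.X h (A.dim - 1) x (pullbackOne A α y))
    (hβadj : ∀ x y : complexBetti A.X 1, polarizationPairingOne A.X h (A.dim - 1) (pullbackOne A β x) y =
      εb • polarizationPairingOne A.X h (A.dim - 1) x (pullbackOne A β y))
    (hD : ∀ g : A ⟶ A, ∃ N : ℤ, N ≠ 0 ∧ End.of (N • g) ∈ Subring.closure {End.of ψ, End.of α, End.of β}) :
    weilClassesField A φ P (2 * m) ⊓ divisorClassesSpan A.X A.dim m = ⊥ ↔
      ∃ ρ σ : ℂ, Polynomial.eval₂ (Int.castRingHom ℂ) ρ P = 0 ∧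
        Module.finrank ℂ ↥((pullbackOne A φ).eigenspace ρ ⊓ (pullbackOne A ψ).eigenspace σ) ≠
          Module.finrank ℂ ↥((pullbackOne A φ).eigenspace ρ ⊓ (pullbackOne A ψ').eigenspace σ) := by
  have hεa2 : εa * εa = 1 := by rcases hεa with rfl | rfl <;> norm_num
  have hεb2 : εb * εb = 1 := by rcases hεb with rfl | rfl <;> norm_num
  exact weilClassesField_inf_divisorClassesSpan_eq_bot_iff_exists_finrank_ne_of_central_quaternionOver_CMField hPm hPe hPirr hφ
    her hm hh hnd (pullbackOne_mem_centralizerAlgebra_of_central hψ) hRm hRirr hψR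
    (pullbackOne_mem_adjoin_singleton_of_exists_zsmul_mem_closure_singleton hψ'E) hadj
    (eigenspace_inf_eigenspace_eq_bot_of_ne_of_exists_zsmul_mem_closure_singleton hRm hRirr hψR hψ'E hne)
    (pullbackOne_mul_comm_of_central hψ α) (pullbackOne_mul_comm_of_central hψ β) hanti hα2 hqa hβ2 hqb hεa2 hεb2 hαadj
    hβadj (pullbackOne_mem_adjoin_triple_of_forall_exists_zsmul_mem_closure_triple hD φ)

/-- **… THE DICHOTOMY, TYPE 4 WITH `d = 2`, `m = 1`, FROM `End(A)`**: «either all classes in `W_F` are decomposable or all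
non-zero classes in `W_F` are exceptional», for every `φ ∈ End(A)`. [cite: MoonenZarhin1998WeilClasses, §1 Criterion (2) (chunk p0003 L46–L60)] -/
theorem weilClassesField_le_or_inf_divisorClassesSpan_eq_bot_of_quaternionOverCMField_End (hPm : P.Monic)
    (hPe : P.natDegree = e) (hPirr : Irreducible (P.map (Int.castRingHom ℚ)))
    (hφ : Polynomial.eval₂ (Int.castRingHom (CategoryTheory.End A)) (φ : CategoryTheory.End A) P = 0)
    (her : e * (2 * m) = 2 * A.dim) (hm : m ≠ 0) (hh : h ∈ hodgeClassSpan A.dim A.X 1)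
    (hnd : ∀ x : complexBetti A.X 1, (∀ y, polarizationPairingOne A.X h (A.dim - 1) x y = 0) → x = 0)
    (hψ : ∀ χ : A ⟶ A, ψ ≫ χ = χ ≫ ψ) (hRm : R.Monic) (hRirr : Irreducible (R.map (Int.castRingHom ℚ)))
    (hψR : Polynomial.eval₂ (Int.castRingHom (CategoryTheory.End A)) (ψ : CategoryTheory.End A) R = 0)
    (hadj : ∀ x y : complexBetti A.X 1, polarizationPairingOne A.X h (A.dim - 1) (pullbackOne A ψ x) y =
      polarizationPairingOne A.X h (A.dim - 1) x (pullbackOne A ψ' y))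
    (hψ'E : ∃ N : ℤ, N ≠ 0 ∧ End.of (N • ψ') ∈ Subring.closure {End.of ψ}) (hne : ψ' ≠ ψ)
    (hanti : pullbackOne A α * pullbackOne A β = -(pullbackOne A β * pullbackOne A α))
    (hα2 : pullbackOne A α * pullbackOne A α = aeval (pullbackOne A ψ) qa)
    (hqa : ∀ z : ℂ, (R.map (Int.castRingHom ℂ)).IsRoot z → qa.eval z ≠ 0)
    (hβ2 : pullbackOne A β * pullbackOne A β = aeval (pullbackOne A ψ) qb)
    (hqb : ∀ z : ℂ, (R.map (Int.castRingHom ℂ)).IsRoot z → qb.eval z ≠ 0) (hεa : εa = 1 ∨ εa = -1)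
    (hεb : εb = 1 ∨ εb = -1)
    (hαadj : ∀ x y : complexBetti A.X 1, polarizationPairingOne A.X h (A.dim - 1) (pullbackOne A α x) y =
      εa • polarizationPairingOne A.X h (A.dim - 1) x (pullbackOne A α y))
    (hβadj : ∀ x y : complexBetti A.X 1, polarizationPairingOne A.X h (A.dim - 1) (pullbackOne A β x) y =
      εb • polarizationPairingOne A.X h (A.dim - 1) x (pullbackOne A β y))
    (hD : ∀ g : A ⟶ A, ∃ N : ℤ, N ≠ 0 ∧ End.of (N • g) ∈ Subring.closure {End.of ψ, End.of α, End.of β}) :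
    weilClassesField A φ P (2 * m) ≤ divisorClassesSpan A.X A.dim m ∨
      weilClassesField A φ P (2 * m) ⊓ divisorClassesSpan A.X A.dim m = ⊥ := by
  have hεa2 : εa * εa = 1 := by rcases hεa with rfl | rfl <;> norm_num
  have hεb2 : εb * εb = 1 := by rcases hεb with rfl | rfl <;> norm_num
  exact weilClassesField_le_or_inf_divisorClassesSpan_eq_bot_of_central_quaternionOver_CMField hPm hPe hPirr hφ her hm hh hnd
    (pullbackOne_mem_centralizerAlgebra_of_central hψ) hRm hRirr hψR
    (pullbackOne_mem_adjoin_singleton_of_exists_zsmul_mem_closure_singleton hψ'E) hadj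
    (eigenspace_inf_eigenspace_eq_bot_of_ne_of_exists_zsmul_mem_closure_singleton hRm hRirr hψR hψ'E hne)
    (pullbackOne_mul_comm_of_central hψ α) (pullbackOne_mul_comm_of_central hψ β) hanti hα2 hqa hβ2 hqb hεa2 hεb2 hαadj
    hβadj (pullbackOne_mem_adjoin_triple_of_forall_exists_zsmul_mem_closure_triple hD φ)

end EndLevel

section EndLevelPowers

variable {A : AbelianVariety ℂ} {h : complexBetti A.X 2} {n : ℕ} {ψ ψ' α β : A ⟶ A}
  {φ : ⨁ (fun _ : Fin (n + 1) => A) ⟶ ⨁ (fun _ : Fin (n + 1) => A)} {P R : Polynomial ℤ} {e m : ℕ}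
  {qa qb : ℂ[X]} {εa εb : ℂ}

/-- **MZ98 CRITERION (2), TYPE 4 WITH `d = 2` ON POWERS `X = A^{n+1}`, FROM `End(A)` — «`W_F(X)` DECOMPOSABLE ⟺
`θ = 0`» for EVERY `φ ∈ End(X)`** (the product polarization; `End(A)`-level presentation «`End⁰(A) = D = E⟨α, β⟩`, `E =
ℚ(ψ)` CM, `ψ` central, `ψ† = ψ' ≠ ψ`, `N'ψ' ∈ ℤ[ψ]`, `hD`» as in
`weilClassesField_le_divisorClassesSpan_iff_forall_finrank_eq_of_quaternionOverCMField_End`; `dim A > 0`, `h^{dim A} ≠ 0`;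
«`F = ℚ(φ) ⊆ End⁰(X) = M_{n+1}(D)`» is automatic: every `φ^*` lies in `ℂ⟨(⊕ψ)^*, (⊕α)^*, (⊕β)^*, (πₐ ≫ ι_b)^*⟩` by the
seat's `pullbackOne_mem_adjoin_diagonal_of_forall_exists_zsmul_mem_closure_triple`).  This is the print's row «`Y` of Type 4
with `d ≥ 2` or `m ≥ 2`: exceptional iff `θ ≠ 0`» for `d = 2` and all `m`.
[cite: MoonenZarhin1998WeilClasses, §1 Criterion (2), case «Y is of Type 4 with d ≥ 2 or m ≥ 2 and the map θ … is non-zero» and its proof (chunk p0003 L46–L80); Table 1 («B = End⁰(X) = M_m(D)»)]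
[cite: Milne1999LefschetzClasses, §1 p. 643, Thm. 3.2, Cor. 4.5] [cite: LangeBirkenhake1992, §5.5 (type IV)] -/
theorem weilClassesField_biproduct_le_divisorClassesSpan_iff_forall_finrank_eq_of_quaternionOverCMField_End (hA : 0 < A.dim)
    (hh : h ∈ hodgeClassSpan A.dim A.X 1) (htop : lefschetzPow h (A.dim - 1) 2 h ≠ 0)
    (hnd : ∀ x : complexBetti A.X 1, (∀ y, polarizationPairingOne A.X h (A.dim - 1) x y = 0) → x = 0)
    (hψ : ∀ χ : A ⟶ A, ψ ≫ χ = χ ≫ ψ) (hRm : R.Monic) (hRirr : Irreducible (R.map (Int.castRingHom ℚ)))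
    (hψR : Polynomial.eval₂ (Int.castRingHom (CategoryTheory.End A)) (ψ : CategoryTheory.End A) R = 0)
    (hadj : ∀ x y : complexBetti A.X 1, polarizationPairingOne A.X h (A.dim - 1) (pullbackOne A ψ x) y =
      polarizationPairingOne A.X h (A.dim - 1) x (pullbackOne A ψ' y))
    (hψ'E : ∃ N : ℤ, N ≠ 0 ∧ End.of (N • ψ') ∈ Subring.closure {End.of ψ}) (hne : ψ' ≠ ψ)
    (hanti : pullbackOne A α * pullbackOne A β = -(pullbackOne A β * pullbackOne A α))
    (hα2 : pullbackOne A α * pullbackOne A α = aeval (pullbackOne A ψ) qa)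
    (hqa : ∀ z : ℂ, (R.map (Int.castRingHom ℂ)).IsRoot z → qa.eval z ≠ 0)
    (hβ2 : pullbackOne A β * pullbackOne A β = aeval (pullbackOne A ψ) qb)
    (hqb : ∀ z : ℂ, (R.map (Int.castRingHom ℂ)).IsRoot z → qb.eval z ≠ 0) (hεa : εa = 1 ∨ εa = -1)
    (hεb : εb = 1 ∨ εb = -1)
    (hαadj : ∀ x y : complexBetti A.X 1, polarizationPairingOne A.X h (A.dim - 1) (pullbackOne A α x) y =
      εa • polarizationPairingOne A.X h (A.dim - 1) x (pullbackOne A α y))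
    (hβadj : ∀ x y : complexBetti A.X 1, polarizationPairingOne A.X h (A.dim - 1) (pullbackOne A β x) y =
      εb • polarizationPairingOne A.X h (A.dim - 1) x (pullbackOne A β y))
    (hD : ∀ g : A ⟶ A, ∃ N : ℤ, N ≠ 0 ∧ End.of (N • g) ∈ Subring.closure {End.of ψ, End.of α, End.of β})
    (hPm : P.Monic) (hPe : P.natDegree = e) (hPirr : Irreducible (P.map (Int.castRingHom ℚ)))
    (hφ : Polynomial.eval₂ (Int.castRingHom (CategoryTheory.End (⨁ (fun _ : Fin (n + 1) => A))))
      (φ : CategoryTheory.End (⨁ (fun _ : Fin (n + 1) => A))) P = 0)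
    (her : e * (2 * m) = 2 * ((n + 1) * A.dim)) (hm : m ≠ 0) :
    weilClassesField (⨁ (fun _ : Fin (n + 1) => A)) φ P (2 * m) ≤
        divisorClassesSpan (⨁ (fun _ : Fin (n + 1) => A)).X (⨁ (fun _ : Fin (n + 1) => A)).dim m ↔
      ∀ ρ : ℂ, Polynomial.eval₂ (Int.castRingHom ℂ) ρ P = 0 → ∀ σ : ℂ,
        Module.finrank ℂ ↥((pullbackOne (⨁ (fun _ : Fin (n + 1) => A)) φ).eigenspace ρ ⊓
          (pullbackOne (⨁ (fun _ : Fin (n + 1) => A)) (biproduct.map fun _ : Fin (n + 1) => ψ)).eigenspace σ) =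
        Module.finrank ℂ ↥((pullbackOne (⨁ (fun _ : Fin (n + 1) => A)) φ).eigenspace ρ ⊓
          (pullbackOne (⨁ (fun _ : Fin (n + 1) => A)) (biproduct.map fun _ : Fin (n + 1) => ψ')).eigenspace σ) :=
  weilClassesField_biproduct_le_divisorClassesSpan_iff_forall_finrank_eq_of_central_quaternionOver_CMField hA hh htop hnd hψ hRm
    hRirr hψR (pullbackOne_mem_adjoin_singleton_of_exists_zsmul_mem_closure_singleton hψ'E) hadj
    (eigenspace_inf_eigenspace_eq_bot_of_ne_of_exists_zsmul_mem_closure_singleton hRm hRirr hψR hψ'E hne)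
    (pullbackOne_mul_comm_of_central hψ α) (pullbackOne_mul_comm_of_central hψ β) hanti hα2 hqa hβ2 hqb hεa hεb hαadj hβadj
    hPm hPe hPirr hφ her hm (pullbackOne_mem_adjoin_diagonal_of_forall_exists_zsmul_mem_closure_triple hD φ)

/-- **… «ALL NON-ZERO CLASSES OF `W_F(A^{n+1})` EXCEPTIONAL ⟺ `θ ≠ 0`», TYPE 4 WITH `d = 2`, FROM `End(A)`.**
[cite: MoonenZarhin1998WeilClasses, §1 Criterion (2), case «Y is of Type 4 with d ≥ 2 or m ≥ 2 and the map θ … is non-zero» and its proof (chunk p0003 L46–L80)]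
[cite: Milne1999LefschetzClasses, §1 p. 643, Thm. 3.2, Cor. 4.5] -/
theorem weilClassesField_biproduct_inf_divisorClassesSpan_eq_bot_iff_exists_finrank_ne_of_quaternionOverCMField_End
    (hA : 0 < A.dim) (hh : h ∈ hodgeClassSpan A.dim A.X 1) (htop : lefschetzPow h (A.dim - 1) 2 h ≠ 0)
    (hnd : ∀ x : complexBetti A.X 1, (∀ y, polarizationPairingOne A.X h (A.dim - 1) x y = 0) → x = 0)
    (hψ : ∀ χ : A ⟶ A, ψ ≫ χ = χ ≫ ψ) (hRm : R.Monic) (hRirr : Irreducible (R.map (Int.castRingHom ℚ)))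
    (hψR : Polynomial.eval₂ (Int.castRingHom (CategoryTheory.End A)) (ψ : CategoryTheory.End A) R = 0)
    (hadj : ∀ x y : complexBetti A.X 1, polarizationPairingOne A.X h (A.dim - 1) (pullbackOne A ψ x) y =
      polarizationPairingOne A.X h (A.dim - 1) x (pullbackOne A ψ' y))
    (hψ'E : ∃ N : ℤ, N ≠ 0 ∧ End.of (N • ψ') ∈ Subring.closure {End.of ψ}) (hne : ψ' ≠ ψ)
    (hanti : pullbackOne A α * pullbackOne A β = -(pullbackOne A β * pullbackOne A α))
    (hα2 : pullbackOne A α * pullbackOne A α = aeval (pullbackOne A ψ) qa)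
    (hqa : ∀ z : ℂ, (R.map (Int.castRingHom ℂ)).IsRoot z → qa.eval z ≠ 0)
    (hβ2 : pullbackOne A β * pullbackOne A β = aeval (pullbackOne A ψ) qb)
    (hqb : ∀ z : ℂ, (R.map (Int.castRingHom ℂ)).IsRoot z → qb.eval z ≠ 0) (hεa : εa = 1 ∨ εa = -1)
    (hεb : εb = 1 ∨ εb = -1)
    (hαadj : ∀ x y : complexBetti A.X 1, polarizationPairingOne A.X h (A.dim - 1) (pullbackOne A α x) y =
      εa • polarizationPairingOne A.X h (A.dim - 1) x (pullbackOne A α y))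
    (hβadj : ∀ x y : complexBetti A.X 1, polarizationPairingOne A.X h (A.dim - 1) (pullbackOne A β x) y =
      εb • polarizationPairingOne A.X h (A.dim - 1) x (pullbackOne A β y))
    (hD : ∀ g : A ⟶ A, ∃ N : ℤ, N ≠ 0 ∧ End.of (N • g) ∈ Subring.closure {End.of ψ, End.of α, End.of β})
    (hPm : P.Monic) (hPe : P.natDegree = e) (hPirr : Irreducible (P.map (Int.castRingHom ℚ)))
    (hφ : Polynomial.eval₂ (Int.castRingHom (CategoryTheory.End (⨁ (fun _ : Fin (n + 1) => A))))
      (φ : CategoryTheory.End (⨁ (fun _ : Fin (n + 1) => A))) P = 0)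
    (her : e * (2 * m) = 2 * ((n + 1) * A.dim)) (hm : m ≠ 0) :
    weilClassesField (⨁ (fun _ : Fin (n + 1) => A)) φ P (2 * m) ⊓
        divisorClassesSpan (⨁ (fun _ : Fin (n + 1) => A)).X (⨁ (fun _ : Fin (n + 1) => A)).dim m = ⊥ ↔
      ∃ ρ σ : ℂ, Polynomial.eval₂ (Int.castRingHom ℂ) ρ P = 0 ∧
        Module.finrank ℂ ↥((pullbackOne (⨁ (fun _ : Fin (n + 1) => A)) φ).eigenspace ρ ⊓
          (pullbackOne (⨁ (fun _ : Fin (n + 1) => A)) (biproduct.map fun _ : Fin (n + 1) => ψ)).eigenspace σ) ≠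
        Module.finrank ℂ ↥((pullbackOne (⨁ (fun _ : Fin (n + 1) => A)) φ).eigenspace ρ ⊓
          (pullbackOne (⨁ (fun _ : Fin (n + 1) => A)) (biproduct.map fun _ : Fin (n + 1) => ψ')).eigenspace σ) :=
  weilClassesField_biproduct_inf_divisorClassesSpan_eq_bot_iff_exists_finrank_ne_of_central_quaternionOver_CMField hA hh htop hnd
    hψ hRm hRirr hψR (pullbackOne_mem_adjoin_singleton_of_exists_zsmul_mem_closure_singleton hψ'E) hadj
    (eigenspace_inf_eigenspace_eq_bot_of_ne_of_exists_zsmul_mem_closure_singleton hRm hRirr hψR hψ'E hne)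
    (pullbackOne_mul_comm_of_central hψ α) (pullbackOne_mul_comm_of_central hψ β) hanti hα2 hqa hβ2 hqb hεa hεb hαadj hβadj
    hPm hPe hPirr hφ her hm (pullbackOne_mem_adjoin_diagonal_of_forall_exists_zsmul_mem_closure_triple hD φ)

/-- **… THE DICHOTOMY FOR `W_F(A^{n+1})`, TYPE 4 WITH `d = 2`, FROM `End(A)`**, for every `φ ∈ End(A^{n+1})`.
[cite: MoonenZarhin1998WeilClasses, §1 Criterion (2) (chunk p0003 L46–L60)] -/
theorem weilClassesField_biproduct_le_or_inf_divisorClassesSpan_eq_bot_of_quaternionOverCMField_End (hA : 0 < A.dim)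
    (hh : h ∈ hodgeClassSpan A.dim A.X 1) (htop : lefschetzPow h (A.dim - 1) 2 h ≠ 0)
    (hnd : ∀ x : complexBetti A.X 1, (∀ y, polarizationPairingOne A.X h (A.dim - 1) x y = 0) → x = 0)
    (hψ : ∀ χ : A ⟶ A, ψ ≫ χ = χ ≫ ψ) (hRm : R.Monic) (hRirr : Irreducible (R.map (Int.castRingHom ℚ)))
    (hψR : Polynomial.eval₂ (Int.castRingHom (CategoryTheory.End A)) (ψ : CategoryTheory.End A) R = 0)
    (hadj : ∀ x y : complexBetti A.X 1, polarizationPairingOne A.X h (A.dim - 1) (pullbackOne A ψ x) y =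
      polarizationPairingOne A.X h (A.dim - 1) x (pullbackOne A ψ' y))
    (hψ'E : ∃ N : ℤ, N ≠ 0 ∧ End.of (N • ψ') ∈ Subring.closure {End.of ψ}) (hne : ψ' ≠ ψ)
    (hanti : pullbackOne A α * pullbackOne A β = -(pullbackOne A β * pullbackOne A α))
    (hα2 : pullbackOne A α * pullbackOne A α = aeval (pullbackOne A ψ) qa)
    (hqa : ∀ z : ℂ, (R.map (Int.castRingHom ℂ)).IsRoot z → qa.eval z ≠ 0)
    (hβ2 : pullbackOne A β * pullbackOne A β = aeval (pullbackOne A ψ) qb)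
    (hqb : ∀ z : ℂ, (R.map (Int.castRingHom ℂ)).IsRoot z → qb.eval z ≠ 0) (hεa : εa = 1 ∨ εa = -1)
    (hεb : εb = 1 ∨ εb = -1)
    (hαadj : ∀ x y : complexBetti A.X 1, polarizationPairingOne A.X h (A.dim - 1) (pullbackOne A α x) y =
      εa • polarizationPairingOne A.X h (A.dim - 1) x (pullbackOne A α y))
    (hβadj : ∀ x y : complexBetti A.X 1, polarizationPairingOne A.X h (A.dim - 1) (pullbackOne A β x) y =
      εb • polarizationPairingOne A.X h (A.dim - 1) x (pullbackOne A β y))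
    (hD : ∀ g : A ⟶ A, ∃ N : ℤ, N ≠ 0 ∧ End.of (N • g) ∈ Subring.closure {End.of ψ, End.of α, End.of β})
    (hPm : P.Monic) (hPe : P.natDegree = e) (hPirr : Irreducible (P.map (Int.castRingHom ℚ)))
    (hφ : Polynomial.eval₂ (Int.castRingHom (CategoryTheory.End (⨁ (fun _ : Fin (n + 1) => A))))
      (φ : CategoryTheory.End (⨁ (fun _ : Fin (n + 1) => A))) P = 0)
    (her : e * (2 * m) = 2 * ((n + 1) * A.dim)) (hm : m ≠ 0) :
    weilClassesField (⨁ (fun _ : Fin (n + 1) => A)) φ P (2 * m) ≤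
        divisorClassesSpan (⨁ (fun _ : Fin (n + 1) => A)).X (⨁ (fun _ : Fin (n + 1) => A)).dim m ∨
      weilClassesField (⨁ (fun _ : Fin (n + 1) => A)) φ P (2 * m) ⊓
        divisorClassesSpan (⨁ (fun _ : Fin (n + 1) => A)).X (⨁ (fun _ : Fin (n + 1) => A)).dim m = ⊥ :=
  weilClassesField_biproduct_le_or_inf_divisorClassesSpan_eq_bot_of_central_quaternionOver_CMField hA hh htop hnd hψ hRm hRirr
    hψR (pullbackOne_mem_adjoin_singleton_of_exists_zsmul_mem_closure_singleton hψ'E) hadj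
    (eigenspace_inf_eigenspace_eq_bot_of_ne_of_exists_zsmul_mem_closure_singleton hRm hRirr hψR hψ'E hne)
    (pullbackOne_mul_comm_of_central hψ α) (pullbackOne_mul_comm_of_central hψ β) hanti hα2 hqa hβ2 hqb hεa hεb hαadj hβadj
    hPm hPe hPirr hφ her hm (pullbackOne_mem_adjoin_diagonal_of_forall_exists_zsmul_mem_closure_triple hD φ)

end EndLevelPowers

end Literature.AlgebraicGeometry.HodgeTheory

end
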